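import Literature.AlgebraicGeometry.Shioda1982.PicardNumberTwicePrime
import Mathlib.Tactic.NormNum.Prime
import HarnessLib

/-!
# The pair-free Hodge `4`-multisets of level `6p` (`p ≥ 17` prime) in Chinese-remainder coordinates

Topic `Literature/AlgebraicGeometry/Shioda1982`; the technical half of `PicardNumberSixPrime.lean` (Shioda 1982, Lemma 1 / Prop. 4
(Q′) and Aoki–Shioda 1983, Theorem (𝔅²ₘ) (ii) at the levels `m = 6p`), kept in its own file for size. THEOREM (no named fact, no
`sorry`): **`classify_hodgeMultiset_sixPrime`** — a pair-free Hodge `4`-multiset `s` over `ℤ/6p`, `p ≥ 17` prime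
(`IsHodgeMultiset s`, Shioda's semigroup condition), is `{x, x + 3p, −2x, 3p}`, `{x, x + 3p, 2x + 3p, −4x}` or
`{x, x + 2p, x + 4p, −3x}` for some residue `x` (the multisets of values of Shioda's `αᵢ, βᵢ` with `m′ = 3p` and `γⱼ` with
`m″ = 2p` [cite: Shioda1982PicardFermat, §4 Lemma 1 p. 728, Prop. 4 (Q′) p. 729]; [cite: AokiShioda1983, §2 Theorem (𝔅²ₘ) (ii) a)–c)]).

## The proof (ours — Koblitz–Ogus in Chinese-remainder coordinates; NOT the printed inductive-structure argument)

Koblitz–Ogus in the tree's PROVED linear-algebra form `KoblitzOgus.hodge_eq_combination` [cite: Deligne1982HodgeCycles, Rem. 7.16 (a)]: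
the multiplicity function of a Hodge multiset over `ℤ/6p` is a `ℚ`-combination of reflection vectors and distribution vectors
`D_{M,z}`, `M ∣ 6p`. Identify `ℤ/6p ≅ ℤ/6 × ℤ/p` (`crt`, `pt`); write `o(e, c) = #_{(e,c)} − #_{(−e,−c)}` and, on the fibre
`c ∈ ℤ/p`, `U(c) = o(1,c) + o(−1,c)`, `E(c) = o(2,c) + o(−2,c)`, `T(c) = o(3,c)`, `S(c) = o(0,c)`, `U⁻(c) = o(1,c) − o(−1,c)`,
`E⁻(c) = o(2,c) − o(−2,c)`. Two functionals kill every `D_{M,z}` (`LI_koD`, `LII_koD`, checked divisor by divisor):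
(I) `U(b) − U(2b) + E(2b) − U(3b) + 2T(3b) + U(6b) − E(6b) − 2T(6b) + 2S(6b) = 0` (`b ≠ 0`) — the relations of the odd
characters `χψ`, `ψ` odd mod `p`, in Aoki's criterion [cite: Aoki1983, Prop. 2.2] —, and (II) `Γ(b) = U⁻(b) + U⁻(2b) + E⁻(2b)` is
constant on `b ≠ 0` (the characters `χ₃ψ`, `ψ` even); a trivial-character count (`relII_and_balance`: a `4`-element multiset cannot
feed a non-zero constant on `p − 1 ≥ 16` fibres) gives `Γ ≡ 0` and the balance identity `2(n₁ − n₋₁) + (n₂ − n₋₂) = 0` for the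
numbers `n_e` of members of unit/even type off the fibre `0`. The classification of the "Good" coordinate multisets
(`classify_coord`) is an elementary case analysis using only `k·b ≠ 0` in `ℤ/p` for `0 < |k| ≤ 16` (and composite `|k| < 34`),
whence `p ≥ 17`: a member `(3, d)` off the fibre `0` leads to `β`- or `α`-type multisets (`classify_T`), a member `(±2, c)` without
unit-type members to `γ` (`classify_E`), and a unit-type member `(±1, b)` — after the symmetry `(e,c) ↦ (−e,c)` and sorting the
other three members by balance weight — to one of four patterns (`classify_U_UUUU`: impossible, via `U⁻(2x) = −U⁻(x)` and the
fibre sum `(1 ± 2 ± 4 ± 8)b ≠ 0`; `classify_U_UE`: `β`; `classify_U_UU`: `γ`; `classify_U_EE`: `α`). All members on the fibre `0`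
(multiples of `p`): the norm at `t = 1` gives `α_{±p}` (`fibre_zero`). Transport back along `crt`: `classify_hodgeMultiset_sixPrime`.
Numerical companions (cell `pub-hfermat`, outside Lean): `code/lit/picard/scope_6p.py` (the `130` indecomposable Hodge multisets
of level `102` are exactly the three families); the relations (I), (II) hold on every Hodge quadruple of the levels `102, 114, 138`.

HONEST FRAMING (cell `pub-hfermat`): explicit algebraic cycles for specific Hodge classes on Fermat/Delsarte varieties; residual open
instances listed; no claim on general Hodge. (This file reproduces a printed structure theorem; the proof route is this formalisation's.)
-/

namespace Literature.AlgebraicGeometry.Shioda1982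

open Finset Multiset
open Literature.AlgebraicGeometry.HodgeTheory Literature.AlgebraicGeometry.HodgeTheory.FermatCharacter

section SixPrime

variable {p : ℕ}

set_option linter.unusedSimpArgs false -- uniform simp sets across the generated case tables of §5 (lint debt)

/-! ### `ℤ/6p ≅ ℤ/6 × ℤ/p`: Chinese-remainder coordinates -/

/-- `(6, p) = 1` for a prime `p ≥ 5`. [folklore] -/
private theorem coprime_six (hp : p.Prime) (h5 : 5 ≤ p) : Nat.Coprime 6 p := by
  have h2 : Nat.Coprime 2 p := (Nat.coprime_primes Nat.prime_two hp).2 (by omega)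
  have h3 : Nat.Coprime 3 p := (Nat.coprime_primes Nat.prime_three hp).2 (by omega)
  exact Nat.Coprime.mul_left h2 h3

/-- The Chinese-remainder isomorphism `ℤ/6p ≃+* ℤ/6 × ℤ/p`. [folklore] -/
private def crt (h : Nat.Coprime 6 p) : ZMod (6 * p) ≃+* ZMod 6 × ZMod p := ZMod.chineseRemainder h

/-- The residue with coordinates `(e, b)`. [folklore] -/
private def pt (h : Nat.Coprime 6 p) (e : ZMod 6) (b : ZMod p) : ZMod (6 * p) := (crt h).symm (e, b)

/-- First coordinate = residue mod `6`. [folklore] -/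
private theorem crt_fst (h : Nat.Coprime 6 p) [NeZero (6 * p)] (w : ZMod (6 * p)) :
    (crt h w).1 = (w.val : ZMod 6) := by
  conv_lhs => rw [← ZMod.natCast_zmod_val w]
  rw [map_natCast, Prod.fst_natCast]

/-- Second coordinate = residue mod `p`. [folklore] -/
private theorem crt_snd (h : Nat.Coprime 6 p) [NeZero (6 * p)] (w : ZMod (6 * p)) :
    (crt h w).2 = (w.val : ZMod p) := by
  conv_lhs => rw [← ZMod.natCast_zmod_val w]
  rw [map_natCast, Prod.snd_natCast]

/-- `crt (pt e b) = (e, b)`. [folklore] -/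
private theorem crt_pt (h : Nat.Coprime 6 p) (e : ZMod 6) (b : ZMod p) : crt h (pt h e b) = (e, b) :=
  (crt h).apply_symm_apply (e, b)

/-- `pt (crt w) = w`. [folklore] -/
private theorem pt_crt (h : Nat.Coprime 6 p) (w : ZMod (6 * p)) : pt h (crt h w).1 (crt h w).2 = w :=
  (crt h).symm_apply_apply w

/-- `pt` is injective. [folklore] -/
private theorem pt_inj (h : Nat.Coprime 6 p) {e e' : ZMod 6} {b b' : ZMod p} :
    pt h e b = pt h e' b' ↔ e = e' ∧ b = b' := by
  rw [pt, pt, (crt h).symm.injective.eq_iff, Prod.mk.injEq]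

/-- `pt` is additive. [folklore] -/
private theorem pt_add (h : Nat.Coprime 6 p) (e e' : ZMod 6) (b b' : ZMod p) :
    pt h e b + pt h e' b' = pt h (e + e') (b + b') := by
  rw [pt, pt, pt, ← (crt h).symm.map_add, Prod.mk_add_mk]

/-- `pt` and negation. [folklore] -/
private theorem neg_pt (h : Nat.Coprime 6 p) (e : ZMod 6) (b : ZMod p) : -pt h e b = pt h (-e) (-b) := by
  rw [pt, pt, ← (crt h).symm.map_neg, Prod.neg_mk]

/-- `pt` and natural multiples. [folklore] -/
private theorem natCast_mul_pt (h : Nat.Coprime 6 p) (k : ℕ) (e : ZMod 6) (b : ZMod p) :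
    (k : ZMod (6 * p)) * pt h e b = pt h (k * e) (k * b) := by
  rw [pt, pt, ← nsmul_eq_mul, ← _root_.map_nsmul, Prod.smul_mk, nsmul_eq_mul, nsmul_eq_mul]

/-- `⟨pt e b⟩ mod 6` is `⟨e⟩`. [folklore] -/
private theorem val_pt_mod_six (h : Nat.Coprime 6 p) [NeZero (6 * p)] (e : ZMod 6) (b : ZMod p) :
    (pt h e b).val % 6 = e.val := by
  have := crt_fst h (pt h e b)
  rw [crt_pt] at this
  have h2 := congrArg ZMod.val this
  rw [ZMod.val_natCast] at h2
  exact h2.symm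

/-- `⟨pt e b⟩ mod p` is `⟨b⟩`. [folklore] -/
private theorem val_pt_mod_p (h : Nat.Coprime 6 p) [NeZero (6 * p)] [NeZero p] (e : ZMod 6) (b : ZMod p) :
    (pt h e b).val % p = b.val := by
  have := crt_snd h (pt h e b)
  rw [crt_pt] at this
  have h2 := congrArg ZMod.val this
  rw [ZMod.val_natCast] at h2
  exact h2.symm

/-- The prime `p` as a residue mod `6`. -/
local notation "π" => ((p : ℕ) : ZMod 6)

/-- `crt p = (p mod 6, 0)`. [folklore] -/
private theorem crt_P (h : Nat.Coprime 6 p) [NeZero (6 * p)] : crt h (p : ZMod (6 * p)) = (π, 0) := by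
  rw [Prod.ext_iff, crt_fst, crt_snd, ZMod.val_natCast]
  have hp6 : p % (6 * p) = p := Nat.mod_eq_of_lt (by have := NeZero.ne (6 * p); omega)
  rw [hp6]
  exact ⟨rfl, ZMod.natCast_self p⟩

/-- `p = pt (p mod 6) 0`. [folklore] -/
private theorem P_eq_pt (h : Nat.Coprime 6 p) [NeZero (6 * p)] : (p : ZMod (6 * p)) = pt h π 0 := by
  rw [← pt_crt h (p : ZMod (6 * p)), crt_P]

/-- `p mod 6 ∈ {1, 5}` for a prime `p ≥ 5`. [folklore] -/
private theorem pi_eq (hp : p.Prime) (h5 : 5 ≤ p) : π = 1 ∨ π = -1 := by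
  have h2 : ¬ 2 ∣ p := fun h ↦ by
    have := (Nat.prime_dvd_prime_iff_eq Nat.prime_two hp).1 h; omega
  have h3 : ¬ 3 ∣ p := fun h ↦ by
    have := (Nat.prime_dvd_prime_iff_eq Nat.prime_three hp).1 h; omega
  have h6 : p % 6 = 1 ∨ p % 6 = 5 := by omega
  rw [← ZMod.natCast_mod p 6]
  rcases h6 with h6 | h6 <;> rw [h6]
  · exact Or.inl rfl
  · exact Or.inr (by decide)

/-- `π ≠ 0, −π ≠ 0, 2π ≠ 0, −2π ≠ 0, 3 ≠ 0` in `ℤ/6` (`π = ±1`). [folklore] -/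
private theorem pi_facts (hp : p.Prime) (h5 : 5 ≤ p) :
    (π : ZMod 6) ≠ 0 ∧ (-π : ZMod 6) ≠ 0 ∧ (2 * π : ZMod 6) ≠ 0 ∧ (-(2 * π) : ZMod 6) ≠ 0 ∧
      π * π = 1 ∧ (3 * π : ZMod 6) = 3 := by
  rcases pi_eq hp h5 with h | h <;> rw [h] <;> decide

/-! ### The Koblitz–Ogus distribution vectors in Chinese-remainder coordinates -/

/-- The Koblitz–Ogus distribution vector of level `M ∣ 6p` through `z` (as in `KoblitzOgus.hodge_eq_combination`):
`w ↦ [w ≡ z (mod M)] − [(6p/M)·z = w]`. [cite: Deligne1982HodgeCycles, Rem. 7.16 (a)] -/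
private def koD (N : ℕ) (M : ℕ) (z w : ZMod N) : ℚ :=
  (if w.val % M = z.val % M then (1 : ℚ) else 0) - (if ((N / M : ℕ) : ZMod N) * z = w then 1 else 0)

/-- The divisors of `6p`. [folklore] -/
private theorem eq_of_dvd_six_mul_prime (hp : p.Prime) (h5 : 5 ≤ p) {M : ℕ} (hM : M ∣ 6 * p) :
    M = 1 ∨ M = 2 ∨ M = 3 ∨ M = 6 ∨ M = p ∨ M = 2 * p ∨ M = 3 * p ∨ M = 6 * p := by
  have h6 := coprime_six hp h5
  obtain ⟨a, b, ha, hb, rfl⟩ := (Nat.dvd_mul.1 hM)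
  have ha' : a = 1 ∨ a = 2 ∨ a = 3 ∨ a = 6 := by
    have := Nat.le_of_dvd (by norm_num) ha
    interval_cases a <;> simp_all
  rcases (Nat.dvd_prime hp).1 hb with rfl | rfl <;> rcases ha' with rfl | rfl | rfl | rfl <;> simp

/-- Congruence mod `6` in coordinates. [folklore] -/
private theorem mod_six_iff (h : Nat.Coprime 6 p) [NeZero (6 * p)] (w z : ZMod (6 * p)) :
    w.val % 6 = z.val % 6 ↔ (crt h w).1 = (crt h z).1 := by
  rw [crt_fst, crt_fst, ZMod.natCast_eq_natCast_iff']

/-- Congruence mod `p` in coordinates. [folklore] -/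
private theorem mod_p_iff (h : Nat.Coprime 6 p) [NeZero (6 * p)] (w z : ZMod (6 * p)) :
    w.val % p = z.val % p ↔ (crt h w).2 = (crt h z).2 := by
  rw [crt_snd, crt_snd, ZMod.natCast_eq_natCast_iff']

/-- Congruence mod `2` in coordinates. [folklore] -/
private theorem mod_two_iff (h : Nat.Coprime 6 p) [NeZero (6 * p)] (w z : ZMod (6 * p)) :
    w.val % 2 = z.val % 2 ↔ (crt h w).1.val % 2 = (crt h z).1.val % 2 := by
  rw [crt_fst, crt_fst, ZMod.val_natCast, ZMod.val_natCast, Nat.mod_mod_of_dvd _ (by norm_num : 2 ∣ 6),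
    Nat.mod_mod_of_dvd _ (by norm_num : 2 ∣ 6)]

/-- Congruence mod `3` in coordinates. [folklore] -/
private theorem mod_three_iff (h : Nat.Coprime 6 p) [NeZero (6 * p)] (w z : ZMod (6 * p)) :
    w.val % 3 = z.val % 3 ↔ (crt h w).1.val % 3 = (crt h z).1.val % 3 := by
  rw [crt_fst, crt_fst, ZMod.val_natCast, ZMod.val_natCast, Nat.mod_mod_of_dvd _ (by norm_num : 3 ∣ 6),
    Nat.mod_mod_of_dvd _ (by norm_num : 3 ∣ 6)]

/-- Congruence mod `2p` in coordinates. [folklore] -/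
private theorem mod_twoP_iff (h : Nat.Coprime 6 p) [NeZero (6 * p)] (w z : ZMod (6 * p)) :
    w.val % (2 * p) = z.val % (2 * p) ↔ (crt h w).1.val % 2 = (crt h z).1.val % 2 ∧ (crt h w).2 = (crt h z).2 := by
  have h2 : Nat.Coprime 2 p := Nat.Coprime.coprime_dvd_left (by norm_num : 2 ∣ 6) h
  rw [← mod_two_iff, ← mod_p_iff]
  exact (Nat.modEq_and_modEq_iff_modEq_mul h2).symm

/-- Congruence mod `3p` in coordinates. [folklore] -/
private theorem mod_threeP_iff (h : Nat.Coprime 6 p) [NeZero (6 * p)] (w z : ZMod (6 * p)) :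
    w.val % (3 * p) = z.val % (3 * p) ↔ (crt h w).1.val % 3 = (crt h z).1.val % 3 ∧ (crt h w).2 = (crt h z).2 := by
  have h3 : Nat.Coprime 3 p := Nat.Coprime.coprime_dvd_left (by norm_num : 3 ∣ 6) h
  rw [← mod_three_iff, ← mod_p_iff]
  exact (Nat.modEq_and_modEq_iff_modEq_mul h3).symm

/-- A multiple of `z = pt e b` in coordinates. [folklore] -/
private theorem natCast_mul_eq_pt_iff (h : Nat.Coprime 6 p) (k : ℕ) (ez e : ZMod 6) (bz c : ZMod p) :
    (k : ZMod (6 * p)) * pt h ez bz = pt h e c ↔ (k : ZMod 6) * ez = e ∧ (k : ZMod p) * bz = c := by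
  rw [natCast_mul_pt, pt_inj]

/-- Cancellation by `2, 3, 6` in `ℤ/p`, `p ≥ 5` prime, in the orientations used below. [folklore] -/
private theorem cancel_facts (hp : p.Prime) (h5 : 5 ≤ p) (b x : ZMod p) :
    (6 * x = 6 * b ↔ b = x) ∧ (6 * x = -(6 * b) ↔ -b = x) ∧
    (3 * x = 3 * b ↔ b = x) ∧ (3 * x = -(3 * b) ↔ -b = x) ∧
    (3 * x = 6 * b ↔ 2 * b = x) ∧ (3 * x = -(6 * b) ↔ -(2 * b) = x) ∧
    (2 * x = 2 * b ↔ b = x) ∧ (2 * x = -(2 * b) ↔ -b = x) ∧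
    (2 * x = 6 * b ↔ 3 * b = x) ∧ (2 * x = -(6 * b) ↔ -(3 * b) = x) := by
  haveI := Fact.mk hp
  have h2 : (2 : ZMod p) ≠ 0 := by
    intro h0
    have := (ZMod.natCast_eq_zero_iff 2 p).1 (by exact_mod_cast h0)
    exact absurd (Nat.le_of_dvd (by norm_num) this) (by omega)
  have h3 : (3 : ZMod p) ≠ 0 := by
    intro h0
    have := (ZMod.natCast_eq_zero_iff 3 p).1 (by exact_mod_cast h0)
    exact absurd (Nat.le_of_dvd (by norm_num) this) (by omega)
  have h6 : (6 : ZMod p) ≠ 0 := by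
    rw [show (6 : ZMod p) = 2 * 3 by norm_num]; exact mul_ne_zero h2 h3
  have key : ∀ {k : ZMod p}, k ≠ 0 → ∀ u v : ZMod p, (k * x = k * u ↔ u = x) := fun hk u v ↦
    ⟨fun e ↦ (mul_left_cancel₀ hk e).symm, fun e ↦ by rw [e]⟩
  refine ⟨key h6 b b, ?_, key h3 b b, ?_, ?_, ?_, key h2 b b, ?_, ?_, ?_⟩
  · rw [show -(6 * b) = 6 * (-b) by ring]; exact key h6 _ b
  · rw [show -(3 * b) = 3 * (-b) by ring]; exact key h3 _ b
  · rw [show (6 : ZMod p) * b = 3 * (2 * b) by ring]; exact key h3 _ b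
  · rw [show -(6 * b) = 3 * (-(2 * b)) by ring]; exact key h3 _ b
  · rw [show -(2 * b) = 2 * (-b) by ring]; exact key h2 _ b
  · rw [show (6 : ZMod p) * b = 2 * (3 * b) by ring]; exact key h2 _ b
  · rw [show -(6 * b) = 2 * (-(3 * b)) by ring]; exact key h2 _ b

/-- `b, 2b, 3b, 6b ≠ 0` for `b ≠ 0` in `ℤ/p`, `p ≥ 5`. [folklore] -/
private theorem mul_ne_zero_facts (hp : p.Prime) (h5 : 5 ≤ p) {b : ZMod p} (hb : b ≠ 0) :
    (2 * b ≠ 0) ∧ (3 * b ≠ 0) ∧ (6 * b ≠ 0) := by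
  obtain ⟨c1, -, c3, -, -, -, c7, -⟩ := cancel_facts hp h5 (0 : ZMod p) b
  refine ⟨fun e ↦ hb ?_, fun e ↦ hb ?_, fun e ↦ hb ?_⟩
  · exact (c7.1 (by rw [e, mul_zero])).symm
  · exact (c3.1 (by rw [e, mul_zero])).symm
  · exact (c1.1 (by rw [e, mul_zero])).symm

/-! ### The two Koblitz–Ogus functionals of level `6p` -/

/-- `ĝ(w) = g(w) − g(−w)`: twice the odd part. [folklore] -/
private def hat (g : ZMod (6 * p) → ℚ) (w : ZMod (6 * p)) : ℚ := g w - g (-w)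

/-- The unit part of the fibre `c`: `ĝ(π, c) + ĝ(−π, c)`. [folklore] -/
private def Upart (h : Nat.Coprime 6 p) (g : ZMod (6 * p) → ℚ) (c : ZMod p) : ℚ :=
  hat g (pt h π c) + hat g (pt h (-π) c)

/-- The even, prime-to-`3` part of the fibre `c`: `ĝ(2π, c) + ĝ(−2π, c)`. [folklore] -/
private def Epart (h : Nat.Coprime 6 p) (g : ZMod (6 * p) → ℚ) (c : ZMod p) : ℚ :=
  hat g (pt h (2 * π) c) + hat g (pt h (-(2 * π)) c)

/-- The odd multiple-of-`3` point of the fibre `c`: `ĝ(3, c)`. [folklore] -/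
private def Tpart (h : Nat.Coprime 6 p) (g : ZMod (6 * p) → ℚ) (c : ZMod p) : ℚ := hat g (pt h 3 c)

/-- The multiple-of-`6` point of the fibre `c`: `ĝ(0, c)`. [folklore] -/
private def Spart (h : Nat.Coprime 6 p) (g : ZMod (6 * p) → ℚ) (c : ZMod p) : ℚ := hat g (pt h 0 c)

/-- The signed unit part of the fibre `c`: `ĝ(π, c) − ĝ(−π, c)`. [folklore] -/
private def Uminus (h : Nat.Coprime 6 p) (g : ZMod (6 * p) → ℚ) (c : ZMod p) : ℚ :=
  hat g (pt h π c) - hat g (pt h (-π) c)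

/-- The signed even part of the fibre `c`: `ĝ(2π, c) − ĝ(−2π, c)`. [folklore] -/
private def Eminus (h : Nat.Coprime 6 p) (g : ZMod (6 * p) → ℚ) (c : ZMod p) : ℚ :=
  hat g (pt h (2 * π) c) - hat g (pt h (-(2 * π)) c)

/-- **The odd-character functional** `L_I(b) = U(b) − U(2b) + E(2b) − U(3b) + 2T(3b) + U(6b) − E(6b) − 2T(6b) + 2S(6b)`
(the sum over the odd characters `ψ` of `(ℤ/p)ˣ` of the `ψ`-lines of the relation module). [folklore] -/
private def LI (h : Nat.Coprime 6 p) (g : ZMod (6 * p) → ℚ) (b : ZMod p) : ℚ :=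
  Upart h g b - Upart h g (2 * b) + Epart h g (2 * b) - Upart h g (3 * b) + 2 * Tpart h g (3 * b)
    + Upart h g (6 * b) - Epart h g (6 * b) - 2 * Tpart h g (6 * b) + 2 * Spart h g (6 * b)

/-- `Γ(b) = U⁻(b) + U⁻(2b) + E⁻(2b)`. [folklore] -/
private def Gam (h : Nat.Coprime 6 p) (g : ZMod (6 * p) → ℚ) (b : ZMod p) : ℚ :=
  Uminus h g b + Uminus h g (2 * b) + Eminus h g (2 * b)

/-- **The `χ₃ψ`-functional** `L_II(b, b′) = Γ(b) − Γ(b′)` (even characters `ψ ≠ 1` of `(ℤ/p)ˣ`). [folklore] -/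
private def LII (h : Nat.Coprime 6 p) (g : ZMod (6 * p) → ℚ) (b b' : ZMod p) : ℚ := Gam h g b - Gam h g b'

/-- `ĝ` is additive. [folklore] -/
private theorem hat_add (g g' : ZMod (6 * p) → ℚ) (w : ZMod (6 * p)) :
    hat (fun z ↦ g z + g' z) w = hat g w + hat g' w := by
  simp only [hat]; ring

/-- `ĝ` is homogeneous. [folklore] -/
private theorem hat_smul (a : ℚ) (g : ZMod (6 * p) → ℚ) (w : ZMod (6 * p)) :
    hat (fun z ↦ a * g z) w = a * hat g w := by
  simp only [hat]; ring

/-- `ĝ` commutes with sums. [folklore] -/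
private theorem hat_sum {ι : Type} (t : Finset ι) (g : ι → ZMod (6 * p) → ℚ) (w : ZMod (6 * p)) :
    hat (fun z ↦ ∑ i ∈ t, g i z) w = ∑ i ∈ t, hat (g i) w := by
  simp only [hat, Finset.sum_sub_distrib]

/-- `ĝ = 0` for negation-invariant `g`. [folklore] -/
private theorem hat_even {g : ZMod (6 * p) → ℚ} (hg : ∀ z, g (-z) = g z) (w : ZMod (6 * p)) : hat g w = 0 := by
  simp only [hat, hg, sub_self]

/-- `L_I` is linear and kills negation-invariant functions. [folklore] -/
private theorem LI_linear (h : Nat.Coprime 6 p) (b : ZMod p) :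
    (∀ g g' : ZMod (6 * p) → ℚ, LI h (fun z ↦ g z + g' z) b = LI h g b + LI h g' b) ∧
    (∀ (a : ℚ) (g : ZMod (6 * p) → ℚ), LI h (fun z ↦ a * g z) b = a * LI h g b) ∧
    (∀ {ι : Type} (t : Finset ι) (g : ι → ZMod (6 * p) → ℚ), LI h (fun z ↦ ∑ i ∈ t, g i z) b = ∑ i ∈ t, LI h (g i) b) ∧
    (∀ g : ZMod (6 * p) → ℚ, (∀ z, g (-z) = g z) → LI h g b = 0) := by
  refine ⟨fun g g' ↦ ?_, fun a g ↦ ?_, fun t g ↦ ?_, fun g hg ↦ ?_⟩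
  · simp only [LI, Upart, Epart, Tpart, Spart, hat_add]; ring
  · simp only [LI, Upart, Epart, Tpart, Spart, hat_smul]; ring
  · simp only [LI, Upart, Epart, Tpart, Spart, hat_sum, Finset.mul_sum, ← Finset.sum_add_distrib,
      ← Finset.sum_sub_distrib]
  · simp only [LI, Upart, Epart, Tpart, Spart, hat_even hg]; ring

/-- `L_II` is linear and kills negation-invariant functions. [folklore] -/
private theorem LII_linear (h : Nat.Coprime 6 p) (b b' : ZMod p) :
    (∀ g g' : ZMod (6 * p) → ℚ, LII h (fun z ↦ g z + g' z) b b' = LII h g b b' + LII h g' b b') ∧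
    (∀ (a : ℚ) (g : ZMod (6 * p) → ℚ), LII h (fun z ↦ a * g z) b b' = a * LII h g b b') ∧
    (∀ {ι : Type} (t : Finset ι) (g : ι → ZMod (6 * p) → ℚ),
      LII h (fun z ↦ ∑ i ∈ t, g i z) b b' = ∑ i ∈ t, LII h (g i) b b') ∧
    (∀ g : ZMod (6 * p) → ℚ, (∀ z, g (-z) = g z) → LII h g b b' = 0) := by
  refine ⟨fun g g' ↦ ?_, fun a g ↦ ?_, fun t g ↦ ?_, fun g hg ↦ ?_⟩
  · simp only [LII, Gam, Uminus, Eminus, hat_add]; ring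
  · simp only [LII, Gam, Uminus, Eminus, hat_smul]; ring
  · simp only [LII, Gam, Uminus, Eminus, hat_sum, ← Finset.sum_add_distrib, ← Finset.sum_sub_distrib]
  · simp only [LII, Gam, Uminus, Eminus, hat_even hg]; ring

/-! ### The functionals kill every distribution vector -/

/-- `pt 0 0 = 0`. [folklore] -/
private theorem pt_zero (h : Nat.Coprime 6 p) : pt h 0 0 = 0 := by
  show (crt h).symm (0, 0) = 0
  exact map_zero (crt h).symm

/-- A point with non-zero second coordinate is not of the form `pt e 0`. [folklore] -/
private theorem pt_ne_pt_zero (h : Nat.Coprime 6 p) {c : ZMod p} (hc : c ≠ 0) (e e' : ZMod 6) :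
    pt h e' 0 ≠ pt h e c := fun eq ↦ hc ((pt_inj h).1 eq).2.symm

/-- `ĝ` of a distribution vector at a coordinate point, unfolded. [folklore] -/
private theorem hat_koD (h : Nat.Coprime 6 p) (M : ℕ) (z : ZMod (6 * p)) (e : ZMod 6) (c : ZMod p) :
    hat (koD (6 * p) M z) (pt h e c) =
      ((if (pt h e c).val % M = z.val % M then (1 : ℚ) else 0) -
        (if (pt h (-e) (-c)).val % M = z.val % M then (1 : ℚ) else 0)) -
      ((if ((6 * p / M : ℕ) : ZMod (6 * p)) * z = pt h e c then (1 : ℚ) else 0) -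
        (if ((6 * p / M : ℕ) : ZMod (6 * p)) * z = pt h (-e) (-c) then (1 : ℚ) else 0)) := by
  simp only [hat, koD, neg_pt]
  ring

/-- The distribution vector of level `6p` is zero. [folklore] -/
private theorem koD_top [NeZero (6 * p)] (z w : ZMod (6 * p)) : koD (6 * p) (6 * p) z w = 0 := by
  have h0 : (6 * p) ≠ 0 := NeZero.ne _
  simp only [koD, Nat.mod_eq_of_lt (ZMod.val_lt _), Nat.div_self (Nat.pos_of_ne_zero h0), Nat.cast_one, one_mul]
  by_cases hw : w = z
  · rw [if_pos (by rw [hw]), if_pos hw.symm, sub_self]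
  · rw [if_neg (fun e ↦ hw (ZMod.val_injective _ e)), if_neg (fun e ↦ hw e.symm), sub_self]

/-- Level `1`: `ĝ = 0` off the fibre `0`. [folklore] -/
private theorem hat_koD_one (h : Nat.Coprime 6 p) [NeZero (6 * p)] (z : ZMod (6 * p)) (e : ZMod 6) {c : ZMod p}
    (hc : c ≠ 0) : hat (koD (6 * p) 1 z) (pt h e c) = 0 := by
  rw [hat_koD]
  have hcast : ((6 * p / 1 : ℕ) : ZMod (6 * p)) = 0 := by rw [Nat.div_one, ZMod.natCast_self]
  have n1 : (0 : ZMod (6 * p)) ≠ pt h e c := by rw [← pt_zero h]; exact pt_ne_pt_zero h hc _ _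
  have n2 : (0 : ZMod (6 * p)) ≠ pt h (-e) (-c) := by rw [← pt_zero h]; exact pt_ne_pt_zero h (neg_ne_zero.2 hc) _ _
  simp only [Nat.mod_one, hcast, zero_mul, n1, n2, if_true, if_false, sub_self]

/-- Parity is negation-invariant in `ℤ/6`. [folklore] -/
private theorem neg_val_mod_two (e : ZMod 6) : (-e).val % 2 = e.val % 2 := by
  fin_cases e <;> decide

/-- Level `2`: `ĝ = 0` off the fibre `0`. [folklore] -/
private theorem hat_koD_two (h : Nat.Coprime 6 p) [NeZero (6 * p)] (ez e : ZMod 6) {bz c : ZMod p}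
    (hc : c ≠ 0) : hat (koD (6 * p) 2 (pt h ez bz)) (pt h e c) = 0 := by
  rw [hat_koD]
  have h3 : (6 * p / 2 : ℕ) = 3 * p := by omega
  have hP : ((3 * p : ℕ) : ZMod p) = 0 := by rw [Nat.cast_mul, ZMod.natCast_self, mul_zero]
  have n1 : ((3 * p : ℕ) : ZMod (6 * p)) * pt h ez bz ≠ pt h e c := by
    rw [natCast_mul_pt, hP, zero_mul]; exact pt_ne_pt_zero h hc _ _
  have n2 : ((3 * p : ℕ) : ZMod (6 * p)) * pt h ez bz ≠ pt h (-e) (-c) := by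
    rw [natCast_mul_pt, hP, zero_mul]; exact pt_ne_pt_zero h (neg_ne_zero.2 hc) _ _
  rw [h3, if_neg n1, if_neg n2]
  simp only [mod_two_iff h, crt_pt, neg_val_mod_two, sub_self]

/-- Level `3`: `ĝ(e, c) = [e ≡ e_z] − [−e ≡ e_z] (mod 3)` off the fibre `0`. [folklore] -/
private theorem hat_koD_three (h : Nat.Coprime 6 p) [NeZero (6 * p)] (ez e : ZMod 6) {bz c : ZMod p}
    (hc : c ≠ 0) : hat (koD (6 * p) 3 (pt h ez bz)) (pt h e c) =
      (if e.val % 3 = ez.val % 3 then (1 : ℚ) else 0) - (if (-e).val % 3 = ez.val % 3 then (1 : ℚ) else 0) := by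
  rw [hat_koD]
  have h3 : (6 * p / 3 : ℕ) = 2 * p := by omega
  have hP : ((2 * p : ℕ) : ZMod p) = 0 := by rw [Nat.cast_mul, ZMod.natCast_self, mul_zero]
  have n1 : ((2 * p : ℕ) : ZMod (6 * p)) * pt h ez bz ≠ pt h e c := by
    rw [natCast_mul_pt, hP, zero_mul]; exact pt_ne_pt_zero h hc _ _
  have n2 : ((2 * p : ℕ) : ZMod (6 * p)) * pt h ez bz ≠ pt h (-e) (-c) := by
    rw [natCast_mul_pt, hP, zero_mul]; exact pt_ne_pt_zero h (neg_ne_zero.2 hc) _ _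
  rw [h3, if_neg n1, if_neg n2]
  simp only [mod_three_iff h, crt_pt, sub_zero]

/-- Level `6`: `ĝ(e, c) = [e = e_z] − [−e = e_z]` off the fibre `0`. [folklore] -/
private theorem hat_koD_six (h : Nat.Coprime 6 p) [NeZero (6 * p)] (ez e : ZMod 6) {bz c : ZMod p}
    (hc : c ≠ 0) : hat (koD (6 * p) 6 (pt h ez bz)) (pt h e c) =
      (if e = ez then (1 : ℚ) else 0) - (if -e = ez then (1 : ℚ) else 0) := by
  rw [hat_koD]
  have h6 : (6 * p / 6 : ℕ) = p := by omega
  have n1 : ((p : ℕ) : ZMod (6 * p)) * pt h ez bz ≠ pt h e c := by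
    rw [natCast_mul_pt, ZMod.natCast_self, zero_mul]; exact pt_ne_pt_zero h hc _ _
  have n2 : ((p : ℕ) : ZMod (6 * p)) * pt h ez bz ≠ pt h (-e) (-c) := by
    rw [natCast_mul_pt, ZMod.natCast_self, zero_mul]; exact pt_ne_pt_zero h (neg_ne_zero.2 hc) _ _
  rw [h6, if_neg n1, if_neg n2]
  simp only [mod_six_iff h, crt_pt, sub_zero]

/-- Level `p`: `ĝ(e, c) = [c = b_z] − [−c = b_z] − [e = 0, 6b_z = c] + [−e = 0, 6b_z = −c]`. [folklore] -/
private theorem hat_koD_P (h : Nat.Coprime 6 p) [NeZero (6 * p)] (hp : p.Prime) (ez e : ZMod 6) (bz c : ZMod p) :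
    hat (koD (6 * p) p (pt h ez bz)) (pt h e c) =
      ((if c = bz then (1 : ℚ) else 0) - (if -c = bz then (1 : ℚ) else 0)) -
      ((if 0 = e ∧ 6 * bz = c then (1 : ℚ) else 0) - (if 0 = -e ∧ 6 * bz = -c then (1 : ℚ) else 0)) := by
  rw [hat_koD]
  have h6 : (6 * p / p : ℕ) = 6 := Nat.mul_div_cancel 6 hp.pos
  have h60 : (6 : ZMod 6) * ez = 0 := by rw [show (6 : ZMod 6) = 0 by decide, zero_mul]
  rw [h6]
  simp only [natCast_mul_eq_pt_iff]
  simp only [mod_p_iff h, crt_pt, Nat.cast_ofNat, h60]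

/-- Level `2p`: `ĝ(e, c) = [e ≡ e_z (2), c = b_z] − [−e ≡ e_z (2), −c = b_z] − [3e_z = e, 3b_z = c] + [3e_z = −e, 3b_z = −c]`.
[folklore] -/
private theorem hat_koD_twoP (h : Nat.Coprime 6 p) [NeZero (6 * p)] (hp : p.Prime) (ez e : ZMod 6) (bz c : ZMod p) :
    hat (koD (6 * p) (2 * p) (pt h ez bz)) (pt h e c) =
      ((if e.val % 2 = ez.val % 2 ∧ c = bz then (1 : ℚ) else 0) -
        (if (-e).val % 2 = ez.val % 2 ∧ -c = bz then (1 : ℚ) else 0)) -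
      ((if 3 * ez = e ∧ 3 * bz = c then (1 : ℚ) else 0) - (if 3 * ez = -e ∧ 3 * bz = -c then (1 : ℚ) else 0)) := by
  rw [hat_koD]
  have h3 : (6 * p / (2 * p) : ℕ) = 3 := by
    rw [show 6 * p = 3 * (2 * p) by ring]; exact Nat.mul_div_cancel 3 (by have := hp.pos; omega)
  rw [h3]
  simp only [natCast_mul_eq_pt_iff]
  simp only [mod_twoP_iff h, crt_pt, Nat.cast_ofNat]

/-- Level `3p`: `ĝ(e, c) = [e ≡ e_z (3), c = b_z] − [−e ≡ e_z (3), −c = b_z] − [2e_z = e, 2b_z = c] + [2e_z = −e, 2b_z = −c]`.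
[folklore] -/
private theorem hat_koD_threeP (h : Nat.Coprime 6 p) [NeZero (6 * p)] (hp : p.Prime) (ez e : ZMod 6) (bz c : ZMod p) :
    hat (koD (6 * p) (3 * p) (pt h ez bz)) (pt h e c) =
      ((if e.val % 3 = ez.val % 3 ∧ c = bz then (1 : ℚ) else 0) -
        (if (-e).val % 3 = ez.val % 3 ∧ -c = bz then (1 : ℚ) else 0)) -
      ((if 2 * ez = e ∧ 2 * bz = c then (1 : ℚ) else 0) - (if 2 * ez = -e ∧ 2 * bz = -c then (1 : ℚ) else 0)) := by
  rw [hat_koD]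
  have h2 : (6 * p / (3 * p) : ℕ) = 2 := by
    rw [show 6 * p = 2 * (3 * p) by ring]; exact Nat.mul_div_cancel 2 (by have := hp.pos; omega)
  rw [h2]
  simp only [natCast_mul_eq_pt_iff]
  simp only [mod_threeP_iff h, crt_pt, Nat.cast_ofNat]

/-- Literal facts in `ℤ/6` used to evaluate the functionals (`π = ±1`). [folklore] -/
private theorem zmod6_facts (hp : p.Prime) (h5 : 5 ≤ p) :
    (0 : ZMod 6) ≠ π ∧ (0 : ZMod 6) ≠ -π ∧ (0 : ZMod 6) ≠ 2 * π ∧ (0 : ZMod 6) ≠ -(2 * π) ∧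
      (0 : ZMod 6) ≠ 3 ∧ (-3 : ZMod 6) = 3 := by
  rcases pi_eq hp h5 with h | h <;> rw [h] <;> decide

/-- **`L_I` kills every distribution vector.** [folklore] -/
private theorem LI_koD (h : Nat.Coprime 6 p) [NeZero (6 * p)] (hp : p.Prime) (h5 : 5 ≤ p) {M : ℕ}
    (hM : M ∈ (6 * p).divisors) (z : ZMod (6 * p)) {b : ZMod p} (hb : b ≠ 0) : LI h (koD (6 * p) M z) b = 0 := by
  obtain ⟨h2b, h3b, h6b⟩ := mul_ne_zero_facts hp h5 hb
  obtain ⟨n1, n2, n3, n4, n5, e3⟩ := zmod6_facts hp h5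
  obtain ⟨ez, bz, rfl⟩ : ∃ ez bz, z = pt h ez bz := ⟨_, _, (pt_crt h z).symm⟩
  obtain ⟨c1, c2, c3, c4, c5, c6, c7, c8, c9, c10⟩ := cancel_facts hp h5 b bz
  rcases eq_of_dvd_six_mul_prime hp h5 (Nat.dvd_of_mem_divisors hM) with rfl | rfl | rfl | rfl | rfl | rfl | rfl | hM6
  · simp only [LI, Upart, Epart, Tpart, Spart, hat_koD_one h _ _ hb, hat_koD_one h _ _ h2b, hat_koD_one h _ _ h3b,
      hat_koD_one h _ _ h6b]
    norm_num
  · simp only [LI, Upart, Epart, Tpart, Spart, hat_koD_two h _ _ hb, hat_koD_two h _ _ h2b, hat_koD_two h _ _ h3b,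
      hat_koD_two h _ _ h6b]
    norm_num
  · simp only [LI, Upart, Epart, Tpart, Spart, hat_koD_three h _ _ hb, hat_koD_three h _ _ h2b,
      hat_koD_three h _ _ h3b, hat_koD_three h _ _ h6b, neg_neg, neg_zero, e3]
    ring
  · simp only [LI, Upart, Epart, Tpart, Spart, hat_koD_six h _ _ hb, hat_koD_six h _ _ h2b, hat_koD_six h _ _ h3b,
      hat_koD_six h _ _ h6b, neg_neg, neg_zero, e3]
    ring
  · simp only [LI, Upart, Epart, Tpart, Spart, hat_koD_P h hp, neg_neg, neg_zero, e3, n1, n2, n3, n4, n5, false_and,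
      if_false, true_and, c1, c2, sub_zero]
    ring
  · simp only [LI, Upart, Epart, Tpart, Spart, hat_koD_twoP h hp, neg_neg, neg_zero, e3, c3, c4, c5, c6]
    rcases pi_eq hp h5 with hπ | hπ <;> simp only [hπ] <;> fin_cases ez <;> simp +decide <;> ring
  · simp only [LI, Upart, Epart, Tpart, Spart, hat_koD_threeP h hp, neg_neg, neg_zero, e3, c7, c8, c9, c10]
    rcases pi_eq hp h5 with hπ | hπ <;> simp only [hπ] <;> fin_cases ez <;> simp +decide <;> ring
  · rw [hM6]
    simp only [LI, Upart, Epart, Tpart, Spart, hat, koD_top, sub_self]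
    norm_num

/-- **`L_II` kills every distribution vector.** [folklore] -/
private theorem LII_koD (h : Nat.Coprime 6 p) [NeZero (6 * p)] (hp : p.Prime) (h5 : 5 ≤ p) {M : ℕ}
    (hM : M ∈ (6 * p).divisors) (z : ZMod (6 * p)) {b b' : ZMod p} (hb : b ≠ 0) (hb' : b' ≠ 0) :
    LII h (koD (6 * p) M z) b b' = 0 := by
  obtain ⟨h2b, -, -⟩ := mul_ne_zero_facts hp h5 hb
  obtain ⟨h2b', -, -⟩ := mul_ne_zero_facts hp h5 hb'
  obtain ⟨n1, n2, n3, n4, n5, e3⟩ := zmod6_facts hp h5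
  obtain ⟨ez, bz, rfl⟩ : ∃ ez bz, z = pt h ez bz := ⟨_, _, (pt_crt h z).symm⟩
  obtain ⟨-, -, -, -, -, -, c7, c8, -, -⟩ := cancel_facts hp h5 b bz
  obtain ⟨-, -, -, -, -, -, c7', c8', -, -⟩ := cancel_facts hp h5 b' bz
  rcases eq_of_dvd_six_mul_prime hp h5 (Nat.dvd_of_mem_divisors hM) with rfl | rfl | rfl | rfl | rfl | rfl | rfl | hM6
  · simp only [LII, Gam, Uminus, Eminus, hat_koD_one h _ _ hb, hat_koD_one h _ _ h2b, hat_koD_one h _ _ hb',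
      hat_koD_one h _ _ h2b']
    norm_num
  · simp only [LII, Gam, Uminus, Eminus, hat_koD_two h _ _ hb, hat_koD_two h _ _ h2b, hat_koD_two h _ _ hb',
      hat_koD_two h _ _ h2b']
    norm_num
  · simp only [LII, Gam, Uminus, Eminus, hat_koD_three h _ _ hb, hat_koD_three h _ _ h2b,
      hat_koD_three h _ _ hb', hat_koD_three h _ _ h2b', neg_neg]
    ring
  · simp only [LII, Gam, Uminus, Eminus, hat_koD_six h _ _ hb, hat_koD_six h _ _ h2b, hat_koD_six h _ _ hb',
      hat_koD_six h _ _ h2b', neg_neg]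
    ring
  · simp only [LII, Gam, Uminus, Eminus, hat_koD_P h hp, neg_neg, n1, n2, n3, n4, false_and, if_false, sub_zero]
    ring
  · simp only [LII, Gam, Uminus, Eminus, hat_koD_twoP h hp, neg_neg]
    rcases pi_eq hp h5 with hπ | hπ <;> simp only [hπ] <;> fin_cases ez <;> simp +decide
  · simp only [LII, Gam, Uminus, Eminus, hat_koD_threeP h hp, neg_neg, c7, c8, c7', c8']
    rcases pi_eq hp h5 with hπ | hπ <;> simp only [hπ] <;> fin_cases ez <;> simp +decide <;> ring
  · rw [hM6]
    simp only [LII, Gam, Uminus, Eminus, hat, koD_top, sub_self]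

/-! ### The two relations on Hodge multisets of level `6p` -/

/-- **Koblitz–Ogus, functional form:** a linear functional on `ℚ^{ℤ/6p}` that kills the negation-invariant functions and all
distribution vectors kills the multiplicity function of every Hodge multiset (the tree's PROVED
`KoblitzOgus.hodge_eq_combination`; as in `PicardNumberThreePrime`). [cite: Deligne1982HodgeCycles, Rem. 7.16 (a)] -/
private theorem functional_count_eq_zero [NeZero (6 * p)] {s : Multiset (ZMod (6 * p))} (hs : IsHodgeMultiset s)
    (L : (ZMod (6 * p) → ℚ) → ℚ)
    (hadd : ∀ g g' : ZMod (6 * p) → ℚ, L (fun z ↦ g z + g' z) = L g + L g')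
    (hmul : ∀ (a : ℚ) (g : ZMod (6 * p) → ℚ), L (fun z ↦ a * g z) = a * L g)
    (hsum : ∀ {ι : Type} (t : Finset ι) (g : ι → ZMod (6 * p) → ℚ), L (fun z ↦ ∑ i ∈ t, g i z) = ∑ i ∈ t, L (g i))
    (heven : ∀ g : ZMod (6 * p) → ℚ, (∀ z, g (-z) = g z) → L g = 0)
    (hko : ∀ M ∈ (6 * p).divisors, ∀ y : ZMod (6 * p), L (koD (6 * p) M y) = 0) :
    L (fun w ↦ (count w s : ℚ)) = 0 := by
  classical
  obtain ⟨cr, cd, hrep⟩ := Literature.NumberTheory.Transcendental.KoblitzOgus.hodge_eq_combination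
    (N := 6 * p) (fun x ↦ (count x s : ℚ)) (fun u hu ↦ hs.sum_count_mul_bern_eq_zero hu)
  have hf : (fun w ↦ (count w s : ℚ)) =
      fun w ↦ (∑ a : ZMod (6 * p), cr a * ((if a = w then (1 : ℚ) else 0) + (if -a = w then 1 else 0))) +
        ∑ M ∈ (6 * p).divisors, ∑ y : ZMod (6 * p), cd M y * koD (6 * p) M y w := funext hrep
  rw [hf, hadd, hsum, hsum]
  have hA : ∀ a : ZMod (6 * p),
      L (fun w ↦ cr a * ((if a = w then (1 : ℚ) else 0) + (if -a = w then 1 else 0))) = 0 := fun a ↦ by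
    rw [hmul, heven _ fun w ↦ ?_, mul_zero]
    rw [add_comm]
    congr 1
    · simp only [neg_inj]
    · simp only [eq_neg_iff_add_eq_zero, neg_eq_iff_add_eq_zero]
  have hB : ∀ M ∈ (6 * p).divisors, L (fun w ↦ ∑ y : ZMod (6 * p), cd M y * koD (6 * p) M y w) = 0 :=
    fun M hM ↦ by
      rw [hsum]
      refine Finset.sum_eq_zero fun y _ ↦ ?_
      rw [hmul, hko M hM y, mul_zero]
  rw [Finset.sum_eq_zero fun a _ ↦ hA a, Finset.sum_eq_zero hB, add_zero]

/-- **Relation I** (odd characters mod `p`) for the multiplicity function of a Hodge multiset of level `6p`.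
[cite: Deligne1982HodgeCycles, Rem. 7.16 (a)] [cite: Aoki1983, Prop. 2.2] -/
private theorem LI_count_eq_zero (h : Nat.Coprime 6 p) [NeZero (6 * p)] (hp : p.Prime) (h5 : 5 ≤ p)
    {s : Multiset (ZMod (6 * p))} (hs : IsHodgeMultiset s) {b : ZMod p} (hb : b ≠ 0) :
    LI h (fun w ↦ (count w s : ℚ)) b = 0 := by
  have lin := LI_linear h b
  exact functional_count_eq_zero hs (fun g ↦ LI h g b) lin.1 lin.2.1 (fun t g ↦ lin.2.2.1 t g) lin.2.2.2
    (fun M hM y ↦ LI_koD h hp h5 hM y hb)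

/-- **Relation II** (the characters `χ₃ψ`, `ψ ≠ 1` even mod `p`) for the multiplicity function of a Hodge multiset of
level `6p`. [cite: Deligne1982HodgeCycles, Rem. 7.16 (a)] [cite: Aoki1983, Prop. 2.2] -/
private theorem LII_count_eq_zero (h : Nat.Coprime 6 p) [NeZero (6 * p)] (hp : p.Prime) (h5 : 5 ≤ p)
    {s : Multiset (ZMod (6 * p))} (hs : IsHodgeMultiset s) {b b' : ZMod p} (hb : b ≠ 0) (hb' : b' ≠ 0) :
    LII h (fun w ↦ (count w s : ℚ)) b b' = 0 := by
  have lin := LII_linear h b b'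
  exact functional_count_eq_zero hs (fun g ↦ LII h g b b') lin.1 lin.2.1 (fun t g ↦ lin.2.2.1 t g) lin.2.2.2
    (fun M hM y ↦ LII_koD h hp h5 hM y hb hb')

/-! ### The odd part in coordinates -/

/-- The odd part of the multiplicity function of `T : Multiset (ℤ/6 × ℤ/p)`: `o(q) = #_q T − #_{−q} T`. [folklore] -/
private def oc (T : Multiset (ZMod 6 × ZMod p)) (q : ZMod 6 × ZMod p) : ℤ := (count q T : ℤ) - count (-q) T

/-- `ĝ` of the multiplicity function of `s` at `pt e c` is the odd part of `s.map crt` at `(e, c)`. [folklore] -/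
private theorem hat_count (h : Nat.Coprime 6 p) (s : Multiset (ZMod (6 * p))) (e : ZMod 6) (c : ZMod p) :
    hat (fun w ↦ (count w s : ℚ)) (pt h e c) = (oc (s.map (crt h)) (e, c) : ℚ) := by
  classical
  have hc : ∀ q : ZMod 6 × ZMod p, count q (s.map (crt h)) = count ((crt h).symm q) s := fun q ↦ by
    rw [← Multiset.count_map_eq_count' _ _ (crt h).symm.injective, Multiset.map_map]
    simp only [Function.comp_def, RingEquiv.symm_apply_apply, Multiset.map_id']
  simp only [hat, oc, hc, neg_pt, Int.cast_sub, Int.cast_natCast]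
  rfl

variable (T : Multiset (ZMod 6 × ZMod p))

/-- `U(c) = o(1, c) + o(−1, c)`: the (signed) number of unit members in the fibre `c`. [folklore] -/
private def cU (c : ZMod p) : ℤ := oc T (1, c) + oc T (-1, c)

/-- `E(c) = o(2, c) + o(−2, c)`. [folklore] -/
private def cE (c : ZMod p) : ℤ := oc T (2, c) + oc T (-2, c)

/-- `T(c) = o(3, c)`. [folklore] -/
private def cT (c : ZMod p) : ℤ := oc T (3, c)

/-- `S(c) = o(0, c)`. [folklore] -/
private def cS (c : ZMod p) : ℤ := oc T (0, c)

/-- `U⁻(c) = o(1, c) − o(−1, c)`. [folklore] -/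
private def cUm (c : ZMod p) : ℤ := oc T (1, c) - oc T (-1, c)

/-- `E⁻(c) = o(2, c) − o(−2, c)`. [folklore] -/
private def cEm (c : ZMod p) : ℤ := oc T (2, c) - oc T (-2, c)

/-- `Γ(b) = U⁻(b) + U⁻(2b) + E⁻(2b)`. [folklore] -/
private def cGam (b : ZMod p) : ℤ := cUm T b + cUm T (2 * b) + cEm T (2 * b)

/-- Relation I for `T`: `U(b) − U(2b) + E(2b) − U(3b) + 2T(3b) + U(6b) − E(6b) − 2T(6b) + 2S(6b) = 0`, `b ≠ 0`.
[folklore] -/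
private def RelI (T : Multiset (ZMod 6 × ZMod p)) : Prop :=
  ∀ b : ZMod p, b ≠ 0 → cU T b - cU T (2 * b) + cE T (2 * b) - cU T (3 * b) + 2 * cT T (3 * b) + cU T (6 * b)
    - cE T (6 * b) - 2 * cT T (6 * b) + 2 * cS T (6 * b) = 0

/-- Relation II for `T`: `Γ(b) = 0`, `b ≠ 0`. [folklore] -/
private def RelII (T : Multiset (ZMod 6 × ZMod p)) : Prop := ∀ b : ZMod p, b ≠ 0 → cGam T b = 0

variable {T}

/-- `o` is odd. [folklore] -/
private theorem oc_neg (q : ZMod 6 × ZMod p) : oc T (-q) = -oc T q := by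
  simp only [oc, neg_neg]; ring

/-- Relation I for the coordinates of a Hodge multiset of level `6p`. [cite: Aoki1983, Prop. 2.2] -/
private theorem relI_of_isHodgeMultiset (h : Nat.Coprime 6 p) [NeZero (6 * p)] (hp : p.Prime) (h5 : 5 ≤ p)
    {s : Multiset (ZMod (6 * p))} (hs : IsHodgeMultiset s) : RelI (s.map (crt h)) := by
  intro b hb
  have key := LI_count_eq_zero h hp h5 hs hb
  simp only [LI, Upart, Epart, Tpart, Spart, hat_count] at key
  have e : ((cU (s.map (crt h)) b - cU (s.map (crt h)) (2 * b) + cE (s.map (crt h)) (2 * b)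
      - cU (s.map (crt h)) (3 * b) + 2 * cT (s.map (crt h)) (3 * b) + cU (s.map (crt h)) (6 * b)
      - cE (s.map (crt h)) (6 * b) - 2 * cT (s.map (crt h)) (6 * b) + 2 * cS (s.map (crt h)) (6 * b) : ℤ) : ℚ) = 0 := by
    rcases pi_eq hp h5 with hπ | hπ <;> simp only [hπ, neg_neg, show (2 : ZMod 6) * -1 = -2 by decide, mul_one]
      at key <;> push_cast [cU, cE, cT, cS] <;> linear_combination key
  exact_mod_cast e

/-- Relation II, difference form, for the coordinates of a Hodge multiset of level `6p`. [cite: Aoki1983, Prop. 2.2] -/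
private theorem cGam_eq_of_isHodgeMultiset (h : Nat.Coprime 6 p) [NeZero (6 * p)] (hp : p.Prime) (h5 : 5 ≤ p)
    {s : Multiset (ZMod (6 * p))} (hs : IsHodgeMultiset s) {b b' : ZMod p} (hb : b ≠ 0) (hb' : b' ≠ 0) :
    cGam (s.map (crt h)) b = cGam (s.map (crt h)) b' := by
  have key := LII_count_eq_zero h hp h5 hs hb hb'
  simp only [LII, Gam, Uminus, Eminus, hat_count] at key
  have e : ((cGam (s.map (crt h)) b - cGam (s.map (crt h)) b' : ℤ) : ℚ) = 0 := by
    rcases pi_eq hp h5 with hπ | hπ <;> simp only [hπ, neg_neg, show (2 : ZMod 6) * -1 = -2 by decide, mul_one]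
      at key <;> push_cast [cGam, cUm, cEm]
    · linear_combination key
    · linear_combination -key
  have := (Int.cast_eq_zero.mp e)
  linarith

/-! ### The trivial character: `Γ ≡ 0` and the balance `2(n₁ − n₋₁) + (n₂ − n₋₂) = 0` -/

/-- `Σ_b #_{(e,b)} T = #{q ∈ T : q.1 = e}`. [folklore] -/
private theorem sum_count_eq [NeZero p] (T : Multiset (ZMod 6 × ZMod p)) (e : ZMod 6) :
    ∑ b : ZMod p, (count (e, b) T : ℤ) = (Multiset.card (T.filter fun q ↦ q.1 = e) : ℤ) := by
  classical
  induction T using Multiset.induction_on with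
  | empty => simp
  | cons a T ih =>
    simp only [Multiset.count_cons, Nat.cast_add, Nat.cast_ite, Nat.cast_one, Nat.cast_zero,
      Finset.sum_add_distrib, ih]
    by_cases he : a.1 = e
    · rw [Multiset.filter_cons, if_pos he, Multiset.card_add, Multiset.card_singleton, Nat.cast_add, Nat.cast_one]
      have h1 : ∀ b : ZMod p, ((e, b) = a) ↔ b = a.2 := fun b ↦ by
        rw [Prod.ext_iff]; exact ⟨fun h ↦ h.2, fun h ↦ ⟨he.symm, h⟩⟩
      simp only [h1, Finset.sum_ite_eq', Finset.mem_univ, if_true]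
      ring
    · rw [Multiset.filter_cons, if_neg he, zero_add]
      have h1 : ∀ b : ZMod p, ¬ ((e, b) = a) := fun b h ↦ he (by rw [← h])
      simp only [h1, if_false, Finset.sum_const_zero, add_zero]

/-- Four disjoint first-coordinate classes have at most `#T` members in total. [folklore] -/
private theorem card_filter_four_le (T : Multiset (ZMod 6 × ZMod p)) :
    Multiset.card (T.filter fun q ↦ q.1 = 1) + Multiset.card (T.filter fun q ↦ q.1 = -1) +
      Multiset.card (T.filter fun q ↦ q.1 = 2) + Multiset.card (T.filter fun q ↦ q.1 = -2) ≤ Multiset.card T := by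
  classical
  induction T using Multiset.induction_on with
  | empty => simp
  | cons a T ih =>
    simp only [Multiset.filter_cons, Multiset.card_add, Multiset.card_cons]
    have : Multiset.card (if a.1 = 1 then ({a} : Multiset (ZMod 6 × ZMod p)) else 0) +
        Multiset.card (if a.1 = -1 then ({a} : Multiset (ZMod 6 × ZMod p)) else 0) +
        Multiset.card (if a.1 = 2 then ({a} : Multiset (ZMod 6 × ZMod p)) else 0) +
        Multiset.card (if a.1 = -2 then ({a} : Multiset (ZMod 6 × ZMod p)) else 0) ≤ 1 := by
      generalize a.1 = x
      by_cases h1 : x = 1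
      · subst h1; simp +decide
      by_cases h2 : x = -1
      · subst h2; simp +decide
      by_cases h3 : x = 2
      · subst h3; simp +decide
      by_cases h4 : x = -2
      · subst h4; simp +decide
      simp [h1, h2, h3, h4]
    omega

/-- **The trivial character.** If `Γ` is constant on `(ℤ/p)ˣ` for a `4`-element `T ⊂ ℤ/6 × ℤ/p` of sum zero (`p ≥ 17`), then
`Γ ≡ 0` and `2(n₁ − n₋₁) + (n₂ − n₋₂) = 0`, `n_e` the number of members `(e, c)` with `c ≠ 0`: summing `Γ` over `(ℤ/p)ˣ` gives
`(p−1)Γ = 4(n₁ − n₋₁) + 2(n₂ − n₋₂)`, of absolute value `≤ 16`, with equality only for four members `(±1, ·)`, whose sum is not zero.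
[folklore] -/
private theorem relII_and_balance (hp : p.Prime) (h17 : 17 ≤ p) {T : Multiset (ZMod 6 × ZMod p)}
    (hcard : Multiset.card T = 4) (hsum : T.sum = 0)
    (hΓ : ∀ b b' : ZMod p, b ≠ 0 → b' ≠ 0 → cGam T b = cGam T b') :
    RelII T ∧
      2 * (((Multiset.card (T.filter fun q ↦ q.1 = 1) : ℤ) - count ((1 : ZMod 6), (0 : ZMod p)) T) -
            ((Multiset.card (T.filter fun q ↦ q.1 = -1) : ℤ) - count ((-1 : ZMod 6), (0 : ZMod p)) T)) +
        (((Multiset.card (T.filter fun q ↦ q.1 = 2) : ℤ) - count ((2 : ZMod 6), (0 : ZMod p)) T) -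
          ((Multiset.card (T.filter fun q ↦ q.1 = -2) : ℤ) - count ((-2 : ZMod 6), (0 : ZMod p)) T)) = 0 := by
  classical
  haveI := Fact.mk hp
  haveI : NeZero p := ⟨hp.ne_zero⟩
  -- notation
  set N1 := (Multiset.card (T.filter fun q ↦ q.1 = 1) : ℤ) with hN1
  set N5 := (Multiset.card (T.filter fun q ↦ q.1 = -1) : ℤ) with hN5
  set N2 := (Multiset.card (T.filter fun q ↦ q.1 = 2) : ℤ) with hN2
  set N4 := (Multiset.card (T.filter fun q ↦ q.1 = -2) : ℤ) with hN4
  set f1 := (count ((1 : ZMod 6), (0 : ZMod p)) T : ℤ) with hf1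
  set f5 := (count ((-1 : ZMod 6), (0 : ZMod p)) T : ℤ) with hf5
  set f2 := (count ((2 : ZMod 6), (0 : ZMod p)) T : ℤ) with hf2
  set f4 := (count ((-2 : ZMod 6), (0 : ZMod p)) T : ℤ) with hf4
  -- the fibre sums
  have two_ne : (2 : ZMod p) ≠ 0 := by
    intro h0
    have := (ZMod.natCast_eq_zero_iff 2 p).1 (by exact_mod_cast h0)
    exact absurd (Nat.le_of_dvd (by norm_num) this) (by omega)
  have reneg : ∀ g : ZMod p → ℤ, ∑ b : ZMod p, g (-b) = ∑ b : ZMod p, g b := fun g ↦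
    Equiv.sum_comp (Equiv.neg (ZMod p)) g
  have retwo : ∀ g : ZMod p → ℤ, ∑ b : ZMod p, g (2 * b) = ∑ b : ZMod p, g b := fun g ↦ by
    have := Equiv.sum_comp (Units.mk0 (2 : ZMod p) two_ne).mulLeft g
    simpa using this
  have sU : ∑ b : ZMod p, cUm T b = 2 * (N1 - N5) := by
    simp only [cUm, oc, Prod.neg_mk, neg_neg, Finset.sum_sub_distrib]
    rw [sum_count_eq, sum_count_eq, reneg (fun b ↦ (count ((-1 : ZMod 6), b) T : ℤ)),
      reneg (fun b ↦ (count ((1 : ZMod 6), b) T : ℤ)), sum_count_eq, sum_count_eq]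
    ring
  have sE : ∑ b : ZMod p, cEm T b = 2 * (N2 - N4) := by
    simp only [cEm, oc, Prod.neg_mk, neg_neg, Finset.sum_sub_distrib]
    rw [sum_count_eq, sum_count_eq, reneg (fun b ↦ (count ((-2 : ZMod 6), b) T : ℤ)),
      reneg (fun b ↦ (count ((2 : ZMod 6), b) T : ℤ)), sum_count_eq, sum_count_eq]
    ring
  have sG : ∑ b : ZMod p, cGam T b = 4 * (N1 - N5) + 2 * (N2 - N4) := by
    simp only [cGam, Finset.sum_add_distrib]
    rw [retwo (fun b ↦ cUm T b), retwo (fun b ↦ cEm T b), sU, sE]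
    ring
  -- the value at `0`
  have G0val : cGam T 0 = 4 * (f1 - f5) + 2 * (f2 - f4) := by
    simp only [cGam, cUm, cEm, oc, mul_zero, Prod.neg_mk, neg_zero, neg_neg]
    ring
  -- `Σ_{b ≠ 0} Γ(b) = (p − 1) Γ(1)`
  set G := cGam T 1 with hG
  have hconst : ∀ b ∈ (Finset.univ : Finset (ZMod p)).erase 0, cGam T b = G := fun b hb ↦
    hΓ b 1 (Finset.ne_of_mem_erase hb) one_ne_zero
  have hsplit : ∑ b : ZMod p, cGam T b = cGam T 0 + ((p : ℤ) - 1) * G := by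
    rw [← Finset.add_sum_erase _ _ (Finset.mem_univ (0 : ZMod p)), Finset.sum_congr rfl hconst, Finset.sum_const,
      Finset.card_erase_of_mem (Finset.mem_univ _), Finset.card_univ, ZMod.card, nsmul_eq_mul]
    have : ((p - 1 : ℕ) : ℤ) = (p : ℤ) - 1 := by have := hp.pos; omega
    rw [this]
  -- the bound
  have hR : ((p : ℤ) - 1) * G = 4 * ((N1 - f1) - (N5 - f5)) + 2 * ((N2 - f2) - (N4 - f4)) := by
    linear_combination hsplit.symm.trans sG - G0val
  have hle : N1 + N5 + N2 + N4 ≤ 4 := by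
    have := card_filter_four_le T
    rw [hcard] at this
    simp only [hN1, hN5, hN2, hN4]
    exact_mod_cast this
  have hfle : ∀ (e : ZMod 6), (count (e, (0 : ZMod p)) T : ℤ) ≤ (Multiset.card (T.filter fun q ↦ q.1 = e) : ℤ) := by
    intro e
    have h1 : count (e, (0 : ZMod p)) T = count (e, (0 : ZMod p)) (T.filter fun q ↦ q.1 = e) := by
      rw [Multiset.count_filter_of_pos]; rfl
    rw [h1]
    exact_mod_cast Multiset.count_le_card _ _
  have b1 := hfle 1; have b5 := hfle (-1); have b2 := hfle 2; have b4 := hfle (-2)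
  rw [← hN1, ← hf1] at b1; rw [← hN5, ← hf5] at b5; rw [← hN2, ← hf2] at b2; rw [← hN4, ← hf4] at b4
  have f1nn : 0 ≤ f1 := by positivity
  have f5nn : 0 ≤ f5 := by positivity
  have f2nn : 0 ≤ f2 := by positivity
  have f4nn : 0 ≤ f4 := by positivity
  -- if `G ≠ 0` then `|R| ≥ p − 1 ≥ 16`, forcing all four members into one class `(±1, ·)`
  have hG0 : G = 0 := by
    by_contra hG0
    have hp16 : (16 : ℤ) ≤ (p : ℤ) - 1 := by omega
    have habs : (16 : ℤ) ≤ |((p : ℤ) - 1) * G| := by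
      rw [abs_mul, abs_of_nonneg (by omega : (0 : ℤ) ≤ (p : ℤ) - 1)]
      have : (1 : ℤ) ≤ |G| := Int.one_le_abs hG0
      nlinarith
    rw [hR] at habs
    -- hence `N1 = 4` or `N5 = 4`
    have hN : N1 = 4 ∨ N5 = 4 := by
      rcases le_or_gt 0 (4 * ((N1 - f1) - (N5 - f5)) + 2 * ((N2 - f2) - (N4 - f4))) with hs | hs
      · rw [abs_of_nonneg hs] at habs; omega
      · rw [abs_of_neg hs] at habs; omega
    -- all members have the same first coordinate `e₀ ∈ {1, −1}`, so the sum has first coordinate `4 e₀ ≠ 0`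
    have key : ∀ e₀ : ZMod 6, (Multiset.card (T.filter fun q ↦ q.1 = e₀) : ℤ) = 4 → (T.sum).1 = 4 * e₀ := by
      intro e₀ he₀
      have hfilt : T.filter (fun q ↦ q.1 = e₀) = T :=
        Multiset.eq_of_le_of_card_le (Multiset.filter_le _ _) (by rw [hcard]; exact_mod_cast he₀.ge)
      have hall : ∀ q ∈ T, q.1 = e₀ := fun q hq ↦ by
        rw [← hfilt] at hq
        exact (Multiset.mem_filter.1 hq).2
      have h1 : (T.sum).1 = (T.map Prod.fst).sum := (AddMonoidHom.fst (ZMod 6) (ZMod p)).map_multiset_sum T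
      have h2 : T.map Prod.fst = Multiset.replicate 4 e₀ := by
        rw [Multiset.eq_replicate, Multiset.card_map, hcard]
        refine ⟨rfl, fun x hx ↦ ?_⟩
        obtain ⟨q, hq, rfl⟩ := Multiset.mem_map.1 hx
        exact hall q hq
      rw [h1, h2, Multiset.sum_replicate, nsmul_eq_mul, Nat.cast_ofNat]
    have hs1 : (T.sum).1 = 0 := by rw [hsum]; rfl
    rcases hN with hN | hN
    · have := key 1 (by rw [← hN1]; exact hN)
      rw [hs1] at this
      exact absurd this (by decide)
    · have := key (-1) (by rw [← hN5]; exact hN)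
      rw [hs1] at this
      exact absurd this (by decide)
  refine ⟨fun b hb ↦ by rw [hΓ b 1 hb one_ne_zero]; exact hG0, ?_⟩
  have := hR
  rw [hG0, mul_zero] at this
  linarith

/-! ### The combinatorial classification in coordinates: set-up -/

/-- The balance weight of a member `q`: `2·(±1)` for unit type `q.1 = ±1`, `±1` for even type `q.1 = ±2`, counted
only off the fibre `0` (written so that it matches `countP_cons` / `count_cons`). [folklore] -/
private def wt (q : ZMod 6 × ZMod p) : ℤ :=
  2 * (((if q.1 = 1 then 1 else 0) - if ((1 : ZMod 6), (0 : ZMod p)) = q then 1 else 0) -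
        ((if q.1 = -1 then 1 else 0) - if ((-1 : ZMod 6), (0 : ZMod p)) = q then 1 else 0)) +
    (((if q.1 = 2 then 1 else 0) - if ((2 : ZMod 6), (0 : ZMod p)) = q then 1 else 0) -
      ((if q.1 = -2 then 1 else 0) - if ((-2 : ZMod 6), (0 : ZMod p)) = q then 1 else 0))

/-- The balance functional as a sum of weights. [folklore] -/
private theorem sum_map_wt (T : Multiset (ZMod 6 × ZMod p)) : (T.map wt).sum =
    2 * (((Multiset.card (T.filter fun q ↦ q.1 = 1) : ℤ) - count ((1 : ZMod 6), (0 : ZMod p)) T) -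
          ((Multiset.card (T.filter fun q ↦ q.1 = -1) : ℤ) - count ((-1 : ZMod 6), (0 : ZMod p)) T)) +
      (((Multiset.card (T.filter fun q ↦ q.1 = 2) : ℤ) - count ((2 : ZMod 6), (0 : ZMod p)) T) -
        ((Multiset.card (T.filter fun q ↦ q.1 = -2) : ℤ) - count ((-2 : ZMod 6), (0 : ZMod p)) T)) := by
  simp only [← Multiset.countP_eq_card_filter]
  induction T using Multiset.induction_on with
  | empty => simp
  | cons a T ih =>
    rw [Multiset.map_cons, Multiset.sum_cons, ih]
    simp only [Multiset.countP_cons, Multiset.count_cons]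
    push_cast
    simp only [wt]
    ring

/-- The weights of an explicit `4`-element multiset. [folklore] -/
private theorem sum_map_wt_four (a x y z : ZMod 6 × ZMod p) :
    ((a ::ₘ x ::ₘ y ::ₘ ({z} : Multiset (ZMod 6 × ZMod p))).map wt).sum = wt a + wt x + wt y + wt z := by
  simp only [Multiset.map_cons, Multiset.map_singleton, Multiset.sum_cons, Multiset.sum_singleton]
  ring

/-- The hypotheses on `T ⊂ ℤ/6 × ℤ/p` extracted from an indecomposable Hodge quadruple of level `6p`. [folklore] -/
private structure Good (T : Multiset (ZMod 6 × ZMod p)) : Prop where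
  card4 : Multiset.card T = 4
  sum0 : T.sum = 0
  ne0 : ∀ q ∈ T, q ≠ 0
  pf : ∀ q ∈ T, ∀ q' ∈ T.erase q, q + q' ≠ 0
  relI : RelI T
  relII : RelII T
  bal : (T.map wt).sum = 0

/-- Shioda's `α`-family in coordinates: `{x, x + (3,0), −2x, (3,0)}`. [folklore] -/
private def famA (x : ZMod 6 × ZMod p) : Multiset (ZMod 6 × ZMod p) := {x, x + (3, 0), -(2 * x), (3, 0)}

/-- Shioda's `β`-family in coordinates: `{x, x + (3,0), 2x + (3,0), −4x}`. [folklore] -/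
private def famB (x : ZMod 6 × ZMod p) : Multiset (ZMod 6 × ZMod p) := {x, x + (3, 0), 2 * x + (3, 0), -(4 * x)}

/-- Shioda's `γ`-family in coordinates: `{x, x + (2,0), x + (4,0), −3x}`. [folklore] -/
private def famC (x : ZMod 6 × ZMod p) : Multiset (ZMod 6 × ZMod p) := {x, x + (2, 0), x + (4, 0), -(3 * x)}

/-- The conclusion of the classification. [folklore] -/
private def IsStd (T : Multiset (ZMod 6 × ZMod p)) : Prop := ∃ x, T = famA x ∨ T = famB x ∨ T = famC x

/-- Small multiples of a non-zero residue are distinct: `i b ≠ j b` for `i ≠ j`, `|i|, |j| ≤ 8`, `p ≥ 17`. [folklore] -/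
private theorem kb_ne (hp : p.Prime) (h17 : 17 ≤ p) {b : ZMod p} (hb : b ≠ 0) {i j : ℤ} (hij : i ≠ j) (hi : |i| ≤ 8)
    (hj : |j| ≤ 8) : (i : ZMod p) * b ≠ (j : ZMod p) * b := by
  haveI := Fact.mk hp
  intro h
  have h1 : ((i - j : ℤ) : ZMod p) * b = 0 := by push_cast; linear_combination h
  rcases mul_eq_zero.1 h1 with h2 | h2
  · rw [ZMod.intCast_zmod_eq_zero_iff_dvd] at h2
    have h3 : (p : ℤ) ∣ |i - j| := (dvd_abs _ _).2 h2
    have h4 : |i - j| ≤ 16 := by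
      have := abs_sub i j; omega
    have h5 : 0 < |i - j| := abs_pos.2 (sub_ne_zero.2 hij)
    have := Int.le_of_dvd h5 h3
    omega
  · exact hb h2

/-- Small multiples of a non-zero residue are distinct, second form: `i b ≠ j b` whenever `0 < |i − j| < 34` and `|i − j|` is not a
prime (or is `< 17`), for `p ≥ 17`. [folklore] -/
private theorem kb_ne2 (hp : p.Prime) (h17 : 17 ≤ p) {b : ZMod p} (hb : b ≠ 0) {i j : ℤ}
    (h : i ≠ j ∧ (i - j).natAbs < 34 ∧ ((i - j).natAbs < 17 ∨ ¬ Nat.Prime (i - j).natAbs)) :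
    (i : ZMod p) * b ≠ (j : ZMod p) * b := by
  haveI := Fact.mk hp
  obtain ⟨hij, hlt, hor⟩ := h
  intro e
  have h1 : ((i - j : ℤ) : ZMod p) * b = 0 := by push_cast; linear_combination e
  rcases mul_eq_zero.1 h1 with h2 | h2
  · rw [ZMod.intCast_zmod_eq_zero_iff_dvd] at h2
    have h3 : p ∣ (i - j).natAbs := by simpa using Int.natAbs_dvd_natAbs.2 h2
    have h0 : 0 < (i - j).natAbs := Int.natAbs_pos.2 (sub_ne_zero.2 hij)
    obtain ⟨m, hm⟩ := h3
    rcases Nat.lt_or_ge m 2 with hm2 | hm2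
    · interval_cases m
      · omega
      · rw [mul_one] at hm
        rcases hor with hor | hor
        · omega
        · exact hor (hm ▸ hp)
    · have : p * 2 ≤ p * m := Nat.mul_le_mul_left p hm2
      omega
  · exact hb h2

/-- Canonical small multiples: `zc 0 b = 0`, `zc 1 b = b`, `zc i b = i·b`; by unfolding, `zc 18 b` IS the term `18 * b`, which lets
the non-vanishing facts below be stated by `kb_pp` … `kb_nn` in term mode. [folklore] -/
private def zc (i : ℕ) (b : ZMod p) : ZMod p := if i = 0 then 0 else if i = 1 then b else (i : ZMod p) * b

/-- `zc i b = i·b`. [folklore] -/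
private theorem zc_eq (i : ℕ) (b : ZMod p) : zc i b = ((i : ℤ) : ZMod p) * b := by
  unfold zc
  split_ifs with h0 h1 <;> simp [*]

/-- `i b ≠ j b` (`kb_ne2`, both signs `+`). [folklore] -/
private theorem kb_pp (hp : p.Prime) (h17 : 17 ≤ p) {b : ZMod p} (hb : b ≠ 0) {i j : ℕ}
    (h : (i : ℤ) ≠ j ∧ ((i : ℤ) - j).natAbs < 34 ∧ (((i : ℤ) - j).natAbs < 17 ∨ ¬ Nat.Prime ((i : ℤ) - j).natAbs)) :
    zc i b ≠ zc j b := by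
  rw [zc_eq, zc_eq]; exact kb_ne2 hp h17 hb h

/-- `−i b ≠ j b` (`kb_ne2`, signs `−, +`). [folklore] -/
private theorem kb_np (hp : p.Prime) (h17 : 17 ≤ p) {b : ZMod p} (hb : b ≠ 0) {i j : ℕ}
    (h : (-(i : ℤ)) ≠ j ∧ (-(i : ℤ) - j).natAbs < 34 ∧ ((-(i : ℤ) - j).natAbs < 17 ∨ ¬ Nat.Prime (-(i : ℤ) - j).natAbs)) :
    -zc i b ≠ zc j b := by
  rw [zc_eq, zc_eq, ← neg_mul, ← Int.cast_neg]; exact kb_ne2 hp h17 hb h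

/-- `i b ≠ −j b` (`kb_ne2`, signs `+, −`). [folklore] -/
private theorem kb_pn (hp : p.Prime) (h17 : 17 ≤ p) {b : ZMod p} (hb : b ≠ 0) {i j : ℕ}
    (h : (i : ℤ) ≠ -(j : ℤ) ∧ ((i : ℤ) - -(j : ℤ)).natAbs < 34 ∧
      (((i : ℤ) - -(j : ℤ)).natAbs < 17 ∨ ¬ Nat.Prime ((i : ℤ) - -(j : ℤ)).natAbs)) :
    zc i b ≠ -zc j b := by
  rw [zc_eq, zc_eq, ← neg_mul, ← Int.cast_neg]; exact kb_ne2 hp h17 hb h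

/-- `−i b ≠ −j b` (`kb_ne2`, signs `−, −`). [folklore] -/
private theorem kb_nn (hp : p.Prime) (h17 : 17 ≤ p) {b : ZMod p} (hb : b ≠ 0) {i j : ℕ}
    (h : (-(i : ℤ)) ≠ -(j : ℤ) ∧ (-(i : ℤ) - -(j : ℤ)).natAbs < 34 ∧
      ((-(i : ℤ) - -(j : ℤ)).natAbs < 17 ∨ ¬ Nat.Prime (-(i : ℤ) - -(j : ℤ)).natAbs)) :
    -zc i b ≠ -zc j b := by
  rw [zc_eq, zc_eq, ← neg_mul, ← neg_mul, ← Int.cast_neg, ← Int.cast_neg]; exact kb_ne2 hp h17 hb h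

/-- `2q ≠ 0` for `q = (e, c)` with `c ≠ 0` (`p` odd). [folklore] -/
private theorem add_self_ne_zero' (hp : p.Prime) (h17 : 17 ≤ p) {q : ZMod 6 × ZMod p} (hq : q.2 ≠ 0) : q + q ≠ 0 := by
  intro h
  have h2 : (2 : ZMod p) * q.2 = (0 : ZMod p) * q.2 := by
    have := congrArg Prod.snd h; simp only [Prod.snd_add, Prod.snd_zero] at this; linear_combination this
  exact kb_ne hp h17 hq (i := 2) (j := 0) (by norm_num) (by norm_num) (by norm_num) (by simpa using h2)

variable {T : Multiset (ZMod 6 × ZMod p)}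

/-- In a pair-free `T`, `−q ∉ T` for a member `q` with `2q ≠ 0`. [folklore] -/
private theorem Good.neg_not_mem (hT : Good T) {q : ZMod 6 × ZMod p} (hq : q ∈ T) (h2 : q + q ≠ 0) : -q ∉ T := by
  intro hn
  have hne : -q ≠ q := fun e ↦ h2 (by
    have h3 : q + q = q + -q := by rw [e]
    rw [h3, add_neg_cancel])
  exact hT.pf q hq (-q) ((Multiset.mem_erase_of_ne hne).2 hn) (add_neg_cancel q)

/-- `o(q) = #_q T ≥ 1` for a member `q` with `2q ≠ 0`. [folklore] -/
private theorem Good.oc_of_mem (hT : Good T) {q : ZMod 6 × ZMod p} (hq : q ∈ T) (h2 : q + q ≠ 0) :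
    oc T q = count q T ∧ 1 ≤ oc T q := by
  have h0 : count (-q) T = 0 := Multiset.count_eq_zero.2 (hT.neg_not_mem hq h2)
  have h1 : 1 ≤ count q T := Multiset.one_le_count_iff_mem.2 hq
  refine ⟨by simp [oc, h0], ?_⟩
  simp only [oc, h0, Nat.cast_zero, sub_zero]
  exact_mod_cast h1

/-- `o(q) > 0` forces `q ∈ T`. [folklore] -/
private theorem mem_of_oc_pos {q : ZMod 6 × ZMod p} (h : 0 < oc T q) : q ∈ T := by
  by_contra hq
  have : count q T = 0 := Multiset.count_eq_zero.2 hq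
  simp only [oc, this, Nat.cast_zero, zero_sub] at h
  have := count (-q) T
  omega

/-- `o(q) < 0` forces `−q ∈ T`. [folklore] -/
private theorem neg_mem_of_oc_neg {q : ZMod 6 × ZMod p} (h : oc T q < 0) : -q ∈ T := by
  by_contra hq
  have : count (-q) T = 0 := Multiset.count_eq_zero.2 hq
  simp only [oc, this, Nat.cast_zero, sub_zero] at h
  have := count q T
  omega

/-- `o(q) = 0` when neither `q` nor `−q` is a member. [folklore] -/
private theorem oc_eq_zero_of {q : ZMod 6 × ZMod p} (h1 : q ∉ T) (h2 : -q ∉ T) : oc T q = 0 := by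
  simp [oc, Multiset.count_eq_zero.2 h1, Multiset.count_eq_zero.2 h2]

/-- A `4`-element multiset containing a given member. [folklore] -/
private theorem exists_eq_cons_of_mem (hcard : Multiset.card T = 4) {a : ZMod 6 × ZMod p} (ha : a ∈ T) :
    ∃ x y z, T = a ::ₘ x ::ₘ y ::ₘ {z} := by
  obtain ⟨R, rfl⟩ := Multiset.exists_cons_of_mem ha
  have hR : Multiset.card R = 3 := by rw [Multiset.card_cons] at hcard; omega
  obtain ⟨x, y, z, rfl⟩ := Multiset.card_eq_three.1 hR
  exact ⟨x, y, z, rfl⟩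

/-- Two given members of a `4`-element multiset. [folklore] -/
private theorem exists_eq_cons_cons_of_mem (hcard : Multiset.card T = 4) {a a' : ZMod 6 × ZMod p} (ha : a ∈ T)
    (ha' : a' ∈ T.erase a) : ∃ y z, T = a ::ₘ a' ::ₘ y ::ₘ {z} := by
  obtain ⟨R, rfl⟩ := Multiset.exists_cons_of_mem ha
  rw [Multiset.erase_cons_head] at ha'
  obtain ⟨R', rfl⟩ := Multiset.exists_cons_of_mem ha'
  have hR : Multiset.card R' = 2 := by simp only [Multiset.card_cons] at hcard; omega
  obtain ⟨y, z, rfl⟩ := Multiset.card_eq_two.1 hR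
  exact ⟨y, z, rfl⟩

/-- Members of an explicit `4`-element multiset. [folklore] -/
private theorem mem_four {a x y z q : ZMod 6 × ZMod p} : q ∈ (a ::ₘ x ::ₘ y ::ₘ ({z} : Multiset (ZMod 6 × ZMod p))) ↔
    q = a ∨ q = x ∨ q = y ∨ q = z := by
  simp only [Multiset.mem_cons, Multiset.mem_singleton]

/-- The sum of an explicit `4`-element multiset. [folklore] -/
private theorem sum_four (a x y z : ZMod 6 × ZMod p) : (a ::ₘ x ::ₘ y ::ₘ ({z} : Multiset (ZMod 6 × ZMod p))).sum =
    a + x + y + z := by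
  simp only [Multiset.sum_cons, Multiset.sum_singleton]; abel

/-- Counting in an explicit `4`-element multiset. [folklore] -/
private theorem count_four (a x y z q : ZMod 6 × ZMod p) :
    (count q (a ::ₘ x ::ₘ y ::ₘ ({z} : Multiset (ZMod 6 × ZMod p))) : ℤ) =
      (if q = a then 1 else 0) + (if q = x then 1 else 0) + (if q = y then 1 else 0) + (if q = z then 1 else 0) := by
  simp only [Multiset.count_cons, Multiset.count_singleton, Nat.cast_add, Nat.cast_ite, Nat.cast_one, Nat.cast_zero]
  ring

/-- Three given members of a `4`-element multiset. [folklore] -/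
private theorem exists_eq_of_three_mem (hcard : Multiset.card T = 4) {a a' a'' : ZMod 6 × ZMod p} (ha : a ∈ T)
    (ha' : a' ∈ T.erase a) (ha'' : a'' ∈ (T.erase a).erase a') : ∃ z, T = a ::ₘ a' ::ₘ a'' ::ₘ {z} := by
  obtain ⟨R, rfl⟩ := Multiset.exists_cons_of_mem ha
  rw [Multiset.erase_cons_head] at ha' ha''
  obtain ⟨R', rfl⟩ := Multiset.exists_cons_of_mem ha'
  rw [Multiset.erase_cons_head] at ha''
  obtain ⟨R'', rfl⟩ := Multiset.exists_cons_of_mem ha''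
  have hR : Multiset.card R'' = 1 := by simp only [Multiset.card_cons] at hcard; omega
  obtain ⟨z, rfl⟩ := Multiset.card_eq_one.1 hR
  exact ⟨z, rfl⟩

/-- No unit-type or `E`-type member off the fibre `0`. [folklore] -/
private def NoUE (T : Multiset (ZMod 6 × ZMod p)) : Prop :=
  ∀ q ∈ T, q.2 ≠ 0 → q.1 ≠ 1 ∧ q.1 ≠ -1 ∧ q.1 ≠ 2 ∧ q.1 ≠ -2

/-- Under `NoUE`, `U ≡ 0 ≡ E` off `0`. [folklore] -/
private theorem cU_cE_eq_zero (hUE : NoUE T) {x : ZMod p} (hx : x ≠ 0) : cU T x = 0 ∧ cE T x = 0 := by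
  have h : ∀ e : ZMod 6, (e = 1 ∨ e = -1 ∨ e = 2 ∨ e = -2) → ∀ y : ZMod p, y ≠ 0 → count (e, y) T = 0 := by
    intro e he y hy
    rw [Multiset.count_eq_zero]
    intro hm
    obtain ⟨h1, h2, h3, h4⟩ := hUE _ hm hy
    rcases he with rfl | rfl | rfl | rfl
    · exact h1 rfl
    · exact h2 rfl
    · exact h3 rfl
    · exact h4 rfl
  have hx' : -x ≠ 0 := neg_ne_zero.2 hx
  simp only [cU, cE, oc, Prod.neg_mk, neg_neg, h 1 (Or.inl rfl) x hx, h (-1) (Or.inr (Or.inl rfl)) x hx,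
    h 1 (Or.inl rfl) (-x) hx', h (-1) (Or.inr (Or.inl rfl)) (-x) hx', h 2 (Or.inr (Or.inr (Or.inl rfl))) x hx,
    h (-2) (Or.inr (Or.inr (Or.inr rfl))) x hx, h 2 (Or.inr (Or.inr (Or.inl rfl))) (-x) hx',
    h (-2) (Or.inr (Or.inr (Or.inr rfl))) (-x) hx', Nat.cast_zero, sub_self, add_zero, and_self]

/-- Under `NoUE`, relation I reads `S(2y) = T(2y) − T(y)` (`y ≠ 0`). [folklore] -/
private theorem relT_of_noUE (hp : p.Prime) (h17 : 17 ≤ p) (hT : Good T) (hUE : NoUE T) {y : ZMod p} (hy : y ≠ 0) :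
    cS T (2 * y) = cT T (2 * y) - cT T y := by
  haveI := Fact.mk hp
  have h3 : (3 : ZMod p) ≠ 0 := by
    simpa using kb_ne hp h17 one_ne_zero (i := 3) (j := 0) (by norm_num) (by norm_num) (by norm_num)
  set b := y / 3 with hb
  have h3b : 3 * b = y := by rw [hb]; field_simp
  have hb0 : b ≠ 0 := fun e ↦ hy (by rw [← h3b, e, mul_zero])
  have h2b : 2 * b ≠ 0 := by simpa using kb_ne hp h17 hb0 (i := 2) (j := 0) (by norm_num) (by norm_num) (by norm_num)
  have h6b : 6 * b ≠ 0 := by simpa using kb_ne hp h17 hb0 (i := 6) (j := 0) (by norm_num) (by norm_num) (by norm_num)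
  have key := hT.relI b hb0
  rw [(cU_cE_eq_zero hUE hb0).1, (cU_cE_eq_zero hUE h2b).1, (cU_cE_eq_zero hUE h2b).2, (cU_cE_eq_zero hUE h6b).1,
    (cU_cE_eq_zero hUE h6b).2, show (6 : ZMod p) * b = 2 * y by rw [← h3b]; ring, h3b, (cU_cE_eq_zero hUE hy).1] at key
  linarith

/-- Under `NoUE`, `T(x) = #(3,x) − #(3,−x)` and `S(x) = #(0,x) − #(0,−x)`. [folklore] -/
private theorem cT_cS_eq (x : ZMod p) :
    cT T x = (count ((3 : ZMod 6), x) T : ℤ) - count ((3 : ZMod 6), -x) T ∧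
      cS T x = (count ((0 : ZMod 6), x) T : ℤ) - count ((0 : ZMod 6), -x) T := by
  simp only [cT, cS, oc, Prod.neg_mk, neg_zero, show (-3 : ZMod 6) = 3 by decide, and_self]

/-- **No `S`-only configuration**: if the only members off the fibre `0` are of type `S`, contradiction. [folklore] -/
private theorem noS_only (hp : p.Prime) (h17 : 17 ≤ p) (hT : Good T) (hUE : NoUE T)
    (hnoT : ∀ q ∈ T, q.2 ≠ 0 → q.1 ≠ 3) {d : ZMod p} (hd : d ≠ 0) (hmem : ((0 : ZMod 6), d) ∈ T) : False := by
  haveI := Fact.mk hp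
  have hT0 : ∀ x : ZMod p, x ≠ 0 → cT T x = 0 := fun x hx ↦ by
    rw [(cT_cS_eq x).1, Multiset.count_eq_zero.2 (fun h ↦ hnoT _ h hx rfl),
      Multiset.count_eq_zero.2 (fun h ↦ hnoT _ h (neg_ne_zero.2 hx) rfl)]
    simp
  have h2 : (2 : ZMod p) ≠ 0 := by
    simpa using kb_ne hp h17 one_ne_zero (i := 2) (j := 0) (by norm_num) (by norm_num) (by norm_num)
  set y := d / 2 with hy
  have h2y : 2 * y = d := by rw [hy]; field_simp
  have hy0 : y ≠ 0 := fun e ↦ hd (by rw [← h2y, e, mul_zero])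
  have key := relT_of_noUE hp h17 hT hUE hy0
  rw [h2y, hT0 d hd, hT0 y hy0, sub_zero] at key
  have := (hT.oc_of_mem hmem (add_self_ne_zero' hp h17 hd)).2
  rw [show oc T ((0 : ZMod 6), d) = cS T d from rfl] at this
  omega

/-- `T`-branch, three `T`-members `(3,d), (3,2d), (3,4d)`: impossible. [folklore] -/
private theorem classify_T_three (hp : p.Prime) (h17 : 17 ≤ p) (hT : Good T) (hUE : NoUE T) {d : ZMod p} (hd : d ≠ 0)
    (hmem : ((3 : ZMod 6), d) ∈ T) (h2d : ((3 : ZMod 6), 2 * d) ∈ T) (h4d : ((3 : ZMod 6), 4 * d) ∈ T) : False := by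
  haveI := Fact.mk hp
  have z03 : (0 : ZMod 6) ≠ 3 := by decide
  have n_2_1 : (2 * d : ZMod p) ≠ d := kb_pp hp h17 hd (i := 2) (j := 1) (by norm_num)
  have n_4_1 : (4 * d : ZMod p) ≠ d := kb_pp hp h17 hd (i := 4) (j := 1) (by norm_num)
  have n_4_2 : (4 * d : ZMod p) ≠ 2 * d := kb_pp hp h17 hd (i := 4) (j := 2) (by norm_num)
  have n_8_1 : (8 * d : ZMod p) ≠ d := kb_pp hp h17 hd (i := 8) (j := 1) (by norm_num)
  have n_8_2 : (8 * d : ZMod p) ≠ 2 * d := kb_pp hp h17 hd (i := 8) (j := 2) (by norm_num)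
  have n_8_4 : (8 * d : ZMod p) ≠ 4 * d := kb_pp hp h17 hd (i := 8) (j := 4) (by norm_num)
  have n_8_m7 : (8 * d : ZMod p) ≠ -(7 * d) := kb_pn hp h17 hd (i := 8) (j := 7) (by norm_num)
  have n_m8_1 : (-(8 * d) : ZMod p) ≠ d := kb_np hp h17 hd (i := 8) (j := 1) (by norm_num)
  have n_m8_2 : (-(8 * d) : ZMod p) ≠ 2 * d := kb_np hp h17 hd (i := 8) (j := 2) (by norm_num)
  have n_m8_4 : (-(8 * d) : ZMod p) ≠ 4 * d := kb_np hp h17 hd (i := 8) (j := 4) (by norm_num)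
  have n_m8_m7 : (-(8 * d) : ZMod p) ≠ -(7 * d) := kb_nn hp h17 hd (i := 8) (j := 7) (by norm_num)
  have n_4_m7 : (4 * d : ZMod p) ≠ -(7 * d) := kb_pn hp h17 hd (i := 4) (j := 7) (by norm_num)
  have n_m4_1 : (-(4 * d) : ZMod p) ≠ d := kb_np hp h17 hd (i := 4) (j := 1) (by norm_num)
  have n_m4_2 : (-(4 * d) : ZMod p) ≠ 2 * d := kb_np hp h17 hd (i := 4) (j := 2) (by norm_num)
  have n_m4_4 : (-(4 * d) : ZMod p) ≠ 4 * d := kb_np hp h17 hd (i := 4) (j := 4) (by norm_num)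
  have n_m4_m7 : (-(4 * d) : ZMod p) ≠ -(7 * d) := kb_nn hp h17 hd (i := 4) (j := 7) (by norm_num)
  have n_2_0 : (2 * d : ZMod p) ≠ 0 := kb_pp hp h17 hd (i := 2) (j := 0) (by norm_num)
  have n_4_0 : (4 * d : ZMod p) ≠ 0 := kb_pp hp h17 hd (i := 4) (j := 0) (by norm_num)
  have n_m2_1 : (-(2 * d) : ZMod p) ≠ d := kb_np hp h17 hd (i := 2) (j := 1) (by norm_num)
  have n_m2_2 : (-(2 * d) : ZMod p) ≠ 2 * d := kb_np hp h17 hd (i := 2) (j := 2) (by norm_num)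
  have hne1 : ((3 : ZMod 6), 2 * d) ≠ ((3 : ZMod 6), d) := fun e ↦ n_2_1 (Prod.mk.inj e).2
  have hne2 : ((3 : ZMod 6), 4 * d) ≠ ((3 : ZMod 6), d) := fun e ↦ n_4_1 (Prod.mk.inj e).2
  have hne3 : ((3 : ZMod 6), 4 * d) ≠ ((3 : ZMod 6), 2 * d) := fun e ↦ n_4_2 (Prod.mk.inj e).2
  have h2d' := (Multiset.mem_erase_of_ne hne1).2 h2d
  have h4d' := (Multiset.mem_erase_of_ne hne3).2 ((Multiset.mem_erase_of_ne hne2).2 h4d)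
  obtain ⟨z, hTeq⟩ := exists_eq_of_three_mem hT.card4 hmem h2d' h4d'
  have hz : z = ((3 : ZMod 6), -(7 * d)) := by
    have hs := hT.sum0
    rw [hTeq, sum_four] at hs
    have : z = -(((3 : ZMod 6), d) + ((3 : ZMod 6), 2 * d) + ((3 : ZMod 6), 4 * d)) := by
      linear_combination hs
    rw [this, Prod.ext_iff]
    simp only [Prod.neg_mk, Prod.mk_add_mk]
    exact ⟨by decide, by ring⟩
  subst hz
  have key := relT_of_noUE hp h17 hT hUE (y := 4 * d) (by simpa using n_4_0)
  rw [show (2 : ZMod p) * (4 * d) = 8 * d by ring, (cT_cS_eq (8 * d)).1, (cT_cS_eq (4 * d)).1, (cT_cS_eq (8 * d)).2,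
    hTeq] at key
  simp only [count_four, Prod.mk.injEq, z03, false_and, if_false, true_and, n_8_1, n_8_2, n_8_4, n_8_m7, n_m8_1,
    n_m8_2, n_m8_4, n_m8_m7, n_4_1, n_4_2, n_4_m7, n_m4_1, n_m4_2, n_m4_4, n_m4_m7, if_true] at key
  norm_num at key

/-- Numeral multiples of a pair. [folklore] -/
private theorem two_mul_mk (e : ZMod 6) (c : ZMod p) : (2 : ZMod 6 × ZMod p) * (e, c) = (2 * e, 2 * c) :=
  Prod.ext (by simp) (by simp)

/-- Numeral multiples of a pair. [folklore] -/
private theorem three_mul_mk (e : ZMod 6) (c : ZMod p) : (3 : ZMod 6 × ZMod p) * (e, c) = (3 * e, 3 * c) :=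
  Prod.ext (by simp) (by simp)

/-- Numeral multiples of a pair. [folklore] -/
private theorem four_mul_mk (e : ZMod 6) (c : ZMod p) : (4 : ZMod 6 × ZMod p) * (e, c) = (4 * e, 4 * c) :=
  Prod.ext (by simp) (by simp)

/-- Reordering of an explicit `4`-element multiset as a sum of singletons. [folklore] -/
private theorem four_eq_sum {X : Type*} (a b c d : X) :
    (a ::ₘ b ::ₘ c ::ₘ ({d} : Multiset X)) = ({a} + {b} + {c} + {d} : Multiset X) := by
  simp only [← Multiset.singleton_add, add_assoc]

/-- `T`-branch, shape `{(3,d), (0,−2d), (3,x), (0,d−x)}` with `(3,2d) ∉ T`: then `d = 2x` and `T = β_{(3,x)}`. [folklore] -/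
private theorem classify_T_two (hp : p.Prime) (h17 : 17 ≤ p) (hT : Good T) (hUE : NoUE T) {d x : ZMod p} (hd : d ≠ 0)
    (hx : x ≠ 0) (h2d : ((3 : ZMod 6), 2 * d) ∉ T)
    (hTeq : T = ((3 : ZMod 6), d) ::ₘ ((0 : ZMod 6), -(2 * d)) ::ₘ ((3 : ZMod 6), x) ::ₘ {((0 : ZMod 6), d - x)}) :
    IsStd T := by
  haveI := Fact.mk hp
  have z03 : (0 : ZMod 6) ≠ 3 := by decide
  have z30 : (3 : ZMod 6) ≠ 0 := by decide
  have h2p : (2 : ZMod p) ≠ 0 := by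
    simpa using kb_ne hp h17 one_ne_zero (i := 2) (j := 0) (by norm_num) (by norm_num) (by norm_num)
  have n_m1_1 : (-x : ZMod p) ≠ x := kb_np hp h17 hx (i := 1) (j := 1) (by norm_num)
  have n_2_1 : (2 * x : ZMod p) ≠ x := kb_pp hp h17 hx (i := 2) (j := 1) (by norm_num)
  have n_m2_1 : (-(2 * x) : ZMod p) ≠ x := kb_np hp h17 hx (i := 2) (j := 1) (by norm_num)
  have n_2_0 : (2 * x : ZMod p) ≠ 0 := kb_pp hp h17 hx (i := 2) (j := 0) (by norm_num)
  have n_3_0 : (3 * x : ZMod p) ≠ 0 := kb_pp hp h17 hx (i := 3) (j := 0) (by norm_num)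
  -- `x ≠ -d` (pair-freeness)
  have hxd : -x ≠ d := by
    intro e
    have hm : ((3 : ZMod 6), x) ∈ T := by rw [hTeq]; simp
    have hne : ((3 : ZMod 6), d) ≠ ((3 : ZMod 6), x) := fun h ↦ n_m1_1 (by rw [e]; exact (Prod.mk.inj h).2)
    have hm' : ((3 : ZMod 6), d) ∈ T.erase ((3 : ZMod 6), x) := (Multiset.mem_erase_of_ne hne).2 (by rw [hTeq]; simp)
    refine hT.pf _ hm _ hm' (Prod.ext ?_ ?_)
    · simp only [Prod.fst_add, Prod.fst_zero]; decide
    · simp only [Prod.snd_add, Prod.snd_zero, ← e, add_neg_cancel]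
  have f1 : 2 * x ≠ -(2 * d) := fun e ↦ hxd (by
    have := mul_left_cancel₀ h2p (e.trans (by ring : -(2 * d) = 2 * (-d))); rw [this, neg_neg])
  have f2 : (-(2 * x) = -(2 * d)) ↔ x = d := by
    rw [neg_inj]; exact ⟨fun e ↦ mul_left_cancel₀ h2p e, fun e ↦ by rw [e]⟩
  have f3 : -(2 * x) ≠ d - x := fun e ↦ hxd (by linear_combination e)
  -- relation at `x`
  have key := relT_of_noUE hp h17 hT hUE hx
  rw [(cT_cS_eq (2 * x)).1, (cT_cS_eq x).1, (cT_cS_eq (2 * x)).2, hTeq] at key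
  simp only [count_four, Prod.mk.injEq, z03, z30, false_and, if_false, true_and, f1, f2, f3, n_m1_1, n_2_1, n_m2_1,
    if_true] at key
  by_cases h2 : 2 * x = d
  · subst h2
    refine ⟨((3 : ZMod 6), x), Or.inr (Or.inl ?_)⟩
    rw [hTeq, famB]
    have e1 : ((3 : ZMod 6), x) + (3, 0) = ((0 : ZMod 6), 2 * x - x) := by
      rw [Prod.mk_add_mk, Prod.mk.injEq]; exact ⟨by decide, by ring⟩
    have e2 : 2 * ((3 : ZMod 6), x) + (3, 0) = ((3 : ZMod 6), 2 * x) := by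
      rw [two_mul_mk, Prod.mk_add_mk, Prod.mk.injEq]; exact ⟨by decide, by ring⟩
    have e3 : -(4 * ((3 : ZMod 6), x)) = ((0 : ZMod 6), -(2 * (2 * x))) := by
      rw [four_mul_mk, Prod.neg_mk, Prod.mk.injEq]; exact ⟨by decide, by ring⟩
    rw [e1, e2, e3, Multiset.insert_eq_cons, Multiset.insert_eq_cons, Multiset.insert_eq_cons, four_eq_sum,
      four_eq_sum]
    abel
  · exfalso
    simp only [h2, if_false] at key
    split_ifs at key <;> omega

/-- Swapping the last two members. [folklore] -/
private theorem cons_singleton_comm {X : Type*} (a b : X) : (a ::ₘ ({b} : Multiset X)) = b ::ₘ {a} :=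
  Multiset.pair_comm a b

/-- The six residues mod `6`. [folklore] -/
private theorem zmod6_cases (e : ZMod 6) : e = 0 ∨ e = 1 ∨ e = 2 ∨ e = 3 ∨ e = -2 ∨ e = -1 := by
  revert e; decide

/-- `T`-branch, shape `{(3,d), (0,−2d), y, z}` with `y.2 ≠ 0` and `(3,2d) ∉ T`. [folklore] -/
private theorem classify_T_one (hp : p.Prime) (h17 : 17 ≤ p) (hT : Good T) (hUE : NoUE T) {d : ZMod p} (hd : d ≠ 0)
    (h2d : ((3 : ZMod 6), 2 * d) ∉ T) {y z : ZMod 6 × ZMod p} (hy : y.2 ≠ 0)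
    (hTeq : T = ((3 : ZMod 6), d) ::ₘ ((0 : ZMod 6), -(2 * d)) ::ₘ y ::ₘ {z}) : IsStd T := by
  obtain ⟨ey, cy⟩ := y
  obtain ⟨ez, cz⟩ := z
  simp only at hy
  have hyT : ((ey, cy) : ZMod 6 × ZMod p) ∈ T := by rw [hTeq]; simp
  obtain ⟨hy1, hy5, hy2, hy4⟩ := hUE _ hyT hy
  simp only at hy1 hy5 hy2 hy4
  -- the sum
  have hs := hT.sum0
  rw [hTeq, sum_four, Prod.mk_add_mk, Prod.mk_add_mk, Prod.mk_add_mk, Prod.ext_iff] at hs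
  simp only [Prod.fst_zero, Prod.snd_zero] at hs
  obtain ⟨hse, hsc⟩ := hs
  have hcz : cz = d - cy := by linear_combination hsc
  subst hcz
  have hez : ez = -(3 + 0 + ey) := by linear_combination hse
  rcases zmod6_cases ey with rfl | rfl | rfl | rfl | rfl | rfl
  · -- `ey = 0`: `z = (3, d - cy)`
    have hez' : ez = 3 := by rw [hez]; decide
    subst hez'
    by_cases hdc : d - cy = 0
    · have hcy : cy = d := by linear_combination -hdc
      subst hcy
      refine ⟨((3 : ZMod 6), cy), Or.inl ?_⟩
      rw [hTeq, famA, hdc]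
      have e1 : ((3 : ZMod 6), cy) + (3, 0) = ((0 : ZMod 6), cy) := by
        rw [Prod.mk_add_mk, Prod.mk.injEq]; exact ⟨by decide, by ring⟩
      have e2 : -(2 * ((3 : ZMod 6), cy)) = ((0 : ZMod 6), -(2 * cy)) := by
        rw [two_mul_mk, Prod.neg_mk, Prod.mk.injEq]; exact ⟨by decide, by ring⟩
      rw [e1, e2, Multiset.insert_eq_cons, Multiset.insert_eq_cons, Multiset.insert_eq_cons, four_eq_sum, four_eq_sum]
      abel
    · refine classify_T_two hp h17 hT hUE hd hdc h2d (x := d - cy) ?_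
      rw [hTeq, show d - (d - cy) = cy by ring, cons_singleton_comm]
  · exact absurd rfl hy1
  · exact absurd rfl hy2
  · -- `ey = 3`: `z = (0, d - cy)`
    have hez' : ez = 0 := by rw [hez]; decide
    subst hez'
    by_cases hdc : d - cy = 0
    · exfalso
      refine hT.ne0 ((0 : ZMod 6), d - cy) (by rw [hTeq]; simp) ?_
      rw [hdc]; rfl
    · exact classify_T_two hp h17 hT hUE hd hy h2d (x := cy) hTeq
  · exact absurd rfl hy4
  · exact absurd rfl hy5

/-- **The `T`-branch.** A `T`-member `(3, d)`, `d ≠ 0`, and no unit/`E` members off the fibre `0`: `T` is standard. [folklore] -/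
private theorem classify_T (hp : p.Prime) (h17 : 17 ≤ p) (hT : Good T) (hUE : NoUE T) {d : ZMod p} (hd : d ≠ 0)
    (hmem : ((3 : ZMod 6), d) ∈ T) : IsStd T := by
  haveI := Fact.mk hp
  have z03 : (0 : ZMod 6) ≠ 3 := by decide
  have e33 : (-3 : ZMod 6) = 3 := by decide
  have n_2_1 : (2 * d : ZMod p) ≠ d := kb_pp hp h17 hd (i := 2) (j := 1) (by norm_num)
  have n_2_0 : (2 * d : ZMod p) ≠ 0 := kb_pp hp h17 hd (i := 2) (j := 0) (by norm_num)
  have n_4_0 : (4 * d : ZMod p) ≠ 0 := kb_pp hp h17 hd (i := 4) (j := 0) (by norm_num)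
  have n_4_1 : (4 * d : ZMod p) ≠ d := kb_pp hp h17 hd (i := 4) (j := 1) (by norm_num)
  have n_4_2 : (4 * d : ZMod p) ≠ 2 * d := kb_pp hp h17 hd (i := 4) (j := 2) (by norm_num)
  have n_m4_1 : (-(4 * d) : ZMod p) ≠ d := kb_np hp h17 hd (i := 4) (j := 1) (by norm_num)
  have n_m4_2 : (-(4 * d) : ZMod p) ≠ 2 * d := kb_np hp h17 hd (i := 4) (j := 2) (by norm_num)
  -- `T(d) ≥ 1`
  have hnd : ((3 : ZMod 6), -d) ∉ T := by
    have := hT.neg_not_mem hmem (add_self_ne_zero' hp h17 hd)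
    rwa [Prod.neg_mk, e33] at this
  have hTd : 1 ≤ cT T d := by
    rw [(cT_cS_eq d).1, Multiset.count_eq_zero.2 hnd, Nat.cast_zero, sub_zero]
    exact_mod_cast Multiset.one_le_count_iff_mem.2 hmem
  by_cases h2d : ((3 : ZMod 6), 2 * d) ∈ T
  · by_cases h4d : ((3 : ZMod 6), 4 * d) ∈ T
    · exact (classify_T_three hp h17 hT hUE hd hmem h2d h4d).elim
    · -- `(0, -4d) ∈ T`
      have hn2d : ((3 : ZMod 6), -(2 * d)) ∉ T := by
        have := hT.neg_not_mem h2d (add_self_ne_zero' hp h17 n_2_0)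
        rwa [Prod.neg_mk, e33] at this
      have hT2d : 1 ≤ cT T (2 * d) := by
        rw [(cT_cS_eq (2 * d)).1, Multiset.count_eq_zero.2 hn2d, Nat.cast_zero, sub_zero]
        exact_mod_cast Multiset.one_le_count_iff_mem.2 h2d
      have hT4d : cT T (4 * d) ≤ 0 := by
        rw [(cT_cS_eq (4 * d)).1, Multiset.count_eq_zero.2 h4d, Nat.cast_zero, zero_sub]
        have := count ((3 : ZMod 6), -(4 * d)) T
        omega
      have key := relT_of_noUE hp h17 hT hUE n_2_0
      rw [show (2 : ZMod p) * (2 * d) = 4 * d by ring] at key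
      have hS : cS T (4 * d) ≤ -1 := by omega
      have hmem4 : ((0 : ZMod 6), -(4 * d)) ∈ T := by
        have h := neg_mem_of_oc_neg (T := T) (q := ((0 : ZMod 6), 4 * d)) (by rw [show oc T (0, 4 * d) = cS T (4 * d) from rfl]; omega)
        rwa [Prod.neg_mk, neg_zero] at h
      have hne1 : ((3 : ZMod 6), 2 * d) ≠ ((3 : ZMod 6), d) := fun e ↦ n_2_1 (Prod.mk.inj e).2
      have hne2 : ((0 : ZMod 6), -(4 * d)) ≠ ((3 : ZMod 6), d) := fun e ↦ z03 (Prod.mk.inj e).1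
      have hne3 : ((0 : ZMod 6), -(4 * d)) ≠ ((3 : ZMod 6), 2 * d) := fun e ↦ z03 (Prod.mk.inj e).1
      obtain ⟨z, hTeq⟩ := exists_eq_of_three_mem hT.card4 hmem ((Multiset.mem_erase_of_ne hne1).2 h2d)
        ((Multiset.mem_erase_of_ne hne3).2 ((Multiset.mem_erase_of_ne hne2).2 hmem4))
      have hz : z = ((0 : ZMod 6), d) := by
        have hs := hT.sum0
        rw [hTeq, sum_four] at hs
        have : z = -(((3 : ZMod 6), d) + ((3 : ZMod 6), 2 * d) + ((0 : ZMod 6), -(4 * d))) := by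
          linear_combination hs
        rw [this]
        simp only [Prod.ext_iff, Prod.fst_add, Prod.snd_add, Prod.fst_neg, Prod.snd_neg]
        exact ⟨by decide, by ring⟩
      subst hz
      refine ⟨((3 : ZMod 6), d), Or.inr (Or.inl ?_)⟩
      rw [hTeq, famB]
      have e1 : ((3 : ZMod 6), d) + (3, 0) = ((0 : ZMod 6), d) := by
        rw [Prod.mk_add_mk, Prod.mk.injEq]; exact ⟨by decide, by ring⟩
      have e2 : 2 * ((3 : ZMod 6), d) + (3, 0) = ((3 : ZMod 6), 2 * d) := by
        rw [two_mul_mk, Prod.mk_add_mk, Prod.mk.injEq]; exact ⟨by decide, by ring⟩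
      have e3 : -(4 * ((3 : ZMod 6), d)) = ((0 : ZMod 6), -(4 * d)) := by
        rw [four_mul_mk, Prod.neg_mk, Prod.mk.injEq]; exact ⟨by decide, by ring⟩
      rw [e1, e2, e3, Multiset.insert_eq_cons, Multiset.insert_eq_cons, Multiset.insert_eq_cons, four_eq_sum,
        four_eq_sum]
      abel
  · -- `(3, 2d) ∉ T`: `(0, -2d) ∈ T`
    have hT2d : cT T (2 * d) ≤ 0 := by
      rw [(cT_cS_eq (2 * d)).1, Multiset.count_eq_zero.2 h2d, Nat.cast_zero, zero_sub]
      have := count ((3 : ZMod 6), -(2 * d)) T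
      omega
    have key := relT_of_noUE hp h17 hT hUE hd
    have hmem2 : ((0 : ZMod 6), -(2 * d)) ∈ T := by
      have h := neg_mem_of_oc_neg (T := T) (q := ((0 : ZMod 6), 2 * d)) (by rw [show oc T (0, 2 * d) = cS T (2 * d) from rfl]; omega)
      rwa [Prod.neg_mk, neg_zero] at h
    have hne : ((0 : ZMod 6), -(2 * d)) ≠ ((3 : ZMod 6), d) := fun e ↦ z03 (Prod.mk.inj e).1
    obtain ⟨y, z, hTeq⟩ := exists_eq_cons_cons_of_mem hT.card4 hmem ((Multiset.mem_erase_of_ne hne).2 hmem2)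
    -- one of `y`, `z` lies off the fibre `0`
    have hs := hT.sum0
    rw [hTeq, sum_four, Prod.ext_iff] at hs
    simp only [Prod.snd_add, Prod.snd_zero] at hs
    by_cases hy : y.2 = 0
    · have hz : z.2 ≠ 0 := by
        intro hz; apply hd; linear_combination -hs.2 + hy + hz
      refine classify_T_one (y := z) (z := y) hp h17 hT hUE hd h2d hz ?_
      rw [hTeq, cons_singleton_comm]
    · exact classify_T_one hp h17 hT hUE hd h2d hy hTeq

/-! ### The `E`-branch -/

/-- No unit-type member off the fibre `0`. [folklore] -/
private def NoU (T : Multiset (ZMod 6 × ZMod p)) : Prop := ∀ q ∈ T, q.2 ≠ 0 → q.1 ≠ 1 ∧ q.1 ≠ -1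

/-- Under `NoU`, `U⁻ ≡ 0` off `0` and hence `E⁻ ≡ 0` off `0` (relation II). [folklore] -/
private theorem cEm_eq_zero (hp : p.Prime) (h17 : 17 ≤ p) (hT : Good T) (hU : NoU T) {y : ZMod p} (hy : y ≠ 0) :
    cEm T y = 0 := by
  haveI := Fact.mk hp
  have hUm : ∀ x : ZMod p, x ≠ 0 → cUm T x = 0 := by
    intro x hx
    have h : ∀ e : ZMod 6, (e = 1 ∨ e = -1) → ∀ w : ZMod p, w ≠ 0 → count (e, w) T = 0 := by
      intro e he w hw
      rw [Multiset.count_eq_zero]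
      intro hm
      obtain ⟨h1, h2⟩ := hU _ hm hw
      rcases he with rfl | rfl
      · exact h1 rfl
      · exact h2 rfl
    have hx' : -x ≠ 0 := neg_ne_zero.2 hx
    simp only [cUm, oc, Prod.neg_mk, neg_neg, h 1 (Or.inl rfl) x hx, h (-1) (Or.inr rfl) x hx, h 1 (Or.inl rfl) (-x) hx',
      h (-1) (Or.inr rfl) (-x) hx', Nat.cast_zero, sub_self]
  have h2 : (2 : ZMod p) ≠ 0 := by
    simpa using kb_ne hp h17 one_ne_zero (i := 2) (j := 0) (by norm_num) (by norm_num) (by norm_num)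
  set x := y / 2 with hx
  have h2x : 2 * x = y := by rw [hx]; field_simp
  have hx0 : x ≠ 0 := fun e ↦ hy (by rw [← h2x, e, mul_zero])
  have key := hT.relII x hx0
  rw [cGam, h2x, hUm x hx0, hUm y hy] at key
  simpa using key

/-- `E`-branch, shape `{(2,6a), (−2,6a), (3,d₁), (3,d₂)}`: impossible. [folklore] -/
private theorem classify_E_TT (hp : p.Prime) (h17 : 17 ≤ p) (hT : Good T) {a d₁ d₂ : ZMod p} (ha : a ≠ 0)
    (hTeq : T = ((2 : ZMod 6), 6 * a) ::ₘ ((-2 : ZMod 6), 6 * a) ::ₘ ((3 : ZMod 6), d₁) ::ₘ {((3 : ZMod 6), d₂)}) :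
    False := by
  haveI := Fact.mk hp
  have z : ((1 : ZMod 6) ≠ 2 ∧ (1 : ZMod 6) ≠ -2 ∧ (1 : ZMod 6) ≠ 3 ∧ (-1 : ZMod 6) ≠ 2 ∧ (-1 : ZMod 6) ≠ -2 ∧
      (-1 : ZMod 6) ≠ 3 ∧ (2 : ZMod 6) ≠ -2 ∧ (2 : ZMod 6) ≠ 3 ∧ (-2 : ZMod 6) ≠ 2 ∧ (-2 : ZMod 6) ≠ 3 ∧
      (0 : ZMod 6) ≠ 2 ∧ (0 : ZMod 6) ≠ -2 ∧ (0 : ZMod 6) ≠ 3 ∧ (3 : ZMod 6) ≠ 2 ∧ (3 : ZMod 6) ≠ -2) := by decide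
  obtain ⟨z12, z1m2, z13, zm12, zm1m2, zm13, z2m2, z23, zm22, zm23, z02, z0m2, z03, z32, z3m2⟩ := z
  have n_m6_6 : (-(6 * a) : ZMod p) ≠ 6 * a := kb_np hp h17 ha (i := 6) (j := 6) (by norm_num)
  have n_18_6 : (18 * a : ZMod p) ≠ 6 * a := kb_pp hp h17 ha (i := 18) (j := 6) (by norm_num)
  have n_m18_6 : (-(18 * a) : ZMod p) ≠ 6 * a := kb_np hp h17 ha (i := 18) (j := 6) (by norm_num)
  have n_2_6 : (2 * a : ZMod p) ≠ 6 * a := kb_pp hp h17 ha (i := 2) (j := 6) (by norm_num)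
  have n_m2_6 : (-(2 * a) : ZMod p) ≠ 6 * a := kb_np hp h17 ha (i := 2) (j := 6) (by norm_num)
  have n_3_0 : (3 * a : ZMod p) ≠ 0 := kb_pp hp h17 ha (i := 3) (j := 0) (by norm_num)
  have n_1_0 : (a : ZMod p) ≠ 0 := kb_pp hp h17 ha (i := 1) (j := 0) (by norm_num)
  have n_18_3 : (18 * a : ZMod p) ≠ 3 * a := kb_pp hp h17 ha (i := 18) (j := 3) (by norm_num)
  have n_18_m6 : (18 * a : ZMod p) ≠ -(6 * a) := kb_pn hp h17 ha (i := 18) (j := 6) (by norm_num)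
  have n_m9_3 : (-(9 * a) : ZMod p) ≠ 3 * a := kb_np hp h17 ha (i := 9) (j := 3) (by norm_num)
  have n_m9_m6 : (-(9 * a) : ZMod p) ≠ -(6 * a) := kb_nn hp h17 ha (i := 9) (j := 6) (by norm_num)
  have n_21_m12 : (21 * a : ZMod p) ≠ -(12 * a) := kb_pn hp h17 ha (i := 21) (j := 12) (by norm_num)
  have n_12_m12 : (12 * a : ZMod p) ≠ -(12 * a) := kb_pn hp h17 ha (i := 12) (j := 12) (by norm_num)
  have n_m6_m12 : (-(6 * a) : ZMod p) ≠ -(12 * a) := kb_nn hp h17 ha (i := 6) (j := 12) (by norm_num)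
  have n_m15_m12 : (-(15 * a) : ZMod p) ≠ -(12 * a) := kb_nn hp h17 ha (i := 15) (j := 12) (by norm_num)
  -- the sum
  have hs := hT.sum0
  rw [hTeq, sum_four, Prod.ext_iff] at hs
  simp only [Prod.snd_add, Prod.snd_zero] at hs
  have hsum : d₁ + d₂ = -(12 * a) := by linear_combination hs.2
  -- the values of `U`, `E`, `S`
  have hU : ∀ x : ZMod p, cU T x = 0 := fun x ↦ by
    rw [hTeq]; simp only [cU, oc, count_four, Prod.neg_mk, neg_neg, Prod.mk.injEq, z12, z1m2, z13, zm12, zm1m2,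
      zm13, false_and, if_false]; norm_num
  have hS : ∀ x : ZMod p, cS T x = 0 := fun x ↦ by
    rw [hTeq]; simp only [cS, oc, count_four, Prod.neg_mk, neg_zero, Prod.mk.injEq, z02, z0m2, z03, false_and,
      if_false]; norm_num
  have hE6 : cE T (6 * a) = 2 := by
    rw [hTeq]; simp only [cE, oc, count_four, Prod.neg_mk, neg_neg, Prod.mk.injEq, z2m2, z23, zm22, zm23, n_m6_6,
      false_and, if_false, and_false, if_true, and_self]; norm_num
  have hE18 : cE T (18 * a) = 0 := by
    rw [hTeq]; simp only [cE, oc, count_four, Prod.neg_mk, neg_neg, Prod.mk.injEq, z2m2, z23, zm22, zm23, n_18_6,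
      n_m18_6, false_and, if_false, and_false]; norm_num
  have hE2 : cE T (2 * a) = 0 := by
    rw [hTeq]; simp only [cE, oc, count_four, Prod.neg_mk, neg_neg, Prod.mk.injEq, z2m2, z23, zm22, zm23, n_2_6,
      n_m2_6, false_and, if_false, and_false]; norm_num
  -- relation I at `3a` and at `a`
  have k3 := hT.relI (3 * a) (by simpa using n_3_0)
  rw [show (2 : ZMod p) * (3 * a) = 6 * a by ring, show (3 : ZMod p) * (3 * a) = 9 * a by ring,
    show (6 : ZMod p) * (3 * a) = 18 * a by ring, hU, hU, hU, hU, hE6, hE18, hS] at k3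
  have k1 := hT.relI a ha
  rw [hU, hU, hU, hU, hE2, hE6, hS] at k1
  -- two `T`-members
  have mem3 : ∀ x : ZMod p, ((3 : ZMod 6), x) ∈ T → x = d₁ ∨ x = d₂ := by
    intro x hx
    rw [hTeq, mem_four] at hx
    simp only [Prod.mk.injEq, z32, z3m2, false_and, false_or, true_and] at hx
    exact hx
  have e33 : (-3 : ZMod 6) = 3 := by decide
  have hx1 : ∃ x₁, (x₁ = 18 * a ∨ x₁ = -(9 * a)) ∧ (x₁ = d₁ ∨ x₁ = d₂) := by
    rcases le_or_gt 1 (cT T (18 * a)) with h | h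
    · exact ⟨18 * a, Or.inl rfl, mem3 _ (mem_of_oc_pos (T := T) (q := ((3 : ZMod 6), 18 * a)) (by simp only [cT] at h; omega))⟩
    · have h' : oc T ((3 : ZMod 6), 9 * a) < 0 := by simp only [cT] at h k3 ⊢; omega
      have := neg_mem_of_oc_neg h'
      rw [Prod.neg_mk, e33] at this
      exact ⟨-(9 * a), Or.inr rfl, mem3 _ this⟩
  have hx2 : ∃ x₂, (x₂ = 3 * a ∨ x₂ = -(6 * a)) ∧ (x₂ = d₁ ∨ x₂ = d₂) := by
    rcases le_or_gt 1 (cT T (3 * a)) with h | h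
    · exact ⟨3 * a, Or.inl rfl, mem3 _ (mem_of_oc_pos (T := T) (q := ((3 : ZMod 6), 3 * a)) (by simp only [cT] at h; omega))⟩
    · have h' : oc T ((3 : ZMod 6), 6 * a) < 0 := by simp only [cT] at h k1 ⊢; omega
      have := neg_mem_of_oc_neg h'
      rw [Prod.neg_mk, e33] at this
      exact ⟨-(6 * a), Or.inr rfl, mem3 _ this⟩
  obtain ⟨x₁, hx1v, hx1d⟩ := hx1
  obtain ⟨x₂, hx2v, hx2d⟩ := hx2
  have hne : x₁ ≠ x₂ := by
    rcases hx1v with rfl | rfl <;> rcases hx2v with rfl | rfl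
    · exact n_18_3
    · exact n_18_m6
    · exact n_m9_3
    · exact n_m9_m6
  have hxs : x₁ + x₂ = d₁ + d₂ := by
    rcases hx1d with rfl | rfl <;> rcases hx2d with rfl | rfl
    · exact absurd rfl hne
    · rfl
    · exact add_comm _ _
    · exact absurd rfl hne
  rw [hsum] at hxs
  rcases hx1v with rfl | rfl <;> rcases hx2v with rfl | rfl
  · exact n_21_m12 (by linear_combination hxs)
  · exact n_12_m12 (by linear_combination hxs)
  · exact n_m6_m12 (by linear_combination hxs)
  · exact n_m15_m12 (by linear_combination hxs)

/-- `E`-branch, shape `{(2,2b), (−2,2b), (0,c₁), (0,c₂)}`: then `T = γ_{(0,2b)}`. [folklore] -/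
private theorem classify_E_SS (hp : p.Prime) (h17 : 17 ≤ p) (hT : Good T) {b c₁ c₂ : ZMod p} (hb : b ≠ 0)
    (hTeq : T = ((2 : ZMod 6), 2 * b) ::ₘ ((-2 : ZMod 6), 2 * b) ::ₘ ((0 : ZMod 6), c₁) ::ₘ {((0 : ZMod 6), c₂)}) :
    IsStd T := by
  haveI := Fact.mk hp
  have z : ((1 : ZMod 6) ≠ 2 ∧ (1 : ZMod 6) ≠ -2 ∧ (1 : ZMod 6) ≠ 0 ∧ (-1 : ZMod 6) ≠ 2 ∧ (-1 : ZMod 6) ≠ -2 ∧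
      (-1 : ZMod 6) ≠ 0 ∧ (2 : ZMod 6) ≠ -2 ∧ (2 : ZMod 6) ≠ 0 ∧ (-2 : ZMod 6) ≠ 2 ∧ (-2 : ZMod 6) ≠ 0 ∧
      (0 : ZMod 6) ≠ 2 ∧ (0 : ZMod 6) ≠ -2 ∧ (3 : ZMod 6) ≠ 2 ∧ (3 : ZMod 6) ≠ -2 ∧ (3 : ZMod 6) ≠ 0) := by decide
  obtain ⟨z12, z1m2, z10, zm12, zm1m2, zm10, z2m2, z20, zm22, zm20, z02, z0m2, z32, z3m2, z30⟩ := z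
  have n_m2_2 : (-(2 * b) : ZMod p) ≠ 2 * b := kb_np hp h17 hb (i := 2) (j := 2) (by norm_num)
  have n_6_2 : (6 * b : ZMod p) ≠ 2 * b := kb_pp hp h17 hb (i := 6) (j := 2) (by norm_num)
  have n_m6_2 : (-(6 * b) : ZMod p) ≠ 2 * b := kb_np hp h17 hb (i := 6) (j := 2) (by norm_num)
  have hU : ∀ x : ZMod p, cU T x = 0 := fun x ↦ by
    rw [hTeq]; simp only [cU, oc, count_four, Prod.neg_mk, neg_neg, Prod.mk.injEq, z12, z1m2, z10, zm12, zm1m2,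
      zm10, false_and, if_false]; norm_num
  have hT3 : ∀ x : ZMod p, cT T x = 0 := fun x ↦ by
    rw [(cT_cS_eq x).1, hTeq]; simp only [count_four, Prod.mk.injEq, z32, z3m2, z30, false_and, if_false]; norm_num
  have hE2 : cE T (2 * b) = 2 := by
    rw [hTeq]; simp only [cE, oc, count_four, Prod.neg_mk, neg_neg, Prod.mk.injEq, z2m2, z20, zm22, zm20, n_m2_2,
      false_and, and_false, if_false, if_true, and_self]; norm_num
  have hE6 : cE T (6 * b) = 0 := by
    rw [hTeq]; simp only [cE, oc, count_four, Prod.neg_mk, neg_neg, Prod.mk.injEq, z2m2, z20, zm22, zm20, n_6_2,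
      n_m6_2, false_and, and_false, if_false]; norm_num
  have key := hT.relI b hb
  rw [hU, hU, hU, hU, hT3, hT3, hE2, hE6, (cT_cS_eq (6 * b)).2, hTeq] at key
  simp only [count_four, Prod.mk.injEq, z02, z0m2, false_and, if_false, true_and] at key
  have hs := hT.sum0
  rw [hTeq, sum_four, Prod.ext_iff] at hs
  simp only [Prod.snd_add, Prod.snd_zero] at hs
  have std : ∀ c₁' c₂' : ZMod p, (c₁' = -(6 * b) ∧ c₂' = 2 * b) →
      ((2 : ZMod 6), 2 * b) ::ₘ ((-2 : ZMod 6), 2 * b) ::ₘ ((0 : ZMod 6), c₁') ::ₘ ({((0 : ZMod 6), c₂')} :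
        Multiset (ZMod 6 × ZMod p)) = famC ((0 : ZMod 6), 2 * b) := by
    rintro _ _ ⟨rfl, rfl⟩
    rw [famC]
    have e1 : ((0 : ZMod 6), 2 * b) + (2, 0) = ((2 : ZMod 6), 2 * b) := by
      rw [Prod.mk_add_mk, Prod.mk.injEq]; exact ⟨by decide, by ring⟩
    have e2 : ((0 : ZMod 6), 2 * b) + (4, 0) = ((-2 : ZMod 6), 2 * b) := by
      rw [Prod.mk_add_mk, Prod.mk.injEq]; exact ⟨by decide, by ring⟩
    have e3 : -(3 * ((0 : ZMod 6), 2 * b)) = ((0 : ZMod 6), -(6 * b)) := by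
      rw [three_mul_mk, Prod.neg_mk, Prod.mk.injEq]; exact ⟨by decide, by ring⟩
    rw [e1, e2, e3, Multiset.insert_eq_cons, Multiset.insert_eq_cons, Multiset.insert_eq_cons, four_eq_sum,
      four_eq_sum]
    abel
  by_cases h1 : -(6 * b) = c₁
  · refine ⟨((0 : ZMod 6), 2 * b), Or.inr (Or.inr ?_)⟩
    rw [hTeq]
    exact std c₁ c₂ ⟨h1.symm, by linear_combination hs.2 + h1⟩
  by_cases h2 : -(6 * b) = c₂
  · refine ⟨((0 : ZMod 6), 2 * b), Or.inr (Or.inr ?_)⟩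
    rw [hTeq, cons_singleton_comm]
    exact std c₂ c₁ ⟨h2.symm, by linear_combination hs.2 + h2⟩
  exfalso
  simp only [h1, h2, if_false] at key
  split_ifs at key <;> omega

/-- `E`-branch, shape `{(2,c), (−2,c), (2,w), (−2,−2c−w)}` under `NoU`: impossible. [folklore] -/
private theorem classify_E_two (hp : p.Prime) (h17 : 17 ≤ p) (hT : Good T) (hU : NoU T) {c w : ZMod p} (hc : c ≠ 0)
    (hTeq : T = ((2 : ZMod 6), c) ::ₘ ((-2 : ZMod 6), c) ::ₘ ((2 : ZMod 6), w) ::ₘ {((-2 : ZMod 6), -(2 * c) - w)}) :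
    False := by
  haveI := Fact.mk hp
  have z : ((2 : ZMod 6) ≠ -2 ∧ (-2 : ZMod 6) ≠ 2) := by decide
  obtain ⟨z2m2, zm22⟩ := z
  have h2p : (2 : ZMod p) ≠ 0 := by
    simpa using kb_ne hp h17 one_ne_zero (i := 2) (j := 0) (by norm_num) (by norm_num) (by norm_num)
  have n_2_1 : (2 * c : ZMod p) ≠ c := kb_pp hp h17 hc (i := 2) (j := 1) (by norm_num)
  have n_2_0 : (2 * c : ZMod p) ≠ 0 := kb_pp hp h17 hc (i := 2) (j := 0) (by norm_num)
  have n_m2_1 : (-(2 * c) : ZMod p) ≠ c := kb_np hp h17 hc (i := 2) (j := 1) (by norm_num)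
  have n_2_m2 : (2 * c : ZMod p) ≠ -(2 * c) := kb_pn hp h17 hc (i := 2) (j := 2) (by norm_num)
  have n_m2_0 : (-(2 * c) : ZMod p) ≠ 0 := kb_np hp h17 hc (i := 2) (j := 0) (by norm_num)
  have n_m1_1 : (-c : ZMod p) ≠ c := kb_np hp h17 hc (i := 1) (j := 1) (by norm_num)
  have n_m1_m3 : (-c : ZMod p) ≠ -(3 * c) := kb_nn hp h17 hc (i := 1) (j := 3) (by norm_num)
  have n_1_m3 : (c : ZMod p) ≠ -(3 * c) := kb_pn hp h17 hc (i := 1) (j := 3) (by norm_num)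
  by_cases hw : w = 0
  · subst hw
    have key := cEm_eq_zero hp h17 hT hU (y := 2 * c) n_2_0
    rw [hTeq, sub_zero] at key
    simp only [cEm, oc, count_four, Prod.neg_mk, neg_neg, Prod.mk.injEq, z2m2, zm22, n_2_1, n_2_0, n_m2_1, n_2_m2,
      n_m2_0, false_and, and_false, if_false, if_true, and_self] at key
    norm_num at key
  -- `(−2, w) ∈ T`
  have hmw : ((2 : ZMod 6), w) ∈ T := by rw [hTeq]; simp
  have how := hT.oc_of_mem hmw (add_self_ne_zero' hp h17 hw)
  have e := cEm_eq_zero hp h17 hT hU hw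
  simp only [cEm] at e
  have hm2 : ((-2 : ZMod 6), w) ∈ T := mem_of_oc_pos (by omega)
  rw [hTeq, mem_four] at hm2
  simp only [Prod.mk.injEq, zm22, false_and, false_or, true_and] at hm2
  rcases hm2 with h | h
  · rw [h, show (-(2 * c) - c : ZMod p) = -(3 * c) by ring] at hTeq
    have key := cEm_eq_zero hp h17 hT hU hc
    rw [hTeq] at key
    simp only [cEm, oc, count_four, Prod.neg_mk, neg_neg, Prod.mk.injEq, z2m2, zm22, n_m1_1, n_m1_m3, n_1_m3,
      false_and, and_false, if_false, if_true, and_self] at key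
    norm_num at key
  · have hwc : w = -c := mul_left_cancel₀ h2p (by linear_combination h)
    subst hwc
    have hm : ((-2 : ZMod 6), c) ∈ T := by rw [hTeq]; simp
    have hne : ((2 : ZMod 6), -c) ≠ ((-2 : ZMod 6), c) := fun e ↦ absurd (Prod.mk.inj e).1 z2m2
    have hm' : ((2 : ZMod 6), -c) ∈ T.erase ((-2 : ZMod 6), c) :=
      (Multiset.mem_erase_of_ne hne).2 (by rw [hTeq]; simp)
    refine hT.pf _ hm _ hm' (Prod.ext ?_ ?_)
    · simp only [Prod.fst_add, Prod.fst_zero]; decide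
    · simp only [Prod.snd_add, Prod.snd_zero, add_neg_cancel]

/-- `E`-branch: a Good `T` without unit-type members off the fibre `0` but with an `E`-member is standard
(namely `γ_{(0,2b)}`). [folklore] -/
private theorem classify_E (hp : p.Prime) (h17 : 17 ≤ p) (hT : Good T) (hU : NoU T) {c : ZMod p} (hc : c ≠ 0)
    (hmem : ((2 : ZMod 6), c) ∈ T) : IsStd T := by
  haveI := Fact.mk hp
  have h2p : (2 : ZMod p) ≠ 0 := by
    simpa using kb_ne hp h17 one_ne_zero (i := 2) (j := 0) (by norm_num) (by norm_num) (by norm_num)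
  have h6p : (6 : ZMod p) ≠ 0 := by
    simpa using kb_ne hp h17 one_ne_zero (i := 6) (j := 0) (by norm_num) (by norm_num) (by norm_num)
  have n_m2_0 : (-(2 * c) : ZMod p) ≠ 0 := kb_np hp h17 hc (i := 2) (j := 0) (by norm_num)
  -- `(−2, c) ∈ T`
  have how := hT.oc_of_mem hmem (add_self_ne_zero' hp h17 hc)
  have e := cEm_eq_zero hp h17 hT hU hc
  simp only [cEm] at e
  have hm2 : ((-2 : ZMod 6), c) ∈ T := mem_of_oc_pos (by omega)
  have hne : ((-2 : ZMod 6), c) ≠ ((2 : ZMod 6), c) := fun h ↦ absurd (Prod.mk.inj h).1 (by decide)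
  obtain ⟨y, z, hTeq⟩ := exists_eq_cons_cons_of_mem hT.card4 hmem ((Multiset.mem_erase_of_ne hne).2 hm2)
  obtain ⟨ey, cy⟩ := y
  have hz : z = (-ey, -(2 * c) - cy) := by
    have hs := hT.sum0
    rw [hTeq, sum_four] at hs
    have : z = -(((2 : ZMod 6), c) + ((-2 : ZMod 6), c) + (ey, cy)) := by linear_combination hs
    rw [this, Prod.ext_iff]
    simp only [Prod.neg_mk, Prod.mk_add_mk]
    exact ⟨by ring, by ring⟩
  subst hz
  have hy : ((ey, cy) : ZMod 6 × ZMod p) ∈ T := by rw [hTeq]; simp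
  have hz : ((-ey, -(2 * c) - cy) : ZMod 6 × ZMod p) ∈ T := by rw [hTeq]; simp
  rcases zmod6_cases ey with rfl | rfl | rfl | rfl | rfl | rfl
  · -- `S S`
    rw [neg_zero] at hTeq
    refine classify_E_SS hp h17 hT (b := c / 2) (c₁ := cy) (c₂ := -(2 * c) - cy) (div_ne_zero hc h2p) ?_
    rw [show (2 : ZMod p) * (c / 2) = c by field_simp]
    exact hTeq
  · exfalso
    by_cases hcy : cy = 0
    · subst hcy
      exact (hU _ hz (by rw [sub_zero]; exact n_m2_0)).2 rfl
    · exact (hU _ hy hcy).1 rfl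
  · exact (classify_E_two hp h17 hT hU hc hTeq).elim
  · exfalso
    rw [show (-3 : ZMod 6) = 3 by decide] at hTeq
    refine classify_E_TT hp h17 hT (a := c / 6) (d₁ := cy) (d₂ := -(2 * c) - cy) (div_ne_zero hc h6p) ?_
    rw [show (6 : ZMod p) * (c / 6) = c by field_simp]
    exact hTeq
  · exfalso
    rw [neg_neg, cons_singleton_comm] at hTeq
    refine classify_E_two hp h17 hT hU hc (w := -(2 * c) - cy) ?_
    rw [show (-(2 * c) - (-(2 * c) - cy) : ZMod p) = cy by ring]
    exact hTeq
  · exfalso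
    rw [neg_neg] at hz
    by_cases hcy : cy = 0
    · subst hcy
      exact (hU _ hz (by rw [sub_zero]; exact n_m2_0)).1 rfl
    · exact (hU _ hy hcy).2 rfl

/-! ### The `U`-branch -/

/-- `U`-branch, pattern `{(1,b), (−2,c₁), (−2,c₂), (3,d)}` with `c₁ ∈ ±b`, `c₂ ∈ ±2b`: `T = α_{(1,b)}` (`c₁ = b`,
`c₂ = −2b`, `d = 0`); the three other sign choices violate relation I. [folklore] -/
private theorem classify_U_EE_core (hp : p.Prime) (h17 : 17 ≤ p) (hT : Good T) {b c₁ c₂ d : ZMod p} (hb : b ≠ 0)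
    (hTeq : T = ((1 : ZMod 6), b) ::ₘ ((-2 : ZMod 6), c₁) ::ₘ ((-2 : ZMod 6), c₂) ::ₘ {((3 : ZMod 6), d)})
    (h1 : b = c₁ ∨ -b = c₁) (h2 : 2 * b = c₂ ∨ -(2 * b) = c₂) : IsStd T := by
  haveI := Fact.mk hp
  have hs := hT.sum0
  rw [hTeq, sum_four, Prod.ext_iff] at hs
  simp only [Prod.snd_add, Prod.snd_zero] at hs
  obtain ⟨-, hs⟩ := hs
  have n_m6_m4 : (-(6 * b) : ZMod p) ≠ -(4 * b) := kb_nn hp h17 hb (i := 6) (j := 4) (by norm_num)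
  have n_m6_m2 : (-(6 * b) : ZMod p) ≠ -(2 * b) := kb_nn hp h17 hb (i := 6) (j := 2) (by norm_num)
  have n_m6_m1 : (-(6 * b) : ZMod p) ≠ -b := kb_nn hp h17 hb (i := 6) (j := 1) (by norm_num)
  have n_m6_1 : (-(6 * b) : ZMod p) ≠ b := kb_np hp h17 hb (i := 6) (j := 1) (by norm_num)
  have n_m6_2 : (-(6 * b) : ZMod p) ≠ 2 * b := kb_np hp h17 hb (i := 6) (j := 2) (by norm_num)
  have n_m3_m4 : (-(3 * b) : ZMod p) ≠ -(4 * b) := kb_nn hp h17 hb (i := 3) (j := 4) (by norm_num)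
  have n_m3_m2 : (-(3 * b) : ZMod p) ≠ -(2 * b) := kb_nn hp h17 hb (i := 3) (j := 2) (by norm_num)
  have n_m3_1 : (-(3 * b) : ZMod p) ≠ b := kb_np hp h17 hb (i := 3) (j := 1) (by norm_num)
  have n_m2_m1 : (-(2 * b) : ZMod p) ≠ -b := kb_nn hp h17 hb (i := 2) (j := 1) (by norm_num)
  have n_m2_1 : (-(2 * b) : ZMod p) ≠ b := kb_np hp h17 hb (i := 2) (j := 1) (by norm_num)
  have n_m2_2 : (-(2 * b) : ZMod p) ≠ 2 * b := kb_np hp h17 hb (i := 2) (j := 2) (by norm_num)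
  have n_m1_1 : (-b : ZMod p) ≠ b := kb_np hp h17 hb (i := 1) (j := 1) (by norm_num)
  have n_2_m1 : (2 * b : ZMod p) ≠ -b := kb_pn hp h17 hb (i := 2) (j := 1) (by norm_num)
  have n_2_1 : (2 * b : ZMod p) ≠ b := kb_pp hp h17 hb (i := 2) (j := 1) (by norm_num)
  have n_3_m4 : (3 * b : ZMod p) ≠ -(4 * b) := kb_pn hp h17 hb (i := 3) (j := 4) (by norm_num)
  have n_3_m2 : (3 * b : ZMod p) ≠ -(2 * b) := kb_pn hp h17 hb (i := 3) (j := 2) (by norm_num)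
  have n_3_1 : (3 * b : ZMod p) ≠ b := kb_pp hp h17 hb (i := 3) (j := 1) (by norm_num)
  have n_6_m4 : (6 * b : ZMod p) ≠ -(4 * b) := kb_pn hp h17 hb (i := 6) (j := 4) (by norm_num)
  have n_6_m2 : (6 * b : ZMod p) ≠ -(2 * b) := kb_pn hp h17 hb (i := 6) (j := 2) (by norm_num)
  have n_6_m1 : (6 * b : ZMod p) ≠ -b := kb_pn hp h17 hb (i := 6) (j := 1) (by norm_num)
  have n_6_1 : (6 * b : ZMod p) ≠ b := kb_pp hp h17 hb (i := 6) (j := 1) (by norm_num)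
  have n_6_2 : (6 * b : ZMod p) ≠ 2 * b := kb_pp hp h17 hb (i := 6) (j := 2) (by norm_num)
  rcases h1 with rfl | rfl <;> rcases h2 with rfl | rfl
  · -- `(b, 2b)`: `d = −4b`, relation I at `b` reads `2 = 0`
    have hd : d = -(4 * b) := by linear_combination hs
    subst hd
    exfalso
    have key := hT.relI (b) hb
    rw [hTeq] at key
    simp +decide only [cU, cE, cT, cS, cUm, cEm, oc, count_four, Prod.neg_mk, neg_neg, neg_zero, Prod.mk.injEq, false_and, and_false, true_and, and_true, if_false, if_true, and_self, n_m6_m4, n_m6_1, n_m6_2, n_m3_m4, n_m3_1, n_m2_1, n_m2_2, n_m1_1, n_2_1, n_3_m4, n_3_1, n_6_m4, n_6_1, n_6_2] at key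
  · -- `(b, −2b)`: `d = 0`, the `α`-family
    have hd : d = 0 := by linear_combination hs
    subst hd
    refine ⟨((1 : ZMod 6), b), Or.inl ?_⟩
    rw [hTeq, famA]
    have e1 : ((1 : ZMod 6), b) + (3, 0) = ((-2 : ZMod 6), b) := by
      rw [Prod.mk_add_mk, Prod.mk.injEq]; exact ⟨by decide, by ring⟩
    have e2 : -(2 * ((1 : ZMod 6), b)) = ((-2 : ZMod 6), -(2 * b)) := by
      rw [two_mul_mk, Prod.neg_mk, Prod.mk.injEq]; exact ⟨by decide, by ring⟩
    rw [e1, e2, Multiset.insert_eq_cons, Multiset.insert_eq_cons, Multiset.insert_eq_cons]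
  · -- `(−b, 2b)`: `d = −2b`, relation I at `b` reads `2 = 0`
    have hd : d = -(2 * b) := by linear_combination hs
    subst hd
    exfalso
    have key := hT.relI (b) hb
    rw [hTeq] at key
    simp +decide only [cU, cE, cT, cS, cUm, cEm, oc, count_four, Prod.neg_mk, neg_neg, neg_zero, Prod.mk.injEq, false_and, and_false, true_and, and_true, if_false, if_true, and_self, n_m6_m2, n_m6_m1, n_m6_1, n_m6_2, n_m3_m2, n_m3_1, n_m2_m1, n_m2_1, n_m2_2, n_m1_1, n_2_m1, n_2_1, n_3_m2, n_3_1, n_6_m2, n_6_m1, n_6_1, n_6_2] at key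
  · -- `(−b, −2b)`: `d = 2b`, relation I at `b/2` reads `−2 = 0`
    have hd : d = 2 * b := by linear_combination hs
    subst hd
    exfalso
    have h2p : (2 : ZMod p) ≠ 0 := by
      simpa using kb_ne hp h17 one_ne_zero (i := 2) (j := 0) (by norm_num) (by norm_num) (by norm_num)
    obtain ⟨a, rfl⟩ : ∃ a, b = 2 * a := ⟨b / 2, by field_simp⟩
    have ha : a ≠ 0 := fun e ↦ hb (by rw [e, mul_zero])
    rw [show (-(2 * (2 * a)) : ZMod p) = -(4 * a) by ring, show (2 * (2 * a) : ZMod p) = 4 * a by ring] at hTeq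
    have n_m6_m4 : (-(6 * a) : ZMod p) ≠ -(4 * a) := kb_nn hp h17 ha (i := 6) (j := 4) (by norm_num)
    have n_m6_m2 : (-(6 * a) : ZMod p) ≠ -(2 * a) := kb_nn hp h17 ha (i := 6) (j := 2) (by norm_num)
    have n_m6_2 : (-(6 * a) : ZMod p) ≠ 2 * a := kb_np hp h17 ha (i := 6) (j := 2) (by norm_num)
    have n_m6_4 : (-(6 * a) : ZMod p) ≠ 4 * a := kb_np hp h17 ha (i := 6) (j := 4) (by norm_num)
    have n_m3_2 : (-(3 * a) : ZMod p) ≠ 2 * a := kb_np hp h17 ha (i := 3) (j := 2) (by norm_num)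
    have n_m3_4 : (-(3 * a) : ZMod p) ≠ 4 * a := kb_np hp h17 ha (i := 3) (j := 4) (by norm_num)
    have n_m2_m4 : (-(2 * a) : ZMod p) ≠ -(4 * a) := kb_nn hp h17 ha (i := 2) (j := 4) (by norm_num)
    have n_m2_2 : (-(2 * a) : ZMod p) ≠ 2 * a := kb_np hp h17 ha (i := 2) (j := 2) (by norm_num)
    have n_m1_2 : (-a : ZMod p) ≠ 2 * a := kb_np hp h17 ha (i := 1) (j := 2) (by norm_num)
    have n_1_2 : (a : ZMod p) ≠ 2 * a := kb_pp hp h17 ha (i := 1) (j := 2) (by norm_num)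
    have n_2_m4 : (2 * a : ZMod p) ≠ -(4 * a) := kb_pn hp h17 ha (i := 2) (j := 4) (by norm_num)
    have n_2_m2 : (2 * a : ZMod p) ≠ -(2 * a) := kb_pn hp h17 ha (i := 2) (j := 2) (by norm_num)
    have n_3_2 : (3 * a : ZMod p) ≠ 2 * a := kb_pp hp h17 ha (i := 3) (j := 2) (by norm_num)
    have n_3_4 : (3 * a : ZMod p) ≠ 4 * a := kb_pp hp h17 ha (i := 3) (j := 4) (by norm_num)
    have n_6_m4 : (6 * a : ZMod p) ≠ -(4 * a) := kb_pn hp h17 ha (i := 6) (j := 4) (by norm_num)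
    have n_6_m2 : (6 * a : ZMod p) ≠ -(2 * a) := kb_pn hp h17 ha (i := 6) (j := 2) (by norm_num)
    have n_6_2 : (6 * a : ZMod p) ≠ 2 * a := kb_pp hp h17 ha (i := 6) (j := 2) (by norm_num)
    have n_6_4 : (6 * a : ZMod p) ≠ 4 * a := kb_pp hp h17 ha (i := 6) (j := 4) (by norm_num)
    have key := hT.relI (a) ha
    rw [hTeq] at key
    simp +decide only [cU, cE, cT, cS, cUm, cEm, oc, count_four, Prod.neg_mk, neg_neg, neg_zero, Prod.mk.injEq, false_and, and_false, true_and, and_true, if_false, if_true, and_self, n_m6_m4, n_m6_m2, n_m6_2, n_m6_4, n_m3_2, n_m3_4, n_m2_m4, n_m2_2, n_m1_2, n_1_2, n_2_m4, n_2_m2, n_3_2, n_3_4, n_6_m4, n_6_m2, n_6_2, n_6_4] at key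

/-- `U`-branch, pattern `{(1,b), (−2,c₁), (−2,c₂), z}`: `T = α_{(1,b)}`. Relation II at `b/2` and `b` puts one `cᵢ` in
`±b` and the other in `±2b`. [folklore] -/
private theorem classify_U_EE (hp : p.Prime) (h17 : 17 ≤ p) (hT : Good T) {b c₁ c₂ : ZMod p} {e : ZMod 6} {d : ZMod p}
    (hb : b ≠ 0) (hTeq : T = ((1 : ZMod 6), b) ::ₘ ((-2 : ZMod 6), c₁) ::ₘ ((-2 : ZMod 6), c₂) ::ₘ {(e, d)}) :
    IsStd T := by
  haveI := Fact.mk hp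
  have h2p : (2 : ZMod p) ≠ 0 := by
    simpa using kb_ne hp h17 one_ne_zero (i := 2) (j := 0) (by norm_num) (by norm_num) (by norm_num)
  -- `e = 3`
  have hs := hT.sum0
  rw [hTeq, sum_four, Prod.ext_iff] at hs
  simp only [Prod.fst_add, Prod.fst_zero] at hs
  have he : e = 3 := by linear_combination hs.1
  subst he
  have n_m2_1 : (-(2 * b) : ZMod p) ≠ b := kb_np hp h17 hb (i := 2) (j := 1) (by norm_num)
  have n_m1_m2 : (-b : ZMod p) ≠ -(2 * b) := kb_nn hp h17 hb (i := 1) (j := 2) (by norm_num)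
  have n_m1_1 : (-b : ZMod p) ≠ b := kb_np hp h17 hb (i := 1) (j := 1) (by norm_num)
  have n_m1_2 : (-b : ZMod p) ≠ 2 * b := kb_np hp h17 hb (i := 1) (j := 2) (by norm_num)
  have n_1_m2 : (b : ZMod p) ≠ -(2 * b) := kb_pn hp h17 hb (i := 1) (j := 2) (by norm_num)
  have n_1_2 : (b : ZMod p) ≠ 2 * b := kb_pp hp h17 hb (i := 1) (j := 2) (by norm_num)
  have n_2_1 : (2 * b : ZMod p) ≠ b := kb_pp hp h17 hb (i := 2) (j := 1) (by norm_num)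
  -- the signed unit counts at `b/2`, `b`, `2b`
  set y := b / 2 with hy
  have h2y : 2 * y = b := by rw [hy]; field_simp
  have hy0 : y ≠ 0 := fun e ↦ hb (by rw [← h2y, e, mul_zero])
  have hyb : y ≠ b := fun e ↦ n_1_2 (by rw [e] at h2y; linear_combination -h2y)
  have hyb' : -y ≠ b := fun e ↦ n_1_m2 (by rw [neg_eq_iff_eq_neg.mp e] at h2y; linear_combination -h2y)
  have hUm_y : cUm T y = 0 := by
    rw [hTeq]; simp +decide only [cU, cE, cT, cS, cUm, cEm, oc, count_four, Prod.neg_mk, neg_neg, neg_zero, Prod.mk.injEq, false_and, and_false, true_and, and_true, if_false, if_true, and_self, hyb, hyb']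
  have hUm_b : cUm T b = 1 := by
    rw [hTeq]; simp +decide only [cU, cE, cT, cS, cUm, cEm, oc, count_four, Prod.neg_mk, neg_neg, neg_zero, Prod.mk.injEq, false_and, and_false, true_and, and_true, if_false, if_true, and_self, n_m1_1]
  have hUm_2b : cUm T (2 * b) = 0 := by
    rw [hTeq]; simp +decide only [cU, cE, cT, cS, cUm, cEm, oc, count_four, Prod.neg_mk, neg_neg, neg_zero, Prod.mk.injEq, false_and, and_false, true_and, and_true, if_false, if_true, and_self, n_2_1, n_m2_1]
  have k1 := hT.relII y hy0
  rw [cGam, h2y, hUm_y, hUm_b] at k1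
  have k2 := hT.relII b hb
  rw [cGam, hUm_b, hUm_2b] at k2
  -- membership from `E⁻(x) = −1`
  have memE : ∀ x : ZMod p, cEm T x = -1 → (-x = c₁ ∨ -x = c₂) ∨ (x = c₁ ∨ x = c₂) := by
    intro x hx
    simp only [cEm] at hx
    rcases (show oc T (2, x) < 0 ∨ 0 < oc T (-2, x) by omega) with h | h
    · have := neg_mem_of_oc_neg h
      rw [Prod.neg_mk, hTeq, mem_four] at this
      simp +decide only [Prod.mk.injEq, false_and, true_and, false_or, or_false] at this
      exact Or.inl this
    · have := mem_of_oc_pos h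
      rw [hTeq, mem_four] at this
      simp +decide only [Prod.mk.injEq, false_and, true_and, false_or, or_false] at this
      exact Or.inr this
  have A := memE b (by omega)
  have B := memE (2 * b) (by omega)
  have key : ∀ c₁' c₂' : ZMod p,
      T = ((1 : ZMod 6), b) ::ₘ ((-2 : ZMod 6), c₁') ::ₘ ((-2 : ZMod 6), c₂') ::ₘ {((3 : ZMod 6), d)} →
        (b = c₁' ∨ -b = c₁') → (2 * b = c₂' ∨ -(2 * b) = c₂') → IsStd T :=
    fun c₁' c₂' h h1 h2 ↦ classify_U_EE_core hp h17 hT hb h h1 h2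
  have hTeq' : T = ((1 : ZMod 6), b) ::ₘ ((-2 : ZMod 6), c₂) ::ₘ ((-2 : ZMod 6), c₁) ::ₘ {((3 : ZMod 6), d)} := by
    rw [hTeq, Multiset.cons_swap ((-2 : ZMod 6), c₁)]
  rcases A with (h | h) | (h | h) <;> rcases B with (h' | h') | (h' | h')
  · exact absurd (h.trans h'.symm) n_m1_m2
  · exact key c₁ c₂ hTeq (Or.inr h) (Or.inr h')
  · exact absurd (h.trans h'.symm) n_m1_2
  · exact key c₁ c₂ hTeq (Or.inr h) (Or.inl h')
  · exact key c₂ c₁ hTeq' (Or.inr h) (Or.inr h')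
  · exact absurd (h.trans h'.symm) n_m1_m2
  · exact key c₂ c₁ hTeq' (Or.inr h) (Or.inl h')
  · exact absurd (h.trans h'.symm) n_m1_2
  · exact absurd (h.trans h'.symm) n_1_m2
  · exact key c₁ c₂ hTeq (Or.inl h) (Or.inr h')
  · exact absurd (h.trans h'.symm) n_1_2
  · exact key c₁ c₂ hTeq (Or.inl h) (Or.inl h')
  · exact key c₂ c₁ hTeq' (Or.inl h) (Or.inr h')
  · exact absurd (h.trans h'.symm) n_1_m2
  · exact key c₂ c₁ hTeq' (Or.inl h) (Or.inl h')
  · exact absurd (h.trans h'.symm) n_1_2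

/-- `U`-branch, pattern `{(1,b), (−1,b), (3,c), (3,−2b−c)}`: `T = γ_{(1,b)}` (`c ∈ {b, −3b}`); the other solutions
`c ∈ {6b, −8b}` of relation I at `b` violate relation I at `2b`. [folklore] -/
private theorem classify_U_TT (hp : p.Prime) (h17 : 17 ≤ p) (hT : Good T) {b c : ZMod p} (hb : b ≠ 0)
    (hTeq : T = ((1 : ZMod 6), b) ::ₘ ((-1 : ZMod 6), b) ::ₘ ((3 : ZMod 6), c) ::ₘ {((3 : ZMod 6), -(2 * b) - c)}) :
    IsStd T := by
  haveI := Fact.mk hp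
  have n_m12_m8 : (-(12 * b) : ZMod p) ≠ -(8 * b) := kb_nn hp h17 hb (i := 12) (j := 8) (by norm_num)
  have n_m12_1 : (-(12 * b) : ZMod p) ≠ b := kb_np hp h17 hb (i := 12) (j := 1) (by norm_num)
  have n_m12_6 : (-(12 * b) : ZMod p) ≠ 6 * b := kb_np hp h17 hb (i := 12) (j := 6) (by norm_num)
  have n_m6_m8 : (-(6 * b) : ZMod p) ≠ -(8 * b) := kb_nn hp h17 hb (i := 6) (j := 8) (by norm_num)
  have n_m6_1 : (-(6 * b) : ZMod p) ≠ b := kb_np hp h17 hb (i := 6) (j := 1) (by norm_num)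
  have n_m6_6 : (-(6 * b) : ZMod p) ≠ 6 * b := kb_np hp h17 hb (i := 6) (j := 6) (by norm_num)
  have n_m4_1 : (-(4 * b) : ZMod p) ≠ b := kb_np hp h17 hb (i := 4) (j := 1) (by norm_num)
  have n_m3_1 : (-(3 * b) : ZMod p) ≠ b := kb_np hp h17 hb (i := 3) (j := 1) (by norm_num)
  have n_m2_1 : (-(2 * b) : ZMod p) ≠ b := kb_np hp h17 hb (i := 2) (j := 1) (by norm_num)
  have n_m1_1 : (-b : ZMod p) ≠ b := kb_np hp h17 hb (i := 1) (j := 1) (by norm_num)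
  have n_2_1 : (2 * b : ZMod p) ≠ b := kb_pp hp h17 hb (i := 2) (j := 1) (by norm_num)
  have n_3_1 : (3 * b : ZMod p) ≠ b := kb_pp hp h17 hb (i := 3) (j := 1) (by norm_num)
  have n_4_1 : (4 * b : ZMod p) ≠ b := kb_pp hp h17 hb (i := 4) (j := 1) (by norm_num)
  have n_6_m8 : (6 * b : ZMod p) ≠ -(8 * b) := kb_pn hp h17 hb (i := 6) (j := 8) (by norm_num)
  have n_6_1 : (6 * b : ZMod p) ≠ b := kb_pp hp h17 hb (i := 6) (j := 1) (by norm_num)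
  have n_12_m8 : (12 * b : ZMod p) ≠ -(8 * b) := kb_pn hp h17 hb (i := 12) (j := 8) (by norm_num)
  have n_12_1 : (12 * b : ZMod p) ≠ b := kb_pp hp h17 hb (i := 12) (j := 1) (by norm_num)
  have n_12_6 : (12 * b : ZMod p) ≠ 6 * b := kb_pp hp h17 hb (i := 12) (j := 6) (by norm_num)
  have hU_1 : cU T (b) = 2 := by
    rw [hTeq]; simp +decide only [cU, cE, cT, cS, cUm, cEm, oc, count_four, Prod.neg_mk, neg_neg, neg_zero, Prod.mk.injEq, false_and, and_false, true_and, and_true, if_false, if_true, and_self, n_m12_m8, n_m12_1, n_m12_6, n_m6_m8, n_m6_1, n_m6_6, n_m4_1, n_m3_1, n_m2_1, n_m1_1, n_2_1, n_3_1, n_4_1, n_6_m8, n_6_1, n_12_m8, n_12_1, n_12_6]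
  have hU_2 : cU T (2 * b) = 0 := by
    rw [hTeq]; simp +decide only [cU, cE, cT, cS, cUm, cEm, oc, count_four, Prod.neg_mk, neg_neg, neg_zero, Prod.mk.injEq, false_and, and_false, true_and, and_true, if_false, if_true, and_self, n_m12_m8, n_m12_1, n_m12_6, n_m6_m8, n_m6_1, n_m6_6, n_m4_1, n_m3_1, n_m2_1, n_m1_1, n_2_1, n_3_1, n_4_1, n_6_m8, n_6_1, n_12_m8, n_12_1, n_12_6]
  have hE_2 : cE T (2 * b) = 0 := by
    rw [hTeq]; simp +decide only [cU, cE, cT, cS, cUm, cEm, oc, count_four, Prod.neg_mk, neg_neg, neg_zero, Prod.mk.injEq, false_and, and_false, true_and, and_true, if_false, if_true, and_self, n_m12_m8, n_m12_1, n_m12_6, n_m6_m8, n_m6_1, n_m6_6, n_m4_1, n_m3_1, n_m2_1, n_m1_1, n_2_1, n_3_1, n_4_1, n_6_m8, n_6_1, n_12_m8, n_12_1, n_12_6]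
  have hU_3 : cU T (3 * b) = 0 := by
    rw [hTeq]; simp +decide only [cU, cE, cT, cS, cUm, cEm, oc, count_four, Prod.neg_mk, neg_neg, neg_zero, Prod.mk.injEq, false_and, and_false, true_and, and_true, if_false, if_true, and_self, n_m12_m8, n_m12_1, n_m12_6, n_m6_m8, n_m6_1, n_m6_6, n_m4_1, n_m3_1, n_m2_1, n_m1_1, n_2_1, n_3_1, n_4_1, n_6_m8, n_6_1, n_12_m8, n_12_1, n_12_6]
  have hU_6 : cU T (6 * b) = 0 := by
    rw [hTeq]; simp +decide only [cU, cE, cT, cS, cUm, cEm, oc, count_four, Prod.neg_mk, neg_neg, neg_zero, Prod.mk.injEq, false_and, and_false, true_and, and_true, if_false, if_true, and_self, n_m12_m8, n_m12_1, n_m12_6, n_m6_m8, n_m6_1, n_m6_6, n_m4_1, n_m3_1, n_m2_1, n_m1_1, n_2_1, n_3_1, n_4_1, n_6_m8, n_6_1, n_12_m8, n_12_1, n_12_6]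
  have hE_6 : cE T (6 * b) = 0 := by
    rw [hTeq]; simp +decide only [cU, cE, cT, cS, cUm, cEm, oc, count_four, Prod.neg_mk, neg_neg, neg_zero, Prod.mk.injEq, false_and, and_false, true_and, and_true, if_false, if_true, and_self, n_m12_m8, n_m12_1, n_m12_6, n_m6_m8, n_m6_1, n_m6_6, n_m4_1, n_m3_1, n_m2_1, n_m1_1, n_2_1, n_3_1, n_4_1, n_6_m8, n_6_1, n_12_m8, n_12_1, n_12_6]
  have hS_6 : cS T (6 * b) = 0 := by
    rw [hTeq]; simp +decide only [cU, cE, cT, cS, cUm, cEm, oc, count_four, Prod.neg_mk, neg_neg, neg_zero, Prod.mk.injEq, false_and, and_false, true_and, and_true, if_false, if_true, and_self, n_m12_m8, n_m12_1, n_m12_6, n_m6_m8, n_m6_1, n_m6_6, n_m4_1, n_m3_1, n_m2_1, n_m1_1, n_2_1, n_3_1, n_4_1, n_6_m8, n_6_1, n_12_m8, n_12_1, n_12_6]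
  have key := hT.relI b hb
  rw [hU_1, hU_2, hE_2, hU_3, hU_6, hE_6, hS_6] at key
  have e33 : (-3 : ZMod 6) = 3 := by decide
  have mem3 : ∀ x : ZMod p, ((3 : ZMod 6), x) ∈ T → x = c ∨ x = -(2 * b) - c := by
    intro x hx
    rw [hTeq, mem_four] at hx
    simp +decide only [Prod.mk.injEq, false_and, true_and, false_or] at hx
    exact hx
  have hx1 : (6 * b = c ∨ 6 * b = -(2 * b) - c) ∨ (-(3 * b) = c ∨ -(3 * b) = -(2 * b) - c) := by
    rcases le_or_gt 1 (cT T (6 * b)) with h | h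
    · exact Or.inl (mem3 _ (mem_of_oc_pos (T := T) (q := ((3 : ZMod 6), 6 * b)) (by simp only [cT] at h; omega)))
    · have h' : oc T ((3 : ZMod 6), 3 * b) < 0 := by simp only [cT] at h key ⊢; omega
      have := neg_mem_of_oc_neg h'
      rw [Prod.neg_mk, e33] at this
      exact Or.inr (mem3 _ this)
  -- the `γ`-family
  have hC : ∀ c' : ZMod p, T = ((1 : ZMod 6), b) ::ₘ ((-1 : ZMod 6), b) ::ₘ ((3 : ZMod 6), c') ::ₘ {((3 : ZMod 6), -(2 * b) - c')} →
      (b = c' ∨ -(3 * b) = c') → T = famC ((1 : ZMod 6), b) := by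
    intro c' h hc'
    rw [h, famC]
    have e1 : ((1 : ZMod 6), b) + (2, 0) = ((3 : ZMod 6), b) := by
      rw [Prod.mk_add_mk, Prod.mk.injEq]; exact ⟨by decide, by ring⟩
    have e2 : ((1 : ZMod 6), b) + (4, 0) = ((-1 : ZMod 6), b) := by
      rw [Prod.mk_add_mk, Prod.mk.injEq]; exact ⟨by decide, by ring⟩
    have e3 : -(3 * ((1 : ZMod 6), b)) = ((3 : ZMod 6), -(3 * b)) := by
      rw [three_mul_mk, Prod.neg_mk, Prod.mk.injEq]; exact ⟨by decide, by ring⟩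
    rw [e1, e2, e3, Multiset.insert_eq_cons, Multiset.insert_eq_cons, Multiset.insert_eq_cons, four_eq_sum, four_eq_sum]
    rcases hc' with rfl | rfl
    · rw [show (-(2 * b) - b : ZMod p) = -(3 * b) by ring]; abel
    · rw [show (-(2 * b) - -(3 * b) : ZMod p) = b by ring]; abel
  rcases hx1 with (h | h) | (h | h)
  · -- `c = 6b`: relation I at `2b` reads `2 = 0`
    exfalso
    subst h
    rw [show (-(2 * b) - 6 * b : ZMod p) = -(8 * b) by ring] at hTeq
    have key := hT.relI (2 * b) (by simpa using kb_ne2 hp h17 hb (i := 2) (j := 0) (by norm_num))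
    rw [hTeq, show (2 : ZMod p) * (2 * b) = 4 * b by ring, show (3 : ZMod p) * (2 * b) = 6 * b by ring, show (6 : ZMod p) * (2 * b) = 12 * b by ring] at key
    simp +decide only [cU, cE, cT, cS, cUm, cEm, oc, count_four, Prod.neg_mk, neg_neg, neg_zero, Prod.mk.injEq, false_and, and_false, true_and, and_true, if_false, if_true, and_self, n_m12_m8, n_m12_1, n_m12_6, n_m6_m8, n_m6_1, n_m6_6, n_m4_1, n_m2_1, n_2_1, n_4_1, n_6_m8, n_6_1, n_12_m8, n_12_1, n_12_6] at key
  · -- `c = −8b`: the same multiset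
    exfalso
    have hc : -(8 * b) = c := by linear_combination -h
    subst hc
    rw [show (-(2 * b) - -(8 * b) : ZMod p) = 6 * b by ring] at hTeq
    have key := hT.relI (2 * b) (by simpa using kb_ne2 hp h17 hb (i := 2) (j := 0) (by norm_num))
    rw [hTeq, show (2 : ZMod p) * (2 * b) = 4 * b by ring, show (3 : ZMod p) * (2 * b) = 6 * b by ring, show (6 : ZMod p) * (2 * b) = 12 * b by ring] at key
    simp +decide only [cU, cE, cT, cS, cUm, cEm, oc, count_four, Prod.neg_mk, neg_neg, neg_zero, Prod.mk.injEq, false_and, and_false, true_and, and_true, if_false, if_true, and_self, n_m12_m8, n_m12_1, n_m12_6, n_m6_m8, n_m6_1, n_m6_6, n_m4_1, n_m2_1, n_2_1, n_4_1, n_6_m8, n_6_1, n_12_m8, n_12_1, n_12_6] at key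
  · exact ⟨_, Or.inr (Or.inr (hC c hTeq (Or.inr h)))⟩
  · have hc : b = c := by linear_combination -h
    exact ⟨_, Or.inr (Or.inr (hC c hTeq (Or.inl hc)))⟩

/-- `U`-branch, pattern `{(1,b), (−1,b), (0,c), (0,−2b−c)}`: impossible (relation I at `b` forces `{c, −2b−c} =
{−6b, 4b}`, and then relation I at `2b/3` reads `2 = 0`). [folklore] -/
private theorem classify_U_SS (hp : p.Prime) (h17 : 17 ≤ p) (hT : Good T) {b c : ZMod p} (hb : b ≠ 0)
    (hTeq : T = ((1 : ZMod 6), b) ::ₘ ((-1 : ZMod 6), b) ::ₘ ((0 : ZMod 6), c) ::ₘ {((0 : ZMod 6), -(2 * b) - c)}) :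
    False := by
  haveI := Fact.mk hp
  have h3p : (3 : ZMod p) ≠ 0 := by
    simpa using kb_ne hp h17 one_ne_zero (i := 3) (j := 0) (by norm_num) (by norm_num) (by norm_num)
  have n_m6_1 : (-(6 * b) : ZMod p) ≠ b := kb_np hp h17 hb (i := 6) (j := 1) (by norm_num)
  have n_m3_1 : (-(3 * b) : ZMod p) ≠ b := kb_np hp h17 hb (i := 3) (j := 1) (by norm_num)
  have n_m2_1 : (-(2 * b) : ZMod p) ≠ b := kb_np hp h17 hb (i := 2) (j := 1) (by norm_num)
  have n_m1_1 : (-b : ZMod p) ≠ b := kb_np hp h17 hb (i := 1) (j := 1) (by norm_num)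
  have n_2_1 : (2 * b : ZMod p) ≠ b := kb_pp hp h17 hb (i := 2) (j := 1) (by norm_num)
  have n_3_1 : (3 * b : ZMod p) ≠ b := kb_pp hp h17 hb (i := 3) (j := 1) (by norm_num)
  have n_6_1 : (6 * b : ZMod p) ≠ b := kb_pp hp h17 hb (i := 6) (j := 1) (by norm_num)
  have hU_1 : cU T (b) = 2 := by
    rw [hTeq]; simp +decide only [cU, cE, cT, cS, cUm, cEm, oc, count_four, Prod.neg_mk, neg_neg, neg_zero, Prod.mk.injEq, false_and, and_false, true_and, and_true, if_false, if_true, and_self, n_m6_1, n_m3_1, n_m2_1, n_m1_1, n_2_1, n_3_1, n_6_1]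
  have hU_2 : cU T (2 * b) = 0 := by
    rw [hTeq]; simp +decide only [cU, cE, cT, cS, cUm, cEm, oc, count_four, Prod.neg_mk, neg_neg, neg_zero, Prod.mk.injEq, false_and, and_false, true_and, and_true, if_false, if_true, and_self, n_m6_1, n_m3_1, n_m2_1, n_m1_1, n_2_1, n_3_1, n_6_1]
  have hE_2 : cE T (2 * b) = 0 := by
    rw [hTeq]; simp +decide only [cU, cE, cT, cS, cUm, cEm, oc, count_four, Prod.neg_mk, neg_neg, neg_zero, Prod.mk.injEq, false_and, and_false, true_and, and_true, if_false, if_true, and_self, n_m6_1, n_m3_1, n_m2_1, n_m1_1, n_2_1, n_3_1, n_6_1]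
  have hU_3 : cU T (3 * b) = 0 := by
    rw [hTeq]; simp +decide only [cU, cE, cT, cS, cUm, cEm, oc, count_four, Prod.neg_mk, neg_neg, neg_zero, Prod.mk.injEq, false_and, and_false, true_and, and_true, if_false, if_true, and_self, n_m6_1, n_m3_1, n_m2_1, n_m1_1, n_2_1, n_3_1, n_6_1]
  have hT_3 : cT T (3 * b) = 0 := by
    rw [hTeq]; simp +decide only [cU, cE, cT, cS, cUm, cEm, oc, count_four, Prod.neg_mk, neg_neg, neg_zero, Prod.mk.injEq, false_and, and_false, true_and, and_true, if_false, if_true, and_self, n_m6_1, n_m3_1, n_m2_1, n_m1_1, n_2_1, n_3_1, n_6_1]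
  have hU_6 : cU T (6 * b) = 0 := by
    rw [hTeq]; simp +decide only [cU, cE, cT, cS, cUm, cEm, oc, count_four, Prod.neg_mk, neg_neg, neg_zero, Prod.mk.injEq, false_and, and_false, true_and, and_true, if_false, if_true, and_self, n_m6_1, n_m3_1, n_m2_1, n_m1_1, n_2_1, n_3_1, n_6_1]
  have hE_6 : cE T (6 * b) = 0 := by
    rw [hTeq]; simp +decide only [cU, cE, cT, cS, cUm, cEm, oc, count_four, Prod.neg_mk, neg_neg, neg_zero, Prod.mk.injEq, false_and, and_false, true_and, and_true, if_false, if_true, and_self, n_m6_1, n_m3_1, n_m2_1, n_m1_1, n_2_1, n_3_1, n_6_1]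
  have hT_6 : cT T (6 * b) = 0 := by
    rw [hTeq]; simp +decide only [cU, cE, cT, cS, cUm, cEm, oc, count_four, Prod.neg_mk, neg_neg, neg_zero, Prod.mk.injEq, false_and, and_false, true_and, and_true, if_false, if_true, and_self, n_m6_1, n_m3_1, n_m2_1, n_m1_1, n_2_1, n_3_1, n_6_1]
  have key := hT.relI b hb
  rw [hU_1, hU_2, hE_2, hU_3, hT_3, hU_6, hE_6, hT_6] at key
  have memS : -(6 * b) = c ∨ -(6 * b) = -(2 * b) - c := by
    have h' : oc T ((0 : ZMod 6), 6 * b) < 0 := by simp only [cS] at key; omega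
    have := neg_mem_of_oc_neg h'
    rw [Prod.neg_mk, neg_zero, hTeq, mem_four] at this
    simp +decide only [Prod.mk.injEq, false_and, true_and, false_or] at this
    exact this
  obtain ⟨a, rfl⟩ : ∃ a, b = 3 * a := ⟨b / 3, by field_simp⟩
  have ha : a ≠ 0 := fun e ↦ hb (by rw [e, mul_zero])
  have n_m12_m18 : (-(12 * a) : ZMod p) ≠ -(18 * a) := kb_nn hp h17 ha (i := 12) (j := 18) (by norm_num)
  have n_m12_3 : (-(12 * a) : ZMod p) ≠ 3 * a := kb_np hp h17 ha (i := 12) (j := 3) (by norm_num)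
  have n_m12_12 : (-(12 * a) : ZMod p) ≠ 12 * a := kb_np hp h17 ha (i := 12) (j := 12) (by norm_num)
  have n_m6_3 : (-(6 * a) : ZMod p) ≠ 3 * a := kb_np hp h17 ha (i := 6) (j := 3) (by norm_num)
  have n_m4_3 : (-(4 * a) : ZMod p) ≠ 3 * a := kb_np hp h17 ha (i := 4) (j := 3) (by norm_num)
  have n_m2_3 : (-(2 * a) : ZMod p) ≠ 3 * a := kb_np hp h17 ha (i := 2) (j := 3) (by norm_num)
  have n_2_3 : (2 * a : ZMod p) ≠ 3 * a := kb_pp hp h17 ha (i := 2) (j := 3) (by norm_num)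
  have n_4_3 : (4 * a : ZMod p) ≠ 3 * a := kb_pp hp h17 ha (i := 4) (j := 3) (by norm_num)
  have n_6_3 : (6 * a : ZMod p) ≠ 3 * a := kb_pp hp h17 ha (i := 6) (j := 3) (by norm_num)
  have n_12_m18 : (12 * a : ZMod p) ≠ -(18 * a) := kb_pn hp h17 ha (i := 12) (j := 18) (by norm_num)
  have n_12_3 : (12 * a : ZMod p) ≠ 3 * a := kb_pp hp h17 ha (i := 12) (j := 3) (by norm_num)
  rcases memS with h | h
  · subst h
    rw [show (-(2 * (3 * a)) - -(6 * (3 * a)) : ZMod p) = 12 * a by ring,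
      show (-(6 * (3 * a)) : ZMod p) = -(18 * a) by ring] at hTeq
    have key := hT.relI (2 * a) (by simpa using kb_ne2 hp h17 ha (i := 2) (j := 0) (by norm_num))
    rw [hTeq, show (2 : ZMod p) * (2 * a) = 4 * a by ring, show (3 : ZMod p) * (2 * a) = 6 * a by ring, show (6 : ZMod p) * (2 * a) = 12 * a by ring] at key
    simp +decide only [cU, cE, cT, cS, cUm, cEm, oc, count_four, Prod.neg_mk, neg_neg, neg_zero, Prod.mk.injEq, false_and, and_false, true_and, and_true, if_false, if_true, and_self, n_m12_m18, n_m12_3, n_m12_12, n_m6_3, n_m4_3, n_m2_3, n_2_3, n_4_3, n_6_3, n_12_m18, n_12_3] at key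
  · have hc : 12 * a = c := by linear_combination -h
    subst hc
    rw [show (-(2 * (3 * a)) - 12 * a : ZMod p) = -(18 * a) by ring] at hTeq
    have key := hT.relI (2 * a) (by simpa using kb_ne2 hp h17 ha (i := 2) (j := 0) (by norm_num))
    rw [hTeq, show (2 : ZMod p) * (2 * a) = 4 * a by ring, show (3 : ZMod p) * (2 * a) = 6 * a by ring, show (6 : ZMod p) * (2 * a) = 12 * a by ring] at key
    simp +decide only [cU, cE, cT, cS, cUm, cEm, oc, count_four, Prod.neg_mk, neg_neg, neg_zero, Prod.mk.injEq, false_and, and_false, true_and, and_true, if_false, if_true, and_self, n_m12_m18, n_m12_3, n_m12_12, n_m6_3, n_m4_3, n_m2_3, n_2_3, n_4_3, n_6_3, n_12_m18, n_12_3] at key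

/-- `U`-branch, pattern `{(1,b), (−1,b′), y, z}` with `y, z` of weight `0`: `T = γ_{(1,b)}`. Relation II at `b, 2b`
gives `b′ = b`; the types of `y, z` are then `T` or `S` (`classify_U_TT`, `classify_U_SS`). [folklore] -/
private theorem classify_U_UU (hp : p.Prime) (h17 : 17 ≤ p) (hT : Good T) {b b' : ZMod p} {ey ez : ZMod 6}
    {cy cz : ZMod p} (hb : b ≠ 0) (hy : cy ≠ 0 → ey ≠ 1 ∧ ey ≠ -1 ∧ ey ≠ 2 ∧ ey ≠ -2)
    (hz : cz ≠ 0 → ez ≠ 1 ∧ ez ≠ -1 ∧ ez ≠ 2 ∧ ez ≠ -2)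
    (hTeq : T = ((1 : ZMod 6), b) ::ₘ ((-1 : ZMod 6), b') ::ₘ (ey, cy) ::ₘ {(ez, cz)}) : IsStd T := by
  haveI := Fact.mk hp
  have n_m4_1 : (-(4 * b) : ZMod p) ≠ b := kb_np hp h17 hb (i := 4) (j := 1) (by norm_num)
  have n_m2_1 : (-(2 * b) : ZMod p) ≠ b := kb_np hp h17 hb (i := 2) (j := 1) (by norm_num)
  have n_m1_1 : (-b : ZMod p) ≠ b := kb_np hp h17 hb (i := 1) (j := 1) (by norm_num)
  have n_2_0 : (2 * b : ZMod p) ≠ 0 := kb_pp hp h17 hb (i := 2) (j := 0) (by norm_num)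
  have n_2_1 : (2 * b : ZMod p) ≠ b := kb_pp hp h17 hb (i := 2) (j := 1) (by norm_num)
  have n_4_1 : (4 * b : ZMod p) ≠ b := kb_pp hp h17 hb (i := 4) (j := 1) (by norm_num)
  -- `b′ ≠ −b` (pair-freeness)
  have hbb' : -b ≠ b' := by
    intro e
    have hm : ((1 : ZMod 6), b) ∈ T := by rw [hTeq]; simp
    have hne : ((-1 : ZMod 6), b') ≠ ((1 : ZMod 6), b) := fun h ↦ absurd (Prod.mk.inj h).1 (by decide)
    have hm' : ((-1 : ZMod 6), b') ∈ T.erase ((1 : ZMod 6), b) :=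
      (Multiset.mem_erase_of_ne hne).2 (by rw [hTeq]; simp)
    refine hT.pf _ hm _ hm' (Prod.ext ?_ ?_)
    · simp only [Prod.fst_add, Prod.fst_zero]; decide
    · simp only [Prod.snd_add, Prod.snd_zero, ← e, add_neg_cancel]
  -- `z` from the sum
  have hs := hT.sum0
  rw [hTeq, sum_four] at hs
  have hz' : ((ez, cz) : ZMod 6 × ZMod p) = (-ey, -b - b' - cy) := by
    have : ((ez, cz) : ZMod 6 × ZMod p) = -(((1 : ZMod 6), b) + ((-1 : ZMod 6), b') + (ey, cy)) := by
      linear_combination hs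
    rw [this, Prod.ext_iff]
    simp only [Prod.neg_mk, Prod.mk_add_mk]
    exact ⟨by ring, by ring⟩
  obtain ⟨rfl, rfl⟩ := Prod.mk.inj hz'
  have hzc : cy = 0 → -b - b' - cy ≠ 0 := by
    rintro rfl; rw [sub_zero]; exact sub_ne_zero.2 hbb'
  rcases zmod6_cases ey with rfl | rfl | rfl | rfl | rfl | rfl
  · -- `ey = 0`: two `S`-members
    rw [neg_zero] at hTeq
    have k1 := hT.relII b hb
    have k2 := hT.relII (2 * b) n_2_0
    have h4 : (2 : ZMod p) * (2 * b) = 4 * b := by ring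
    rw [hTeq] at k1 k2
    simp +decide only [cGam, h4, cU, cE, cT, cS, cUm, cEm, oc, count_four, Prod.neg_mk, neg_neg, neg_zero, Prod.mk.injEq, false_and, and_false, true_and, and_true, if_false, if_true, and_self, hbb', n_m1_1, n_2_1, n_m2_1, n_4_1, n_m4_1] at k1 k2
    by_cases hbeq : b = b'
    swap
    · exfalso
      simp only [hbeq, if_false] at k1 k2
      split_ifs at k1 k2 <;> omega
    subst hbeq
    rw [show (-b - b - cy : ZMod p) = -(2 * b) - cy by ring] at hTeq
    exact (classify_U_SS hp h17 hT hb hTeq).elim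
  · exfalso
    by_cases hcy : cy = 0
    · exact (hz (hzc hcy)).2.1 (by decide)
    · exact (hy hcy).1 rfl
  · exfalso
    by_cases hcy : cy = 0
    · exact (hz (hzc hcy)).2.2.2 (by decide)
    · exact (hy hcy).2.2.1 rfl
  · -- `ey = 3`: two `T`-members
    rw [show (-3 : ZMod 6) = 3 by decide] at hTeq
    have k1 := hT.relII b hb
    have k2 := hT.relII (2 * b) n_2_0
    have h4 : (2 : ZMod p) * (2 * b) = 4 * b := by ring
    rw [hTeq] at k1 k2
    simp +decide only [cGam, h4, cU, cE, cT, cS, cUm, cEm, oc, count_four, Prod.neg_mk, neg_neg, neg_zero, Prod.mk.injEq, false_and, and_false, true_and, and_true, if_false, if_true, and_self, hbb', n_m1_1, n_2_1, n_m2_1, n_4_1, n_m4_1] at k1 k2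
    by_cases hbeq : b = b'
    swap
    · exfalso
      simp only [hbeq, if_false] at k1 k2
      split_ifs at k1 k2 <;> omega
    subst hbeq
    rw [show (-b - b - cy : ZMod p) = -(2 * b) - cy by ring] at hTeq
    exact classify_U_TT hp h17 hT hb hTeq
  · exfalso
    by_cases hcy : cy = 0
    · exact (hz (hzc hcy)).2.2.1 (by decide)
    · exact (hy hcy).2.2.2 rfl
  · exfalso
    by_cases hcy : cy = 0
    · exact (hz (hzc hcy)).1 (by decide)
    · exact (hy hcy).2.1 rfl

/-- `U⁻` is an even function of the fibre. [folklore] -/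
private theorem cUm_neg (x : ZMod p) : cUm T (-x) = cUm T x := by
  simp only [cUm]
  rw [show ((1 : ZMod 6), -x) = -((-1 : ZMod 6), x) by rw [Prod.neg_mk, neg_neg],
    show ((-1 : ZMod 6), -x) = -((1 : ZMod 6), x) by rw [Prod.neg_mk], oc_neg, oc_neg]
  ring

/-- `U`-branch, four unit-type members `{(1,b₁), (1,b₂), (−1,b₁), (−1,b₄)}` with `U⁻(b₁) ≤ 0`: impossible. [folklore] -/
private theorem classify_U_UUUU_aux (hp : p.Prime) (h17 : 17 ≤ p) (hT : Good T) {b₁ b₂ b₄ : ZMod p} (hb₁ : b₁ ≠ 0)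
    (hb₂ : b₂ ≠ 0) (hTeq : T = ((1 : ZMod 6), b₁) ::ₘ ((1 : ZMod 6), b₂) ::ₘ ((-1 : ZMod 6), b₁) ::ₘ {((-1 : ZMod 6), b₄)})
    (hle : cUm T b₁ ≤ 0) : False := by
  haveI := Fact.mk hp
  have h2p : (2 : ZMod p) ≠ 0 := by
    simpa using kb_ne hp h17 one_ne_zero (i := 2) (j := 0) (by norm_num) (by norm_num) (by norm_num)
  have n_m1_m3 : (-b₁ : ZMod p) ≠ -(3 * b₁) := kb_nn hp h17 hb₁ (i := 1) (j := 3) (by norm_num)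
  have n_m1_1 : (-b₁ : ZMod p) ≠ b₁ := kb_np hp h17 hb₁ (i := 1) (j := 1) (by norm_num)
  have n_1_m3 : (b₁ : ZMod p) ≠ -(3 * b₁) := kb_pn hp h17 hb₁ (i := 1) (j := 3) (by norm_num)
  have m_m1_1 : (-b₂ : ZMod p) ≠ b₂ := kb_np hp h17 hb₂ (i := 1) (j := 1) (by norm_num)
  have m_4_1 : (4 * b₂ : ZMod p) ≠ b₂ := kb_pp hp h17 hb₂ (i := 4) (j := 1) (by norm_num)
  have m_m4_1 : (-(4 * b₂) : ZMod p) ≠ b₂ := kb_np hp h17 hb₂ (i := 4) (j := 1) (by norm_num)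
  have m_2_0 : (2 * b₂ : ZMod p) ≠ 0 := kb_pp hp h17 hb₂ (i := 2) (j := 0) (by norm_num)
  have hs := hT.sum0
  rw [hTeq, sum_four, Prod.ext_iff] at hs
  simp only [Prod.snd_add, Prod.snd_zero] at hs
  obtain ⟨-, hs⟩ := hs
  -- pair-freeness: `(1,u), (−1,v) ∈ T ⇒ v ≠ −u`
  have hpf : ∀ u v : ZMod p, ((1 : ZMod 6), u) ∈ T → ((-1 : ZMod 6), v) ∈ T → -u ≠ v := by
    intro u v hu hv e
    have hne : ((-1 : ZMod 6), v) ≠ ((1 : ZMod 6), u) := fun h ↦ absurd (Prod.mk.inj h).1 (by decide)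
    refine hT.pf _ hu _ ((Multiset.mem_erase_of_ne hne).2 hv) (Prod.ext ?_ ?_)
    · simp only [Prod.fst_add, Prod.fst_zero]; decide
    · simp only [Prod.snd_add, Prod.snd_zero, ← e, add_neg_cancel]
  have i1 : ((1 : ZMod 6), b₁) ∈ T := by rw [hTeq]; simp
  have i2 : ((1 : ZMod 6), b₂) ∈ T := by rw [hTeq]; simp
  have i3 : ((-1 : ZMod 6), b₁) ∈ T := by rw [hTeq]; simp
  have i4 : ((-1 : ZMod 6), b₄) ∈ T := by rw [hTeq]; simp
  have pf24 := hpf _ _ i2 i4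
  have pf14 := hpf _ _ i1 i4
  have pf21 := hpf _ _ i2 i3
  by_cases h12 : b₁ = b₂
  · subst h12
    have hb4 : -(3 * b₁) = b₄ := by linear_combination -hs
    subst hb4
    have hv : cUm T b₁ = 1 := by
      rw [hTeq]; simp +decide only [cU, cE, cT, cS, cUm, cEm, oc, count_four, Prod.neg_mk, neg_neg, neg_zero, Prod.mk.injEq, false_and, and_false, true_and, and_true, if_false, if_true, and_self, n_m1_m3, n_m1_1, n_1_m3]
    omega
  have h21 : b₂ ≠ b₁ := fun e ↦ h12 e.symm
  by_cases h24 : b₂ = b₄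
  · subst h24
    have h2 : (2 : ZMod p) * (b₁ + b₂) = 0 := by linear_combination hs
    rcases mul_eq_zero.1 h2 with h | h
    · exact h2p h
    · exact pf21 (by linear_combination -h)
  have hv : cUm T b₂ = 1 := by
    rw [hTeq]; simp +decide only [cU, cE, cT, cS, cUm, cEm, oc, count_four, Prod.neg_mk, neg_neg, neg_zero, Prod.mk.injEq, false_and, and_false, true_and, and_true, if_false, if_true, and_self, h21, h24, pf24, pf21, m_m1_1]
  have hEm : ∀ x : ZMod p, cEm T x = 0 := fun x ↦ by
    rw [hTeq]; simp +decide only [cU, cE, cT, cS, cUm, cEm, oc, count_four, Prod.neg_mk, neg_neg, neg_zero, Prod.mk.injEq, false_and, and_false, true_and, and_true, if_false, if_true, and_self]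
  have hΓ : ∀ x : ZMod p, x ≠ 0 → cUm T (2 * x) = -cUm T x := fun x hx ↦ by
    have := hT.relII x hx
    rw [cGam, hEm] at this
    linarith
  have h4 : cUm T (4 * b₂) = 1 := by
    rw [show (4 : ZMod p) * b₂ = 2 * (2 * b₂) by ring, hΓ _ m_2_0, hΓ _ hb₂, hv]; ring
  have mem1 : ∀ x : ZMod p, ((1 : ZMod 6), x) ∈ T → x = b₁ ∨ x = b₂ := by
    intro x hx
    rw [hTeq, mem_four] at hx
    simp +decide only [Prod.mk.injEq, false_and, true_and, or_false] at hx
    exact hx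
  have hx : (4 * b₂ = b₁ ∨ 4 * b₂ = b₂) ∨ (-(4 * b₂) = b₁ ∨ -(4 * b₂) = b₂) := by
    rcases (show 0 < oc T (1, 4 * b₂) ∨ oc T (-1, 4 * b₂) < 0 by simp only [cUm] at h4; omega) with h | h
    · exact Or.inl (mem1 _ (mem_of_oc_pos h))
    · have := neg_mem_of_oc_neg h
      rw [Prod.neg_mk, neg_neg] at this
      exact Or.inr (mem1 _ this)
  rcases hx with (h | h) | (h | h)
  · rw [h] at h4; omega
  · exact m_4_1 h
  · rw [← cUm_neg, h] at h4; omega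
  · exact m_m4_1 h

/-- `U`-branch, four unit-type members `{(1,b₁), (1,b₂), (−1,b₃), (−1,b₄)}`: impossible. By relation II,
`U⁻(2x) = −U⁻(x)`; if `U⁻(b₁) > 0` then `±4b₁, ±2b₁, ±8b₁` are the other three fibres and the fibre sum
`(1 ± 4 ± 2 ± 8) b₁ ≠ 0` (`p ≥ 17`); otherwise `(−1, b₁) ∈ T` and `classify_U_UUUU_aux` applies. [folklore] -/
private theorem classify_U_UUUU (hp : p.Prime) (h17 : 17 ≤ p) (hT : Good T) {b₁ b₂ b₃ b₄ : ZMod p} (hb₁ : b₁ ≠ 0)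
    (hb₂ : b₂ ≠ 0)
    (hTeq : T = ((1 : ZMod 6), b₁) ::ₘ ((1 : ZMod 6), b₂) ::ₘ ((-1 : ZMod 6), b₃) ::ₘ {((-1 : ZMod 6), b₄)}) :
    False := by
  haveI := Fact.mk hp
  have n_m13_0 : (-(13 * b₁) : ZMod p) ≠ 0 := kb_np hp h17 hb₁ (i := 13) (j := 0) (by norm_num)
  have n_m9_0 : (-(9 * b₁) : ZMod p) ≠ 0 := kb_np hp h17 hb₁ (i := 9) (j := 0) (by norm_num)
  have n_m5_0 : (-(5 * b₁) : ZMod p) ≠ 0 := kb_np hp h17 hb₁ (i := 5) (j := 0) (by norm_num)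
  have n_m4_1 : (-(4 * b₁) : ZMod p) ≠ b₁ := kb_np hp h17 hb₁ (i := 4) (j := 1) (by norm_num)
  have n_m2_m8 : (-(2 * b₁) : ZMod p) ≠ -(8 * b₁) := kb_nn hp h17 hb₁ (i := 2) (j := 8) (by norm_num)
  have n_m2_8 : (-(2 * b₁) : ZMod p) ≠ 8 * b₁ := kb_np hp h17 hb₁ (i := 2) (j := 8) (by norm_num)
  have n_m1_0 : (-b₁ : ZMod p) ≠ 0 := kb_np hp h17 hb₁ (i := 1) (j := 0) (by norm_num)
  have n_2_m8 : (2 * b₁ : ZMod p) ≠ -(8 * b₁) := kb_pn hp h17 hb₁ (i := 2) (j := 8) (by norm_num)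
  have n_2_0 : (2 * b₁ : ZMod p) ≠ 0 := kb_pp hp h17 hb₁ (i := 2) (j := 0) (by norm_num)
  have n_2_8 : (2 * b₁ : ZMod p) ≠ 8 * b₁ := kb_pp hp h17 hb₁ (i := 2) (j := 8) (by norm_num)
  have n_3_0 : (3 * b₁ : ZMod p) ≠ 0 := kb_pp hp h17 hb₁ (i := 3) (j := 0) (by norm_num)
  have n_4_0 : (4 * b₁ : ZMod p) ≠ 0 := kb_pp hp h17 hb₁ (i := 4) (j := 0) (by norm_num)
  have n_4_1 : (4 * b₁ : ZMod p) ≠ b₁ := kb_pp hp h17 hb₁ (i := 4) (j := 1) (by norm_num)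
  have n_7_0 : (7 * b₁ : ZMod p) ≠ 0 := kb_pp hp h17 hb₁ (i := 7) (j := 0) (by norm_num)
  have n_11_0 : (11 * b₁ : ZMod p) ≠ 0 := kb_pp hp h17 hb₁ (i := 11) (j := 0) (by norm_num)
  have n_15_0 : (15 * b₁ : ZMod p) ≠ 0 := kb_pp hp h17 hb₁ (i := 15) (j := 0) (by norm_num)
  have hs := hT.sum0
  rw [hTeq, sum_four, Prod.ext_iff] at hs
  simp only [Prod.snd_add, Prod.snd_zero] at hs
  obtain ⟨-, hs⟩ := hs
  have hEm : ∀ x : ZMod p, cEm T x = 0 := fun x ↦ by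
    rw [hTeq]; simp +decide only [cU, cE, cT, cS, cUm, cEm, oc, count_four, Prod.neg_mk, neg_neg, neg_zero, Prod.mk.injEq, false_and, and_false, true_and, and_true, if_false, if_true, and_self]
  have hΓ : ∀ x : ZMod p, x ≠ 0 → cUm T (2 * x) = -cUm T x := fun x hx ↦ by
    have := hT.relII x hx
    rw [cGam, hEm] at this
    linarith
  have mem1 : ∀ x : ZMod p, ((1 : ZMod 6), x) ∈ T → x = b₁ ∨ x = b₂ := by
    intro x hx
    rw [hTeq, mem_four] at hx
    simp +decide only [Prod.mk.injEq, false_and, true_and, or_false] at hx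
    exact hx
  have memm1 : ∀ x : ZMod p, ((-1 : ZMod 6), x) ∈ T → x = b₃ ∨ x = b₄ := by
    intro x hx
    rw [hTeq, mem_four] at hx
    simp +decide only [Prod.mk.injEq, false_and, true_and, false_or] at hx
    exact hx
  have PosA : ∀ x : ZMod p, 0 < cUm T x → (x = b₁ ∨ x = b₂) ∨ (-x = b₁ ∨ -x = b₂) := by
    intro x hx
    rcases (show 0 < oc T (1, x) ∨ oc T (-1, x) < 0 by simp only [cUm] at hx; omega) with h | h
    · exact Or.inl (mem1 _ (mem_of_oc_pos h))
    · have := neg_mem_of_oc_neg h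
      rw [Prod.neg_mk, neg_neg] at this
      exact Or.inr (mem1 _ this)
  have NegB : ∀ x : ZMod p, cUm T x < 0 → (-x = b₃ ∨ -x = b₄) ∨ (x = b₃ ∨ x = b₄) := by
    intro x hx
    rcases (show oc T (1, x) < 0 ∨ 0 < oc T (-1, x) by simp only [cUm] at hx; omega) with h | h
    · have := neg_mem_of_oc_neg h
      rw [Prod.neg_mk] at this
      exact Or.inl (memm1 _ this)
    · exact Or.inr (memm1 _ (mem_of_oc_pos h))
  by_cases hpos : 0 < cUm T b₁
  · have h2 : cUm T (2 * b₁) < 0 := by rw [hΓ _ hb₁]; omega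
    have h4 : 0 < cUm T (4 * b₁) := by
      rw [show (4 : ZMod p) * b₁ = 2 * (2 * b₁) by ring, hΓ _ n_2_0, hΓ _ hb₁]; simpa using hpos
    have h8 : cUm T (8 * b₁) < 0 := by
      rw [show (8 : ZMod p) * b₁ = 2 * (4 * b₁) by ring, hΓ _ n_4_0]; omega
    have hA := PosA _ h4
    have hB := NegB _ h2
    have hC := NegB _ h8
    rcases hA with (hA | hA) | (hA | hA)
    · exact n_4_1 hA
    · subst hA
      rcases hB with (hB | hB) | (hB | hB) <;> rcases hC with (hC | hC) | (hC | hC)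
      · exact n_m2_m8 (hB.trans hC.symm)
      · subst hB; subst hC; exact n_m5_0 (by linear_combination hs)
      · exact n_m2_8 (hB.trans hC.symm)
      · subst hB; subst hC; exact n_11_0 (by linear_combination hs)
      · subst hB; subst hC; exact n_m5_0 (by linear_combination hs)
      · exact n_m2_m8 (hB.trans hC.symm)
      · subst hB; subst hC; exact n_11_0 (by linear_combination hs)
      · exact n_m2_8 (hB.trans hC.symm)
      · exact n_2_m8 (hB.trans hC.symm)
      · subst hB; subst hC; exact n_m1_0 (by linear_combination hs)
      · exact n_2_8 (hB.trans hC.symm)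
      · subst hB; subst hC; exact n_15_0 (by linear_combination hs)
      · subst hB; subst hC; exact n_m1_0 (by linear_combination hs)
      · exact n_2_m8 (hB.trans hC.symm)
      · subst hB; subst hC; exact n_15_0 (by linear_combination hs)
      · exact n_2_8 (hB.trans hC.symm)
    · exact n_m4_1 hA
    · subst hA
      rcases hB with (hB | hB) | (hB | hB) <;> rcases hC with (hC | hC) | (hC | hC)
      · exact n_m2_m8 (hB.trans hC.symm)
      · subst hB; subst hC; exact n_m13_0 (by linear_combination hs)
      · exact n_m2_8 (hB.trans hC.symm)
      · subst hB; subst hC; exact n_3_0 (by linear_combination hs)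
      · subst hB; subst hC; exact n_m13_0 (by linear_combination hs)
      · exact n_m2_m8 (hB.trans hC.symm)
      · subst hB; subst hC; exact n_3_0 (by linear_combination hs)
      · exact n_m2_8 (hB.trans hC.symm)
      · exact n_2_m8 (hB.trans hC.symm)
      · subst hB; subst hC; exact n_m9_0 (by linear_combination hs)
      · exact n_2_8 (hB.trans hC.symm)
      · subst hB; subst hC; exact n_7_0 (by linear_combination hs)
      · subst hB; subst hC; exact n_m9_0 (by linear_combination hs)
      · exact n_2_m8 (hB.trans hC.symm)
      · subst hB; subst hC; exact n_7_0 (by linear_combination hs)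
      · exact n_2_8 (hB.trans hC.symm)
  · have hle : cUm T b₁ ≤ 0 := by omega
    have h1 := hT.oc_of_mem (q := ((1 : ZMod 6), b₁)) (by rw [hTeq]; simp) (add_self_ne_zero' hp h17 hb₁)
    have hm : ((-1 : ZMod 6), b₁) ∈ T := mem_of_oc_pos (by simp only [cUm] at hle; omega)
    rcases memm1 _ hm with h | h
    · subst h
      exact classify_U_UUUU_aux hp h17 hT hb₁ hb₂ hTeq hle
    · subst h
      rw [cons_singleton_comm] at hTeq
      exact classify_U_UUUU_aux hp h17 hT hb₁ hb₂ hTeq hle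

/-- `U`-branch, pattern `{(1,b), (−1,b′), (2,c₁), (−2,c₂)}`: `T = β_{(1,b)}` (`b′ = 2b`) or `T = β_{(−1,b′)}` (`b = 2b′`).
Relation II at `b/2, b, b′/2, b′` places `c₁, c₂`; the fibre sum selects the signs. [folklore] -/
private theorem classify_U_UE (hp : p.Prime) (h17 : 17 ≤ p) (hT : Good T) {b b' c₁ c₂ : ZMod p} (hb : b ≠ 0)
    (hb' : b' ≠ 0) (hc₁ : c₁ ≠ 0)
    (hTeq : T = ((1 : ZMod 6), b) ::ₘ ((-1 : ZMod 6), b') ::ₘ ((2 : ZMod 6), c₁) ::ₘ {((-2 : ZMod 6), c₂)}) :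
    IsStd T := by
  haveI := Fact.mk hp
  have h2p : (2 : ZMod p) ≠ 0 := by
    simpa using kb_ne hp h17 one_ne_zero (i := 2) (j := 0) (by norm_num) (by norm_num) (by norm_num)
  have n_m6_m1 : (-(6 * b) : ZMod p) ≠ -b := kb_nn hp h17 hb (i := 6) (j := 1) (by norm_num)
  have n_m6_1 : (-(6 * b) : ZMod p) ≠ b := kb_np hp h17 hb (i := 6) (j := 1) (by norm_num)
  have n_m4_1 : (-(4 * b) : ZMod p) ≠ b := kb_np hp h17 hb (i := 4) (j := 1) (by norm_num)
  have n_m3_1 : (-(3 * b) : ZMod p) ≠ b := kb_np hp h17 hb (i := 3) (j := 1) (by norm_num)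
  have n_m2_m1 : (-(2 * b) : ZMod p) ≠ -b := kb_nn hp h17 hb (i := 2) (j := 1) (by norm_num)
  have n_m2_1 : (-(2 * b) : ZMod p) ≠ b := kb_np hp h17 hb (i := 2) (j := 1) (by norm_num)
  have n_m1_1 : (-b : ZMod p) ≠ b := kb_np hp h17 hb (i := 1) (j := 1) (by norm_num)
  have n_2_m1 : (2 * b : ZMod p) ≠ -b := kb_pn hp h17 hb (i := 2) (j := 1) (by norm_num)
  have n_2_0 : (2 * b : ZMod p) ≠ 0 := kb_pp hp h17 hb (i := 2) (j := 0) (by norm_num)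
  have n_2_1 : (2 * b : ZMod p) ≠ b := kb_pp hp h17 hb (i := 2) (j := 1) (by norm_num)
  have n_3_1 : (3 * b : ZMod p) ≠ b := kb_pp hp h17 hb (i := 3) (j := 1) (by norm_num)
  have n_4_1 : (4 * b : ZMod p) ≠ b := kb_pp hp h17 hb (i := 4) (j := 1) (by norm_num)
  have n_6_m1 : (6 * b : ZMod p) ≠ -b := kb_pn hp h17 hb (i := 6) (j := 1) (by norm_num)
  have n_6_1 : (6 * b : ZMod p) ≠ b := kb_pp hp h17 hb (i := 6) (j := 1) (by norm_num)
  have m_m1_1 : (-c₁ : ZMod p) ≠ c₁ := kb_np hp h17 hc₁ (i := 1) (j := 1) (by norm_num)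
  have hs := hT.sum0
  rw [hTeq, sum_four, Prod.ext_iff] at hs
  simp only [Prod.snd_add, Prod.snd_zero] at hs
  obtain ⟨-, hs⟩ := hs
  -- pair-freeness
  have hbb' : -b ≠ b' := by
    intro e
    have hm : ((1 : ZMod 6), b) ∈ T := by rw [hTeq]; simp
    have hne : ((-1 : ZMod 6), b') ≠ ((1 : ZMod 6), b) := fun h ↦ absurd (Prod.mk.inj h).1 (by decide)
    have hm' : ((-1 : ZMod 6), b') ∈ T.erase ((1 : ZMod 6), b) :=
      (Multiset.mem_erase_of_ne hne).2 (by rw [hTeq]; simp)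
    refine hT.pf _ hm _ hm' (Prod.ext ?_ ?_)
    · simp only [Prod.fst_add, Prod.fst_zero]; decide
    · simp only [Prod.snd_add, Prod.snd_zero, ← e, add_neg_cancel]
  have hcc : -c₁ ≠ c₂ := by
    intro e
    have hm : ((2 : ZMod 6), c₁) ∈ T := by rw [hTeq]; simp
    have hne : ((-2 : ZMod 6), c₂) ≠ ((2 : ZMod 6), c₁) := fun h ↦ absurd (Prod.mk.inj h).1 (by decide)
    have hm' : ((-2 : ZMod 6), c₂) ∈ T.erase ((2 : ZMod 6), c₁) :=
      (Multiset.mem_erase_of_ne hne).2 (by rw [hTeq]; simp)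
    refine hT.pf _ hm _ hm' (Prod.ext ?_ ?_)
    · simp only [Prod.fst_add, Prod.fst_zero]; decide
    · simp only [Prod.snd_add, Prod.snd_zero, ← e, add_neg_cancel]
  -- membership from the sign of `E⁻`
  have posE : ∀ x : ZMod p, 0 < cEm T x → x = c₁ ∨ -x = c₁ := by
    intro x hx
    rcases (show 0 < oc T (2, x) ∨ oc T (-2, x) < 0 by simp only [cEm] at hx; omega) with h | h
    · have := mem_of_oc_pos h
      rw [hTeq, mem_four] at this
      simp +decide only [Prod.mk.injEq, false_and, true_and, false_or, or_false] at this
      exact Or.inl this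
    · have := neg_mem_of_oc_neg h
      rw [Prod.neg_mk, neg_neg, hTeq, mem_four] at this
      simp +decide only [Prod.mk.injEq, false_and, true_and, false_or, or_false] at this
      exact Or.inr this
  have negE : ∀ x : ZMod p, cEm T x < 0 → x = c₂ ∨ -x = c₂ := by
    intro x hx
    rcases (show oc T (2, x) < 0 ∨ 0 < oc T (-2, x) by simp only [cEm] at hx; omega) with h | h
    · have := neg_mem_of_oc_neg h
      rw [Prod.neg_mk, hTeq, mem_four] at this
      simp +decide only [Prod.mk.injEq, false_and, true_and, false_or, or_false] at this
      exact Or.inr this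
    · have := mem_of_oc_pos h
      rw [hTeq, mem_four] at this
      simp +decide only [Prod.mk.injEq, false_and, true_and, false_or, or_false] at this
      exact Or.inl this
  by_cases hbeq : b = b'
  · -- `b′ = b`: `U⁻ ≡ 0`, so `E⁻ ≡ 0` off `0`, `c₂ = c₁ = −b`, and relation I at `b` reads `2 = 0`
    subst hbeq
    exfalso
    have hUm : ∀ x : ZMod p, cUm T x = 0 := fun x ↦ by
      rw [hTeq]; simp +decide only [cU, cE, cT, cS, cUm, cEm, oc, count_four, Prod.neg_mk, neg_neg, neg_zero, Prod.mk.injEq, false_and, and_false, true_and, and_true, if_false, if_true, and_self]; ring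
    have hEm0 : ∀ x : ZMod p, x ≠ 0 → cEm T x = 0 := by
      intro x hx
      set y := x / 2 with hy
      have h2y : 2 * y = x := by rw [hy]; field_simp
      have hy0 : y ≠ 0 := fun e ↦ hx (by rw [← h2y, e, mul_zero])
      have := hT.relII y hy0
      rwa [cGam, h2y, hUm, hUm, zero_add, zero_add] at this
    have hc2 : c₁ = c₂ := by
      by_contra hne
      have := hEm0 c₁ hc₁
      rw [hTeq] at this
      simp +decide only [cU, cE, cT, cS, cUm, cEm, oc, count_four, Prod.neg_mk, neg_neg, neg_zero, Prod.mk.injEq, false_and, and_false, true_and, and_true, if_false, if_true, and_self, hne, hcc, m_m1_1] at this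
    subst hc2
    have hc : -b = c₁ := by
      have h2 : (2 : ZMod p) * (b + c₁) = 0 := by linear_combination hs
      rcases mul_eq_zero.1 h2 with h | h
      · exact absurd h h2p
      · linear_combination -h
    subst hc
    have key := hT.relI (b) hb
    rw [hTeq] at key
    simp +decide only [cU, cE, cT, cS, cUm, cEm, oc, count_four, Prod.neg_mk, neg_neg, neg_zero, Prod.mk.injEq, false_and, and_false, true_and, and_true, if_false, if_true, and_self, n_m6_m1, n_m6_1, n_m3_1, n_m2_m1, n_m2_1, n_m1_1, n_2_m1, n_2_1, n_3_1, n_6_m1, n_6_1] at key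
  by_cases hceq : c₁ = c₂
  · -- `c₂ = c₁`: `E⁻ ≡ 0`, and relation II at `b, 2b` has no solution with `b′ ∉ ±b`
    subst hceq
    exfalso
    have hEm : ∀ x : ZMod p, cEm T x = 0 := fun x ↦ by
      rw [hTeq]; simp +decide only [cU, cE, cT, cS, cUm, cEm, oc, count_four, Prod.neg_mk, neg_neg, neg_zero, Prod.mk.injEq, false_and, and_false, true_and, and_true, if_false, if_true, and_self]; ring
    have k1 := hT.relII b hb
    have k2 := hT.relII (2 * b) n_2_0
    have h4 : (2 : ZMod p) * (2 * b) = 4 * b := by ring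
    rw [cGam, hEm, add_zero] at k1 k2
    rw [h4] at k2
    rw [hTeq] at k1 k2
    simp +decide only [cU, cE, cT, cS, cUm, cEm, oc, count_four, Prod.neg_mk, neg_neg, neg_zero, Prod.mk.injEq, false_and, and_false, true_and, and_true, if_false, if_true, and_self, hbb', hbeq, n_m1_1, n_2_1, n_m2_1, n_4_1, n_m4_1] at k1 k2
    split_ifs at k1 k2 <;> omega
  -- main case: `b′ ∉ ±b`, `c₂ ∉ ±c₁`
  by_cases hβ₂ : 2 * b = b' ∨ -(2 * b) = b'
  · by_cases hβ₁ : 2 * b' = b ∨ -(2 * b') = b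
    · exfalso
      rcases hβ₂ with h | h <;> rcases hβ₁ with h' | h' <;> rw [← h] at h'
      · exact n_4_1 (by linear_combination h')
      · exact n_m4_1 (by linear_combination h')
      · exact n_m4_1 (by linear_combination h')
      · exact n_4_1 (by linear_combination h')
    obtain ⟨a, rfl⟩ : ∃ a, b = 2 * a := ⟨b / 2, by field_simp⟩
    have ha : a ≠ 0 := fun e ↦ hb (by rw [e, mul_zero])
    have n_m12_0 : (-(12 * a) : ZMod p) ≠ 0 := kb_np hp h17 ha (i := 12) (j := 0) (by norm_num)
    have n_m8_m4 : (-(8 * a) : ZMod p) ≠ -(4 * a) := kb_nn hp h17 ha (i := 8) (j := 4) (by norm_num)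
    have n_m8_0 : (-(8 * a) : ZMod p) ≠ 0 := kb_np hp h17 ha (i := 8) (j := 0) (by norm_num)
    have n_m8_2 : (-(8 * a) : ZMod p) ≠ 2 * a := kb_np hp h17 ha (i := 8) (j := 2) (by norm_num)
    have n_m8_4 : (-(8 * a) : ZMod p) ≠ 4 * a := kb_np hp h17 ha (i := 8) (j := 4) (by norm_num)
    have n_m4_m2 : (-(4 * a) : ZMod p) ≠ -(2 * a) := kb_nn hp h17 ha (i := 4) (j := 2) (by norm_num)
    have n_m4_0 : (-(4 * a) : ZMod p) ≠ 0 := kb_np hp h17 ha (i := 4) (j := 0) (by norm_num)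
    have n_m4_2 : (-(4 * a) : ZMod p) ≠ 2 * a := kb_np hp h17 ha (i := 4) (j := 2) (by norm_num)
    have n_m4_4 : (-(4 * a) : ZMod p) ≠ 4 * a := kb_np hp h17 ha (i := 4) (j := 4) (by norm_num)
    have n_m2_m4 : (-(2 * a) : ZMod p) ≠ -(4 * a) := kb_nn hp h17 ha (i := 2) (j := 4) (by norm_num)
    have n_m2_2 : (-(2 * a) : ZMod p) ≠ 2 * a := kb_np hp h17 ha (i := 2) (j := 2) (by norm_num)
    have n_m2_4 : (-(2 * a) : ZMod p) ≠ 4 * a := kb_np hp h17 ha (i := 2) (j := 4) (by norm_num)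
    have n_m1_m4 : (-a : ZMod p) ≠ -(4 * a) := kb_nn hp h17 ha (i := 1) (j := 4) (by norm_num)
    have n_m1_2 : (-a : ZMod p) ≠ 2 * a := kb_np hp h17 ha (i := 1) (j := 2) (by norm_num)
    have n_m1_4 : (-a : ZMod p) ≠ 4 * a := kb_np hp h17 ha (i := 1) (j := 4) (by norm_num)
    have n_1_m4 : (a : ZMod p) ≠ -(4 * a) := kb_pn hp h17 ha (i := 1) (j := 4) (by norm_num)
    have n_1_2 : (a : ZMod p) ≠ 2 * a := kb_pp hp h17 ha (i := 1) (j := 2) (by norm_num)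
    have n_1_4 : (a : ZMod p) ≠ 4 * a := kb_pp hp h17 ha (i := 1) (j := 4) (by norm_num)
    have n_2_m4 : (2 * a : ZMod p) ≠ -(4 * a) := kb_pn hp h17 ha (i := 2) (j := 4) (by norm_num)
    have n_2_0 : (2 * a : ZMod p) ≠ 0 := kb_pp hp h17 ha (i := 2) (j := 0) (by norm_num)
    have n_2_4 : (2 * a : ZMod p) ≠ 4 * a := kb_pp hp h17 ha (i := 2) (j := 4) (by norm_num)
    have n_4_m4 : (4 * a : ZMod p) ≠ -(4 * a) := kb_pn hp h17 ha (i := 4) (j := 4) (by norm_num)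
    have n_4_m2 : (4 * a : ZMod p) ≠ -(2 * a) := kb_pn hp h17 ha (i := 4) (j := 2) (by norm_num)
    have n_4_0 : (4 * a : ZMod p) ≠ 0 := kb_pp hp h17 ha (i := 4) (j := 0) (by norm_num)
    have n_4_2 : (4 * a : ZMod p) ≠ 2 * a := kb_pp hp h17 ha (i := 4) (j := 2) (by norm_num)
    have n_8_m4 : (8 * a : ZMod p) ≠ -(4 * a) := kb_pn hp h17 ha (i := 8) (j := 4) (by norm_num)
    have n_8_0 : (8 * a : ZMod p) ≠ 0 := kb_pp hp h17 ha (i := 8) (j := 0) (by norm_num)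
    have n_8_2 : (8 * a : ZMod p) ≠ 2 * a := kb_pp hp h17 ha (i := 8) (j := 2) (by norm_num)
    have n_8_4 : (8 * a : ZMod p) ≠ 4 * a := kb_pp hp h17 ha (i := 8) (j := 4) (by norm_num)
    have n_12_0 : (12 * a : ZMod p) ≠ 0 := kb_pp hp h17 ha (i := 12) (j := 0) (by norm_num)
    have n_16_0 : (16 * a : ZMod p) ≠ 0 := kb_pp hp h17 ha (i := 16) (j := 0) (by norm_num)
    rcases hβ₂ with h | h
    · -- `b′ = 2b = 4a`: `T = β_{(1,2a)}`
      subst h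
      rw [show (2 * (2 * a) : ZMod p) = 4 * a by ring] at hTeq
      have hUm_1 : cUm T (a) = 0 := by
        rw [hTeq]; simp +decide only [cU, cE, cT, cS, cUm, cEm, oc, count_four, Prod.neg_mk, neg_neg, neg_zero, Prod.mk.injEq, false_and, and_false, true_and, and_true, if_false, if_true, and_self, n_m12_0, n_m8_m4, n_m8_0, n_m8_2, n_m8_4, n_m4_m2, n_m4_0, n_m4_2, n_m4_4, n_m2_m4, n_m2_2, n_m2_4, n_m1_m4, n_m1_2, n_m1_4, n_1_m4, n_1_2, n_1_4, n_2_m4, n_2_0, n_2_4, n_4_m4, n_4_m2, n_4_0, n_4_2, n_8_m4, n_8_0, n_8_2, n_8_4, n_12_0, n_16_0]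
      have hUm_2 : cUm T (2 * a) = 1 := by
        rw [hTeq]; simp +decide only [cU, cE, cT, cS, cUm, cEm, oc, count_four, Prod.neg_mk, neg_neg, neg_zero, Prod.mk.injEq, false_and, and_false, true_and, and_true, if_false, if_true, and_self, n_m12_0, n_m8_m4, n_m8_0, n_m8_2, n_m8_4, n_m4_m2, n_m4_0, n_m4_2, n_m4_4, n_m2_m4, n_m2_2, n_m2_4, n_m1_m4, n_m1_2, n_m1_4, n_1_m4, n_1_2, n_1_4, n_2_m4, n_2_0, n_2_4, n_4_m4, n_4_m2, n_4_0, n_4_2, n_8_m4, n_8_0, n_8_2, n_8_4, n_12_0, n_16_0]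
      have hUm_4 : cUm T (4 * a) = -1 := by
        rw [hTeq]; simp +decide only [cU, cE, cT, cS, cUm, cEm, oc, count_four, Prod.neg_mk, neg_neg, neg_zero, Prod.mk.injEq, false_and, and_false, true_and, and_true, if_false, if_true, and_self, n_m12_0, n_m8_m4, n_m8_0, n_m8_2, n_m8_4, n_m4_m2, n_m4_0, n_m4_2, n_m4_4, n_m2_m4, n_m2_2, n_m2_4, n_m1_m4, n_m1_2, n_m1_4, n_1_m4, n_1_2, n_1_4, n_2_m4, n_2_0, n_2_4, n_4_m4, n_4_m2, n_4_0, n_4_2, n_8_m4, n_8_0, n_8_2, n_8_4, n_12_0, n_16_0]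
      have hUm_8 : cUm T (8 * a) = 0 := by
        rw [hTeq]; simp +decide only [cU, cE, cT, cS, cUm, cEm, oc, count_four, Prod.neg_mk, neg_neg, neg_zero, Prod.mk.injEq, false_and, and_false, true_and, and_true, if_false, if_true, and_self, n_m12_0, n_m8_m4, n_m8_0, n_m8_2, n_m8_4, n_m4_m2, n_m4_0, n_m4_2, n_m4_4, n_m2_m4, n_m2_2, n_m2_4, n_m1_m4, n_m1_2, n_m1_4, n_1_m4, n_1_2, n_1_4, n_2_m4, n_2_0, n_2_4, n_4_m4, n_4_m2, n_4_0, n_4_2, n_8_m4, n_8_0, n_8_2, n_8_4, n_12_0, n_16_0]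
      have k1 := hT.relII a ha
      rw [cGam, hUm_1, hUm_2] at k1
      have k2 := hT.relII (4 * a) n_4_0
      rw [cGam, show (2 : ZMod p) * (4 * a) = 8 * a by ring, hUm_4, hUm_8] at k2
      rcases negE (2 * a) (by omega) with h1 | h1 <;> rcases posE (8 * a) (by omega) with h2 | h2 <;>
        subst h1 <;> subst h2
      · exact (n_16_0 (by linear_combination hs)).elim
      · refine ⟨((1 : ZMod 6), 2 * a), Or.inr (Or.inl ?_)⟩
        rw [hTeq, famB]
        have e1 : ((1 : ZMod 6), 2 * a) + (3, 0) = ((-2 : ZMod 6), 2 * a) := by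
          rw [Prod.mk_add_mk, Prod.mk.injEq]; exact ⟨by decide, by ring⟩
        have e2 : 2 * ((1 : ZMod 6), 2 * a) + (3, 0) = ((-1 : ZMod 6), 4 * a) := by
          rw [two_mul_mk, Prod.mk_add_mk, Prod.mk.injEq]; exact ⟨by decide, by ring⟩
        have e3 : -(4 * ((1 : ZMod 6), 2 * a)) = ((2 : ZMod 6), -(8 * a)) := by
          rw [four_mul_mk, Prod.neg_mk, Prod.mk.injEq]; exact ⟨by decide, by ring⟩
        rw [e1, e2, e3, Multiset.insert_eq_cons, Multiset.insert_eq_cons, Multiset.insert_eq_cons, four_eq_sum,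
          four_eq_sum]
        abel
      · exact (n_12_0 (by linear_combination hs)).elim
      · exact (n_m4_0 (by linear_combination hs)).elim
    · -- `b′ = −2b = −4a`: no sign choice has fibre sum `0`
      subst h
      exfalso
      rw [show (-(2 * (2 * a)) : ZMod p) = -(4 * a) by ring] at hTeq
      have hUm_1 : cUm T (a) = 0 := by
        rw [hTeq]; simp +decide only [cU, cE, cT, cS, cUm, cEm, oc, count_four, Prod.neg_mk, neg_neg, neg_zero, Prod.mk.injEq, false_and, and_false, true_and, and_true, if_false, if_true, and_self, n_m12_0, n_m8_m4, n_m8_0, n_m8_2, n_m8_4, n_m4_m2, n_m4_0, n_m4_2, n_m4_4, n_m2_m4, n_m2_2, n_m2_4, n_m1_m4, n_m1_2, n_m1_4, n_1_m4, n_1_2, n_1_4, n_2_m4, n_2_0, n_2_4, n_4_m4, n_4_m2, n_4_0, n_4_2, n_8_m4, n_8_0, n_8_2, n_8_4, n_12_0, n_16_0]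
      have hUm_2 : cUm T (2 * a) = 1 := by
        rw [hTeq]; simp +decide only [cU, cE, cT, cS, cUm, cEm, oc, count_four, Prod.neg_mk, neg_neg, neg_zero, Prod.mk.injEq, false_and, and_false, true_and, and_true, if_false, if_true, and_self, n_m12_0, n_m8_m4, n_m8_0, n_m8_2, n_m8_4, n_m4_m2, n_m4_0, n_m4_2, n_m4_4, n_m2_m4, n_m2_2, n_m2_4, n_m1_m4, n_m1_2, n_m1_4, n_1_m4, n_1_2, n_1_4, n_2_m4, n_2_0, n_2_4, n_4_m4, n_4_m2, n_4_0, n_4_2, n_8_m4, n_8_0, n_8_2, n_8_4, n_12_0, n_16_0]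
      have hUm_4 : cUm T (4 * a) = -1 := by
        rw [hTeq]; simp +decide only [cU, cE, cT, cS, cUm, cEm, oc, count_four, Prod.neg_mk, neg_neg, neg_zero, Prod.mk.injEq, false_and, and_false, true_and, and_true, if_false, if_true, and_self, n_m12_0, n_m8_m4, n_m8_0, n_m8_2, n_m8_4, n_m4_m2, n_m4_0, n_m4_2, n_m4_4, n_m2_m4, n_m2_2, n_m2_4, n_m1_m4, n_m1_2, n_m1_4, n_1_m4, n_1_2, n_1_4, n_2_m4, n_2_0, n_2_4, n_4_m4, n_4_m2, n_4_0, n_4_2, n_8_m4, n_8_0, n_8_2, n_8_4, n_12_0, n_16_0]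
      have hUm_8 : cUm T (8 * a) = 0 := by
        rw [hTeq]; simp +decide only [cU, cE, cT, cS, cUm, cEm, oc, count_four, Prod.neg_mk, neg_neg, neg_zero, Prod.mk.injEq, false_and, and_false, true_and, and_true, if_false, if_true, and_self, n_m12_0, n_m8_m4, n_m8_0, n_m8_2, n_m8_4, n_m4_m2, n_m4_0, n_m4_2, n_m4_4, n_m2_m4, n_m2_2, n_m2_4, n_m1_m4, n_m1_2, n_m1_4, n_1_m4, n_1_2, n_1_4, n_2_m4, n_2_0, n_2_4, n_4_m4, n_4_m2, n_4_0, n_4_2, n_8_m4, n_8_0, n_8_2, n_8_4, n_12_0, n_16_0]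
      have k1 := hT.relII a ha
      rw [cGam, hUm_1, hUm_2] at k1
      have k2 := hT.relII (4 * a) n_4_0
      rw [cGam, show (2 : ZMod p) * (4 * a) = 8 * a by ring, hUm_4, hUm_8] at k2
      rcases negE (2 * a) (by omega) with h1 | h1 <;> rcases posE (8 * a) (by omega) with h2 | h2 <;>
        subst h1 <;> subst h2
      · exact n_8_0 (by linear_combination hs)
      · exact n_m8_0 (by linear_combination hs)
      · exact n_4_0 (by linear_combination hs)
      · exact n_m12_0 (by linear_combination hs)
  by_cases hβ₁ : 2 * b' = b ∨ -(2 * b') = b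
  · obtain ⟨a, rfl⟩ : ∃ a, b' = 2 * a := ⟨b' / 2, by field_simp⟩
    have ha : a ≠ 0 := fun e ↦ hb' (by rw [e, mul_zero])
    have n_m12_0 : (-(12 * a) : ZMod p) ≠ 0 := kb_np hp h17 ha (i := 12) (j := 0) (by norm_num)
    have n_m8_m4 : (-(8 * a) : ZMod p) ≠ -(4 * a) := kb_nn hp h17 ha (i := 8) (j := 4) (by norm_num)
    have n_m8_0 : (-(8 * a) : ZMod p) ≠ 0 := kb_np hp h17 ha (i := 8) (j := 0) (by norm_num)
    have n_m8_2 : (-(8 * a) : ZMod p) ≠ 2 * a := kb_np hp h17 ha (i := 8) (j := 2) (by norm_num)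
    have n_m8_4 : (-(8 * a) : ZMod p) ≠ 4 * a := kb_np hp h17 ha (i := 8) (j := 4) (by norm_num)
    have n_m4_m2 : (-(4 * a) : ZMod p) ≠ -(2 * a) := kb_nn hp h17 ha (i := 4) (j := 2) (by norm_num)
    have n_m4_0 : (-(4 * a) : ZMod p) ≠ 0 := kb_np hp h17 ha (i := 4) (j := 0) (by norm_num)
    have n_m4_2 : (-(4 * a) : ZMod p) ≠ 2 * a := kb_np hp h17 ha (i := 4) (j := 2) (by norm_num)
    have n_m4_4 : (-(4 * a) : ZMod p) ≠ 4 * a := kb_np hp h17 ha (i := 4) (j := 4) (by norm_num)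
    have n_m2_m4 : (-(2 * a) : ZMod p) ≠ -(4 * a) := kb_nn hp h17 ha (i := 2) (j := 4) (by norm_num)
    have n_m2_2 : (-(2 * a) : ZMod p) ≠ 2 * a := kb_np hp h17 ha (i := 2) (j := 2) (by norm_num)
    have n_m2_4 : (-(2 * a) : ZMod p) ≠ 4 * a := kb_np hp h17 ha (i := 2) (j := 4) (by norm_num)
    have n_m1_m4 : (-a : ZMod p) ≠ -(4 * a) := kb_nn hp h17 ha (i := 1) (j := 4) (by norm_num)
    have n_m1_2 : (-a : ZMod p) ≠ 2 * a := kb_np hp h17 ha (i := 1) (j := 2) (by norm_num)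
    have n_m1_4 : (-a : ZMod p) ≠ 4 * a := kb_np hp h17 ha (i := 1) (j := 4) (by norm_num)
    have n_1_m4 : (a : ZMod p) ≠ -(4 * a) := kb_pn hp h17 ha (i := 1) (j := 4) (by norm_num)
    have n_1_2 : (a : ZMod p) ≠ 2 * a := kb_pp hp h17 ha (i := 1) (j := 2) (by norm_num)
    have n_1_4 : (a : ZMod p) ≠ 4 * a := kb_pp hp h17 ha (i := 1) (j := 4) (by norm_num)
    have n_2_m4 : (2 * a : ZMod p) ≠ -(4 * a) := kb_pn hp h17 ha (i := 2) (j := 4) (by norm_num)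
    have n_2_0 : (2 * a : ZMod p) ≠ 0 := kb_pp hp h17 ha (i := 2) (j := 0) (by norm_num)
    have n_2_4 : (2 * a : ZMod p) ≠ 4 * a := kb_pp hp h17 ha (i := 2) (j := 4) (by norm_num)
    have n_4_m4 : (4 * a : ZMod p) ≠ -(4 * a) := kb_pn hp h17 ha (i := 4) (j := 4) (by norm_num)
    have n_4_m2 : (4 * a : ZMod p) ≠ -(2 * a) := kb_pn hp h17 ha (i := 4) (j := 2) (by norm_num)
    have n_4_0 : (4 * a : ZMod p) ≠ 0 := kb_pp hp h17 ha (i := 4) (j := 0) (by norm_num)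
    have n_4_2 : (4 * a : ZMod p) ≠ 2 * a := kb_pp hp h17 ha (i := 4) (j := 2) (by norm_num)
    have n_8_m4 : (8 * a : ZMod p) ≠ -(4 * a) := kb_pn hp h17 ha (i := 8) (j := 4) (by norm_num)
    have n_8_0 : (8 * a : ZMod p) ≠ 0 := kb_pp hp h17 ha (i := 8) (j := 0) (by norm_num)
    have n_8_2 : (8 * a : ZMod p) ≠ 2 * a := kb_pp hp h17 ha (i := 8) (j := 2) (by norm_num)
    have n_8_4 : (8 * a : ZMod p) ≠ 4 * a := kb_pp hp h17 ha (i := 8) (j := 4) (by norm_num)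
    have n_12_0 : (12 * a : ZMod p) ≠ 0 := kb_pp hp h17 ha (i := 12) (j := 0) (by norm_num)
    have n_16_0 : (16 * a : ZMod p) ≠ 0 := kb_pp hp h17 ha (i := 16) (j := 0) (by norm_num)
    rcases hβ₁ with h | h
    · -- `b = 2b′ = 4a`: `T = β_{(−1,2a)}`
      subst h
      rw [show (2 * (2 * a) : ZMod p) = 4 * a by ring] at hTeq
      have hUm_1 : cUm T (a) = 0 := by
        rw [hTeq]; simp +decide only [cU, cE, cT, cS, cUm, cEm, oc, count_four, Prod.neg_mk, neg_neg, neg_zero, Prod.mk.injEq, false_and, and_false, true_and, and_true, if_false, if_true, and_self, n_m12_0, n_m8_m4, n_m8_0, n_m8_2, n_m8_4, n_m4_m2, n_m4_0, n_m4_2, n_m4_4, n_m2_m4, n_m2_2, n_m2_4, n_m1_m4, n_m1_2, n_m1_4, n_1_m4, n_1_2, n_1_4, n_2_m4, n_2_0, n_2_4, n_4_m4, n_4_m2, n_4_0, n_4_2, n_8_m4, n_8_0, n_8_2, n_8_4, n_12_0, n_16_0]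
      have hUm_2 : cUm T (2 * a) = -1 := by
        rw [hTeq]; simp +decide only [cU, cE, cT, cS, cUm, cEm, oc, count_four, Prod.neg_mk, neg_neg, neg_zero, Prod.mk.injEq, false_and, and_false, true_and, and_true, if_false, if_true, and_self, n_m12_0, n_m8_m4, n_m8_0, n_m8_2, n_m8_4, n_m4_m2, n_m4_0, n_m4_2, n_m4_4, n_m2_m4, n_m2_2, n_m2_4, n_m1_m4, n_m1_2, n_m1_4, n_1_m4, n_1_2, n_1_4, n_2_m4, n_2_0, n_2_4, n_4_m4, n_4_m2, n_4_0, n_4_2, n_8_m4, n_8_0, n_8_2, n_8_4, n_12_0, n_16_0]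
      have hUm_4 : cUm T (4 * a) = 1 := by
        rw [hTeq]; simp +decide only [cU, cE, cT, cS, cUm, cEm, oc, count_four, Prod.neg_mk, neg_neg, neg_zero, Prod.mk.injEq, false_and, and_false, true_and, and_true, if_false, if_true, and_self, n_m12_0, n_m8_m4, n_m8_0, n_m8_2, n_m8_4, n_m4_m2, n_m4_0, n_m4_2, n_m4_4, n_m2_m4, n_m2_2, n_m2_4, n_m1_m4, n_m1_2, n_m1_4, n_1_m4, n_1_2, n_1_4, n_2_m4, n_2_0, n_2_4, n_4_m4, n_4_m2, n_4_0, n_4_2, n_8_m4, n_8_0, n_8_2, n_8_4, n_12_0, n_16_0]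
      have hUm_8 : cUm T (8 * a) = 0 := by
        rw [hTeq]; simp +decide only [cU, cE, cT, cS, cUm, cEm, oc, count_four, Prod.neg_mk, neg_neg, neg_zero, Prod.mk.injEq, false_and, and_false, true_and, and_true, if_false, if_true, and_self, n_m12_0, n_m8_m4, n_m8_0, n_m8_2, n_m8_4, n_m4_m2, n_m4_0, n_m4_2, n_m4_4, n_m2_m4, n_m2_2, n_m2_4, n_m1_m4, n_m1_2, n_m1_4, n_1_m4, n_1_2, n_1_4, n_2_m4, n_2_0, n_2_4, n_4_m4, n_4_m2, n_4_0, n_4_2, n_8_m4, n_8_0, n_8_2, n_8_4, n_12_0, n_16_0]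
      have k1 := hT.relII a ha
      rw [cGam, hUm_1, hUm_2] at k1
      have k2 := hT.relII (4 * a) n_4_0
      rw [cGam, show (2 : ZMod p) * (4 * a) = 8 * a by ring, hUm_4, hUm_8] at k2
      rcases posE (2 * a) (by omega) with h1 | h1 <;> rcases negE (8 * a) (by omega) with h2 | h2 <;>
        subst h1 <;> subst h2
      · exact (n_16_0 (by linear_combination hs)).elim
      · refine ⟨((-1 : ZMod 6), 2 * a), Or.inr (Or.inl ?_)⟩
        rw [hTeq, famB]
        have e1 : ((-1 : ZMod 6), 2 * a) + (3, 0) = ((2 : ZMod 6), 2 * a) := by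
          rw [Prod.mk_add_mk, Prod.mk.injEq]; exact ⟨by decide, by ring⟩
        have e2 : 2 * ((-1 : ZMod 6), 2 * a) + (3, 0) = ((1 : ZMod 6), 4 * a) := by
          rw [two_mul_mk, Prod.mk_add_mk, Prod.mk.injEq]; exact ⟨by decide, by ring⟩
        have e3 : -(4 * ((-1 : ZMod 6), 2 * a)) = ((-2 : ZMod 6), -(8 * a)) := by
          rw [four_mul_mk, Prod.neg_mk, Prod.mk.injEq]; exact ⟨by decide, by ring⟩
        rw [e1, e2, e3, Multiset.insert_eq_cons, Multiset.insert_eq_cons, Multiset.insert_eq_cons, four_eq_sum,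
          four_eq_sum]
        abel
      · exact (n_12_0 (by linear_combination hs)).elim
      · exact (n_m4_0 (by linear_combination hs)).elim
    · -- `b = −2b′ = −4a`: no sign choice has fibre sum `0`
      subst h
      exfalso
      rw [show (-(2 * (2 * a)) : ZMod p) = -(4 * a) by ring] at hTeq
      have hUm_1 : cUm T (a) = 0 := by
        rw [hTeq]; simp +decide only [cU, cE, cT, cS, cUm, cEm, oc, count_four, Prod.neg_mk, neg_neg, neg_zero, Prod.mk.injEq, false_and, and_false, true_and, and_true, if_false, if_true, and_self, n_m12_0, n_m8_m4, n_m8_0, n_m8_2, n_m8_4, n_m4_m2, n_m4_0, n_m4_2, n_m4_4, n_m2_m4, n_m2_2, n_m2_4, n_m1_m4, n_m1_2, n_m1_4, n_1_m4, n_1_2, n_1_4, n_2_m4, n_2_0, n_2_4, n_4_m4, n_4_m2, n_4_0, n_4_2, n_8_m4, n_8_0, n_8_2, n_8_4, n_12_0, n_16_0]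
      have hUm_2 : cUm T (2 * a) = -1 := by
        rw [hTeq]; simp +decide only [cU, cE, cT, cS, cUm, cEm, oc, count_four, Prod.neg_mk, neg_neg, neg_zero, Prod.mk.injEq, false_and, and_false, true_and, and_true, if_false, if_true, and_self, n_m12_0, n_m8_m4, n_m8_0, n_m8_2, n_m8_4, n_m4_m2, n_m4_0, n_m4_2, n_m4_4, n_m2_m4, n_m2_2, n_m2_4, n_m1_m4, n_m1_2, n_m1_4, n_1_m4, n_1_2, n_1_4, n_2_m4, n_2_0, n_2_4, n_4_m4, n_4_m2, n_4_0, n_4_2, n_8_m4, n_8_0, n_8_2, n_8_4, n_12_0, n_16_0]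
      have hUm_4 : cUm T (4 * a) = 1 := by
        rw [hTeq]; simp +decide only [cU, cE, cT, cS, cUm, cEm, oc, count_four, Prod.neg_mk, neg_neg, neg_zero, Prod.mk.injEq, false_and, and_false, true_and, and_true, if_false, if_true, and_self, n_m12_0, n_m8_m4, n_m8_0, n_m8_2, n_m8_4, n_m4_m2, n_m4_0, n_m4_2, n_m4_4, n_m2_m4, n_m2_2, n_m2_4, n_m1_m4, n_m1_2, n_m1_4, n_1_m4, n_1_2, n_1_4, n_2_m4, n_2_0, n_2_4, n_4_m4, n_4_m2, n_4_0, n_4_2, n_8_m4, n_8_0, n_8_2, n_8_4, n_12_0, n_16_0]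
      have hUm_8 : cUm T (8 * a) = 0 := by
        rw [hTeq]; simp +decide only [cU, cE, cT, cS, cUm, cEm, oc, count_four, Prod.neg_mk, neg_neg, neg_zero, Prod.mk.injEq, false_and, and_false, true_and, and_true, if_false, if_true, and_self, n_m12_0, n_m8_m4, n_m8_0, n_m8_2, n_m8_4, n_m4_m2, n_m4_0, n_m4_2, n_m4_4, n_m2_m4, n_m2_2, n_m2_4, n_m1_m4, n_m1_2, n_m1_4, n_1_m4, n_1_2, n_1_4, n_2_m4, n_2_0, n_2_4, n_4_m4, n_4_m2, n_4_0, n_4_2, n_8_m4, n_8_0, n_8_2, n_8_4, n_12_0, n_16_0]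
      have k1 := hT.relII a ha
      rw [cGam, hUm_1, hUm_2] at k1
      have k2 := hT.relII (4 * a) n_4_0
      rw [cGam, show (2 : ZMod p) * (4 * a) = 8 * a by ring, hUm_4, hUm_8] at k2
      rcases posE (2 * a) (by omega) with h1 | h1 <;> rcases negE (8 * a) (by omega) with h2 | h2 <;>
        subst h1 <;> subst h2
      · exact n_8_0 (by linear_combination hs)
      · exact n_m8_0 (by linear_combination hs)
      · exact n_4_0 (by linear_combination hs)
      · exact n_m12_0 (by linear_combination hs)
  -- neither coincidence: relation II at `b/2` and `b` puts `c₂` in `±b ∩ ±2b = ∅`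
  exfalso
  obtain ⟨a, rfl⟩ : ∃ a, b = 2 * a := ⟨b / 2, by field_simp⟩
  have ha : a ≠ 0 := fun e ↦ hb (by rw [e, mul_zero])
  have n_m4_m2 : (-(4 * a) : ZMod p) ≠ -(2 * a) := kb_nn hp h17 ha (i := 4) (j := 2) (by norm_num)
  have n_m4_2 : (-(4 * a) : ZMod p) ≠ 2 * a := kb_np hp h17 ha (i := 4) (j := 2) (by norm_num)
  have n_m1_2 : (-a : ZMod p) ≠ 2 * a := kb_np hp h17 ha (i := 1) (j := 2) (by norm_num)
  have n_1_2 : (a : ZMod p) ≠ 2 * a := kb_pp hp h17 ha (i := 1) (j := 2) (by norm_num)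
  have n_2_0 : (2 * a : ZMod p) ≠ 0 := kb_pp hp h17 ha (i := 2) (j := 0) (by norm_num)
  have n_4_m2 : (4 * a : ZMod p) ≠ -(2 * a) := kb_pn hp h17 ha (i := 4) (j := 2) (by norm_num)
  have n_4_2 : (4 * a : ZMod p) ≠ 2 * a := kb_pp hp h17 ha (i := 4) (j := 2) (by norm_num)
  have n_m2_2 : (-(2 * a) : ZMod p) ≠ 2 * a := kb_np hp h17 ha (i := 2) (j := 2) (by norm_num)
  have ha1 : a ≠ b' := fun e ↦ hβ₁ (Or.inl (by rw [← e]))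
  have ha2 : -a ≠ b' := fun e ↦ hβ₁ (Or.inr (by rw [← e]; ring))
  have ha3 : 4 * a ≠ b' := fun e ↦ hβ₂ (Or.inl (by rw [← e]; ring))
  have ha4 : -(4 * a) ≠ b' := fun e ↦ hβ₂ (Or.inr (by rw [← e]; ring))
  have hUm_1 : cUm T a = 0 := by
    rw [hTeq]; simp +decide only [cU, cE, cT, cS, cUm, cEm, oc, count_four, Prod.neg_mk, neg_neg, neg_zero, Prod.mk.injEq, false_and, and_false, true_and, and_true, if_false, if_true, and_self, ha1, ha2, n_1_2, n_m1_2]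
  have hUm_2 : cUm T (2 * a) = 1 := by
    rw [hTeq]; simp +decide only [cU, cE, cT, cS, cUm, cEm, oc, count_four, Prod.neg_mk, neg_neg, neg_zero, Prod.mk.injEq, false_and, and_false, true_and, and_true, if_false, if_true, and_self, hbb', hbeq, n_m2_2]
  have hUm_4 : cUm T (4 * a) = 0 := by
    rw [hTeq]; simp +decide only [cU, cE, cT, cS, cUm, cEm, oc, count_four, Prod.neg_mk, neg_neg, neg_zero, Prod.mk.injEq, false_and, and_false, true_and, and_true, if_false, if_true, and_self, ha3, ha4, n_4_2, n_m4_2]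
  have k1 := hT.relII a ha
  rw [cGam, hUm_1, hUm_2] at k1
  have k2 := hT.relII (2 * a) hb
  rw [cGam, show (2 : ZMod p) * (2 * a) = 4 * a by ring, hUm_2, hUm_4] at k2
  rcases negE (2 * a) (by omega) with h1 | h1 <;> rcases negE (4 * a) (by omega) with h2 | h2 <;>
    subst h1
  · exact n_4_2 h2
  · exact n_m4_2 h2
  · exact n_4_m2 h2
  · exact n_m4_m2 h2

/-- The five possible weights and what they say about the member. [folklore] -/
private theorem wt_cases (e : ZMod 6) (c : ZMod p) :
    (wt (e, c) = 2 ∧ e = 1 ∧ c ≠ 0) ∨ (wt (e, c) = -2 ∧ e = -1 ∧ c ≠ 0) ∨ (wt (e, c) = 1 ∧ e = 2 ∧ c ≠ 0) ∨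
      (wt (e, c) = -1 ∧ e = -2 ∧ c ≠ 0) ∨ (wt (e, c) = 0 ∧ (c ≠ 0 → e ≠ 1 ∧ e ≠ -1 ∧ e ≠ 2 ∧ e ≠ -2)) := by
  by_cases hc : c = 0
  · subst hc
    refine Or.inr (Or.inr (Or.inr (Or.inr ⟨?_, fun h ↦ (h rfl).elim⟩)))
    rcases zmod6_cases e with rfl | rfl | rfl | rfl | rfl | rfl <;> simp +decide [wt]
  · have hc' : (0 : ZMod p) ≠ c := fun h ↦ hc h.symm
    rcases zmod6_cases e with rfl | rfl | rfl | rfl | rfl | rfl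
    · exact Or.inr (Or.inr (Or.inr (Or.inr ⟨by simp +decide [wt], fun _ ↦ by decide⟩)))
    · exact Or.inl ⟨by simp +decide [wt, hc'], rfl, hc⟩
    · exact Or.inr (Or.inr (Or.inl ⟨by simp +decide [wt, hc'], rfl, hc⟩))
    · exact Or.inr (Or.inr (Or.inr (Or.inr ⟨by simp +decide [wt], fun _ ↦ by decide⟩)))
    · exact Or.inr (Or.inr (Or.inr (Or.inl ⟨by simp +decide [wt, hc'], rfl, hc⟩)))
    · exact Or.inr (Or.inl ⟨by simp +decide [wt, hc'], rfl, hc⟩)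

/-- Sorting the three other members by weight. [folklore] -/
private theorem sort3 {a x y z : ZMod 6 × ZMod p} (hTeq : T = a ::ₘ x ::ₘ y ::ₘ {z}) :
    ∃ x' y' z' : ZMod 6 × ZMod p, T = a ::ₘ x' ::ₘ y' ::ₘ {z'} ∧ wt x' ≤ wt y' ∧ wt y' ≤ wt z' := by
  rcases le_total (wt x) (wt y) with hxy | hxy <;> rcases le_total (wt y) (wt z) with hyz | hyz <;>
    rcases le_total (wt x) (wt z) with hxz | hxz
  · exact ⟨x, y, z, hTeq, hxy, hyz⟩
  · exact ⟨x, y, z, hTeq, hxy, hyz⟩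
  · exact ⟨x, z, y, by rw [hTeq, cons_singleton_comm y z], hxz, hyz⟩
  · exact ⟨z, x, y, by rw [hTeq, cons_singleton_comm y z, Multiset.cons_swap x z], hxz, hxy⟩
  · exact ⟨y, x, z, by rw [hTeq, Multiset.cons_swap x y], hxy, hxz⟩
  · exact ⟨y, z, x, by rw [hTeq, Multiset.cons_swap x y, cons_singleton_comm x z], hyz, hxz⟩
  · exact ⟨x, y, z, hTeq, le_trans hxz hyz, le_trans hxy hxz⟩
  · exact ⟨z, y, x, by rw [hTeq, cons_singleton_comm y z, Multiset.cons_swap x z, cons_singleton_comm x y], hyz, hxy⟩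

/-- **The `U`-branch.** A Good `T` with a unit-type member `(1, b)`, `b ≠ 0`, is standard. The balance identity sorts
the other three members into one of four weight patterns, treated by `classify_U_UUUU`, `classify_U_UE`, `classify_U_UU`,
`classify_U_EE`. [folklore] -/
private theorem classify_U (hp : p.Prime) (h17 : 17 ≤ p) (hT : Good T) {b : ZMod p} (hb : b ≠ 0)
    (hmem : ((1 : ZMod 6), b) ∈ T) : IsStd T := by
  obtain ⟨x, y, z, hTeq⟩ := exists_eq_cons_of_mem hT.card4 hmem
  obtain ⟨⟨ex, cx⟩, ⟨ey, cy⟩, ⟨ez, cz⟩, hTeq, hxy, hyz⟩ := sort3 hTeq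
  have hbal := hT.bal
  rw [hTeq, sum_map_wt_four] at hbal
  have hb' : (0 : ZMod p) ≠ b := fun h ↦ hb h.symm
  have hw1 : wt ((1 : ZMod 6), b) = 2 := by
    simp +decide only [wt, Prod.mk.injEq, hb', true_and, and_true, false_and, and_false, if_true, if_false]
  rw [hw1] at hbal
  rcases wt_cases ex cx with ⟨hxv, hx⟩ | ⟨hxv, hx⟩ | ⟨hxv, hx⟩ | ⟨hxv, hx⟩ | ⟨hxv, hx⟩ <;>
  rcases wt_cases ey cy with ⟨hyv, hy⟩ | ⟨hyv, hy⟩ | ⟨hyv, hy⟩ | ⟨hyv, hy⟩ | ⟨hyv, hy⟩ <;>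
  rcases wt_cases ez cz with ⟨hzv, hz⟩ | ⟨hzv, hz⟩ | ⟨hzv, hz⟩ | ⟨hzv, hz⟩ | ⟨hzv, hz⟩ <;>
  rw [hxv, hyv, hzv] at hbal <;> rw [hxv, hyv] at hxy <;> rw [hyv, hzv] at hyz
  all_goals first | (exfalso; omega) | skip
  · -- weights `(−2, −2, 2)`: four unit-type members
    obtain ⟨rfl, hcx⟩ := hx
    obtain ⟨rfl, hcy⟩ := hy
    obtain ⟨rfl, hcz⟩ := hz
    rw [cons_singleton_comm, Multiset.cons_swap ((-1 : ZMod 6), cx)] at hTeq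
    exact (classify_U_UUUU hp h17 hT hb hcz hTeq).elim
  · -- weights `(−2, −1, 1)`
    obtain ⟨rfl, hcx⟩ := hx
    obtain ⟨rfl, hcy⟩ := hy
    obtain ⟨rfl, hcz⟩ := hz
    rw [cons_singleton_comm] at hTeq
    exact classify_U_UE hp h17 hT hb hcx hcz hTeq
  · -- weights `(−2, 0, 0)`
    obtain ⟨rfl, hcx⟩ := hx
    exact classify_U_UU hp h17 hT hb hy hz hTeq
  · -- weights `(−1, −1, 0)`
    obtain ⟨rfl, hcx⟩ := hx
    obtain ⟨rfl, hcy⟩ := hy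
    exact classify_U_EE hp h17 hT hb hTeq

/-! ### The symmetry `(e, c) ↦ (−e, c)` and the classification in coordinates -/

/-- The coordinate symmetry `σ(e, c) = (−e, c)` (multiplication by the unit `≡ −1 (mod 6), ≡ 1 (mod p)`). [folklore] -/
private def sig (q : ZMod 6 × ZMod p) : ZMod 6 × ZMod p := (-q.1, q.2)

/-- `σ` on a pair. [folklore] -/
private theorem sig_mk (e : ZMod 6) (c : ZMod p) : sig (e, c) = (-e, c) := rfl

/-- `σ` as an additive homomorphism. [folklore] -/
private def sigHom : ZMod 6 × ZMod p →+ ZMod 6 × ZMod p where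
  toFun := sig
  map_zero' := by simp [sig]
  map_add' q q' := by obtain ⟨e, c⟩ := q; obtain ⟨e', c'⟩ := q'; simp only [sig, Prod.mk_add_mk, neg_add]

/-- `σ` is an involution. [folklore] -/
private theorem sig_sig (q : ZMod 6 × ZMod p) : sig (sig q) = q := by
  obtain ⟨e, c⟩ := q; simp [sig]

/-- `σ` is injective. [folklore] -/
private theorem sig_injective : Function.Injective (sig (p := p)) :=
  Function.LeftInverse.injective sig_sig

/-- `σ(−q) = −σ(q)`. [folklore] -/
private theorem sig_neg (q : ZMod 6 × ZMod p) : sig (-q) = -sig q := by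
  obtain ⟨e, c⟩ := q; simp [sig]

/-- Counting in `σT`. [folklore] -/
private theorem count_map_sig (q : ZMod 6 × ZMod p) : count q (T.map sig) = count (sig q) T := by
  conv_lhs => rw [← sig_sig q]
  rw [Multiset.count_map_eq_count' sig T sig_injective]

/-- Odd multiplicities in `σT`. [folklore] -/
private theorem oc_map_sig (q : ZMod 6 × ZMod p) : oc (T.map sig) q = oc T (sig q) := by
  simp only [oc, count_map_sig, sig_neg]

/-- The strata of `σT`: `U, E, T, S` are invariant, `U⁻, E⁻` change sign. [folklore] -/
private theorem strata_map_sig (c : ZMod p) :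
    cU (T.map sig) c = cU T c ∧ cE (T.map sig) c = cE T c ∧ cT (T.map sig) c = cT T c ∧ cS (T.map sig) c = cS T c ∧
      cUm (T.map sig) c = -cUm T c ∧ cEm (T.map sig) c = -cEm T c := by
  refine ⟨?_, ?_, ?_, ?_, ?_, ?_⟩ <;>
    simp only [cU, cE, cT, cS, cUm, cEm, oc_map_sig, sig_mk, neg_neg, neg_zero, show (-3 : ZMod 6) = 3 by decide] <;>
    ring

/-- The weight changes sign under `σ`. [folklore] -/
private theorem wt_sig (q : ZMod 6 × ZMod p) : wt (sig q) = -wt q := by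
  obtain ⟨e, c⟩ := q
  by_cases hc : c = 0
  · subst hc
    rcases zmod6_cases e with rfl | rfl | rfl | rfl | rfl | rfl <;> simp +decide [wt, sig]
  · have hc' : (0 : ZMod p) ≠ c := fun h ↦ hc h.symm
    rcases zmod6_cases e with rfl | rfl | rfl | rfl | rfl | rfl <;> simp +decide [wt, sig, hc']

/-- Goodness is `σ`-invariant. [folklore] -/
private theorem Good.map_sig (hT : Good T) : Good (T.map sig) where
  card4 := by rw [Multiset.card_map, hT.card4]
  sum0 := by
    have : T.map sig = T.map sigHom := rfl
    rw [this, ← map_multiset_sum, hT.sum0, _root_.map_zero]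
  ne0 := by
    intro q hq
    obtain ⟨q₀, hq₀, rfl⟩ := Multiset.mem_map.1 hq
    intro h
    exact hT.ne0 q₀ hq₀ (by rw [← sig_sig q₀, h]; simp [sig])
  pf := by
    intro q hq q' hq' h
    obtain ⟨q₀, hq₀, rfl⟩ := Multiset.mem_map.1 hq
    rw [← Multiset.map_erase _ sig_injective] at hq'
    obtain ⟨q₁, hq₁, rfl⟩ := Multiset.mem_map.1 hq'
    refine hT.pf q₀ hq₀ q₁ hq₁ ?_
    have : sigHom (q₀ + q₁) = 0 := by rw [_root_.map_add]; exact h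
    rw [← sig_sig (q₀ + q₁), show sig (q₀ + q₁) = sigHom (q₀ + q₁) from rfl, this]
    simp [sig]
  relI := by
    intro b hb
    have := hT.relI b hb
    simp only [(strata_map_sig _).1, (strata_map_sig _).2.1, (strata_map_sig _).2.2.1, (strata_map_sig _).2.2.2.1]
    exact this
  relII := by
    intro b hb
    have := hT.relII b hb
    simp only [cGam, (strata_map_sig _).2.2.2.2.1, (strata_map_sig _).2.2.2.2.2] at this ⊢
    linarith
  bal := by
    rw [Multiset.map_map]
    have : ∀ s : Multiset (ZMod 6 × ZMod p), (s.map (wt ∘ sig)).sum = -(s.map wt).sum := fun s ↦ by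
      induction s using Multiset.induction_on with
      | empty => simp
      | cons a s ih =>
        rw [Multiset.map_cons, Multiset.sum_cons, ih, Multiset.map_cons, Multiset.sum_cons]
        simp only [Function.comp, wt_sig]; ring
    rw [this, hT.bal, neg_zero]

/-- `σ` maps the three families to themselves. [folklore] -/
private theorem map_sig_fam (x : ZMod 6 × ZMod p) :
    (famA x).map sig = famA (sig x) ∧ (famB x).map sig = famB (sig x) ∧ (famC x).map sig = famC (sig x) := by
  obtain ⟨e, c⟩ := x
  have h3 : sig (((e, c) : ZMod 6 × ZMod p) + (3, 0)) = sig (e, c) + (3, 0) := by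
    simp only [sig, Prod.mk_add_mk, Prod.mk.injEq]
    exact ⟨by rw [neg_add, show (-3 : ZMod 6) = 3 by decide], trivial⟩
  have h2 : sig (((e, c) : ZMod 6 × ZMod p) + (2, 0)) = sig (e, c) + (4, 0) := by
    simp only [sig, Prod.mk_add_mk, Prod.mk.injEq]
    exact ⟨by rw [neg_add, show (-2 : ZMod 6) = 4 by decide], trivial⟩
  have h4 : sig (((e, c) : ZMod 6 × ZMod p) + (4, 0)) = sig (e, c) + (2, 0) := by
    simp only [sig, Prod.mk_add_mk, Prod.mk.injEq]
    exact ⟨by rw [neg_add, show (-4 : ZMod 6) = 2 by decide], trivial⟩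
  have hA : sig (-(2 * ((e, c) : ZMod 6 × ZMod p))) = -(2 * sig (e, c)) := by
    simp only [sig, two_mul_mk, Prod.neg_mk, neg_neg, Prod.mk.injEq]; exact ⟨by ring, trivial⟩
  have hB : sig (2 * ((e, c) : ZMod 6 × ZMod p) + (3, 0)) = 2 * sig (e, c) + (3, 0) := by
    simp only [sig, two_mul_mk, Prod.mk_add_mk, Prod.mk.injEq]
    exact ⟨by rw [neg_add, mul_neg, show (-3 : ZMod 6) = 3 by decide], trivial⟩
  have hB' : sig (-(4 * ((e, c) : ZMod 6 × ZMod p))) = -(4 * sig (e, c)) := by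
    simp only [sig, four_mul_mk, Prod.neg_mk, neg_neg, Prod.mk.injEq]; exact ⟨by ring, trivial⟩
  have hC : sig (-(3 * ((e, c) : ZMod 6 × ZMod p))) = -(3 * sig (e, c)) := by
    simp only [sig, three_mul_mk, Prod.neg_mk, neg_neg, Prod.mk.injEq]; exact ⟨by ring, trivial⟩
  have h30 : sig (((3 : ZMod 6), (0 : ZMod p))) = (3, 0) := by
    simp only [sig, Prod.mk.injEq]; exact ⟨by decide, trivial⟩
  refine ⟨?_, ?_, ?_⟩
  · simp only [famA, Multiset.insert_eq_cons, Multiset.map_cons, Multiset.map_singleton, h3, hA, h30]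
  · simp only [famB, Multiset.insert_eq_cons, Multiset.map_cons, Multiset.map_singleton, h3, hB, hB']
  · simp only [famC, Multiset.insert_eq_cons, Multiset.map_cons, Multiset.map_singleton, h2, h4, hC]
    rw [Multiset.cons_swap (sig (e, c) + (4, 0))]

/-- Standardness descends along `σ`. [folklore] -/
private theorem isStd_of_map_sig (h : IsStd (T.map sig)) : IsStd T := by
  obtain ⟨x, hx⟩ := h
  have hT : T = (T.map sig).map sig := by
    rw [Multiset.map_map]
    have : (sig ∘ sig : ZMod 6 × ZMod p → ZMod 6 × ZMod p) = id := funext sig_sig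
    rw [this, Multiset.map_id]
  refine ⟨sig x, ?_⟩
  rcases hx with h | h | h
  · exact Or.inl (by rw [hT, h, (map_sig_fam x).1])
  · exact Or.inr (Or.inl (by rw [hT, h, (map_sig_fam x).2.1]))
  · exact Or.inr (Or.inr (by rw [hT, h, (map_sig_fam x).2.2]))

/-- `NoU` is `σ`-invariant. [folklore] -/
private theorem noU_map_sig (h : NoU T) : NoU (T.map sig) := by
  intro q hq h0
  obtain ⟨⟨e, c⟩, hq₀, rfl⟩ := Multiset.mem_map.1 hq
  have := h _ hq₀ h0
  simp only [sig] at h0 ⊢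
  exact ⟨fun h1 ↦ this.2 (by rw [← neg_neg e, h1]), fun h1 ↦ this.1 (by rw [← neg_neg e, h1, neg_neg])⟩

/-- **Classification in coordinates.** A Good multiset with a member off the fibre `0` is one of `α_x, β_x, γ_x`. [folklore] -/
private theorem classify_coord (hp : p.Prime) (h17 : 17 ≤ p) (hT : Good T) (hex : ∃ q ∈ T, q.2 ≠ 0) : IsStd T := by
  by_cases hU : ∃ q ∈ T, q.2 ≠ 0 ∧ (q.1 = 1 ∨ q.1 = -1)
  · obtain ⟨⟨e, b⟩, hq, hb, he | he⟩ := hU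
    · simp only at he; subst he
      exact classify_U hp h17 hT hb hq
    · simp only at he; subst he
      refine isStd_of_map_sig (classify_U hp h17 hT.map_sig hb ?_)
      exact Multiset.mem_map.2 ⟨(-1, b), hq, by simp [sig]⟩
  push Not at hU
  have hNoU : NoU T := fun q hq h0 ↦ hU q hq h0
  by_cases hE : ∃ q ∈ T, q.2 ≠ 0 ∧ (q.1 = 2 ∨ q.1 = -2)
  · obtain ⟨⟨e, c⟩, hq, hc, he | he⟩ := hE
    · simp only at he; subst he
      exact classify_E hp h17 hT hNoU hc hq
    · simp only at he; subst he
      refine isStd_of_map_sig (classify_E hp h17 hT.map_sig (noU_map_sig hNoU) hc ?_)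
      exact Multiset.mem_map.2 ⟨(-2, c), hq, by simp [sig]⟩
  push Not at hE
  have hNoUE : NoUE T := fun q hq h0 ↦ ⟨(hU q hq h0).1, (hU q hq h0).2, (hE q hq h0).1, (hE q hq h0).2⟩
  by_cases h3 : ∃ q ∈ T, q.2 ≠ 0 ∧ q.1 = 3
  · obtain ⟨⟨e, d⟩, hq, hd, he⟩ := h3
    simp only at he; subst he
    exact classify_T hp h17 hT hNoUE hd hq
  push Not at h3
  exfalso
  obtain ⟨⟨e, d⟩, hq, hd⟩ := hex
  have he : e = 0 := by
    rcases zmod6_cases e with h | h | h | h | h | h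
    · exact h
    · exact absurd h (hU _ hq hd).1
    · exact absurd h (hE _ hq hd).1
    · exact absurd h (h3 _ hq hd)
    · exact absurd h (hE _ hq hd).2
    · exact absurd h (hU _ hq hd).2
  subst he
  exact noS_only hp h17 hT hNoUE (fun q hq h0 ↦ h3 q hq h0) hd hq

/-! ### From Hodge multisets of level `6p` to the three families -/

/-- `m/2 = 3p` and `m/3 = 2p` as residues of level `6p`. -/
local notation "K6" => (((3 * p : ℕ)) : ZMod (6 * p))
local notation "D6" => (((2 * p : ℕ)) : ZMod (6 * p))

/-- A pair-free Hodge `4`-multiset of level `6p` has Good coordinates. [folklore] -/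
private theorem good_of_isHodgeMultiset (h : Nat.Coprime 6 p) [NeZero (6 * p)] (hp : p.Prime) (h17 : 17 ≤ p)
    {s : Multiset (ZMod (6 * p))} (hs : IsHodgeMultiset s) (hcard : Multiset.card s = 4)
    (hind : ∀ a ∈ s, ∀ b ∈ s.erase a, a + b ≠ 0) : Good (s.map (crt h)) := by
  have h5 : 5 ≤ p := by omega
  have hcard' : Multiset.card (s.map (crt h)) = 4 := by rw [Multiset.card_map, hcard]
  have hsum' : (s.map (crt h)).sum = 0 := by rw [← map_multiset_sum, hs.1.2, _root_.map_zero]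
  have hrb := relII_and_balance hp h17 hcard' hsum' (fun b b' hb hb' ↦ cGam_eq_of_isHodgeMultiset h hp h5 hs hb hb')
  exact
  { card4 := hcard'
    sum0 := hsum'
    ne0 := by
      intro q hq
      obtain ⟨x, hx, rfl⟩ := Multiset.mem_map.1 hq
      exact (map_ne_zero_iff (crt h) (crt h).injective).2 (hs.1.1 x hx)
    pf := by
      intro q hq q' hq' e
      obtain ⟨x, hx, rfl⟩ := Multiset.mem_map.1 hq
      rw [← Multiset.map_erase _ (crt h).injective] at hq'
      obtain ⟨x', hx', rfl⟩ := Multiset.mem_map.1 hq'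
      refine hind x hx x' hx' ((map_eq_zero_iff (crt h) (crt h).injective).1 ?_)
      rw [_root_.map_add]; exact e
    relI := relI_of_isHodgeMultiset h hp h5 hs
    relII := hrb.1
    bal := by rw [sum_map_wt]; exact hrb.2 }

/-- `crt (3p) = (3, 0)`. [folklore] -/
private theorem crt_K (h : Nat.Coprime 6 p) [NeZero (6 * p)] (hp : p.Prime) (h5 : 5 ≤ p) :
    crt h K6 = ((3 : ZMod 6), (0 : ZMod p)) := by
  rw [Nat.cast_mul, _root_.map_mul, crt_P, Nat.cast_ofNat, map_ofNat, Prod.ext_iff]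
  simp only [Prod.fst_mul, Prod.snd_mul, Prod.fst_ofNat, Prod.snd_ofNat, mul_zero]
  exact ⟨(pi_facts hp h5).2.2.2.2.2, trivial⟩

/-- `crt (2p) = (2π, 0)` and `crt (4p) = (4π, 0)`; so `{pt 2 0, pt 4 0} = {2p, 4p}`. [folklore] -/
private theorem pt_two_four (h : Nat.Coprime 6 p) [NeZero (6 * p)] (hp : p.Prime) (h5 : 5 ≤ p) :
    (pt h 2 0 = D6 ∧ pt h 4 0 = 2 * D6) ∨ (pt h 2 0 = 2 * D6 ∧ pt h 4 0 = D6) := by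
  have hD : crt h D6 = (2 * π, 0) := by
    rw [Nat.cast_mul, _root_.map_mul, crt_P, Nat.cast_ofNat, map_ofNat, Prod.ext_iff]
    simp only [Prod.fst_mul, Prod.snd_mul, Prod.fst_ofNat, Prod.snd_ofNat, mul_zero]
    exact ⟨trivial, trivial⟩
  have h2D : crt h (2 * D6) = (4 * π, 0) := by
    rw [_root_.map_mul, hD, map_ofNat, Prod.ext_iff]
    simp only [Prod.fst_mul, Prod.snd_mul, Prod.fst_ofNat, Prod.snd_ofNat, mul_zero]
    exact ⟨by ring, trivial⟩
  have e1 : D6 = pt h (2 * π) 0 := by rw [← pt_crt h D6, hD]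
  have e2 : 2 * D6 = pt h (4 * π) 0 := by rw [← pt_crt h (2 * D6), h2D]
  rcases pi_eq hp h5 with hπ | hπ <;> rw [hπ] at e1 e2
  · left; exact ⟨by rw [e1, mul_one], by rw [e2, mul_one]⟩
  · right
    refine ⟨by rw [e2, show (4 : ZMod 6) * -1 = 2 by decide], by rw [e1, show (2 : ZMod 6) * -1 = 4 by decide]⟩

/-- All members in the fibre `0` (multiples of `p`): `s = α_p` or `α_{−p}`. [folklore] -/
private theorem fibre_zero (h : Nat.Coprime 6 p) [NeZero (6 * p)] (hp : p.Prime) (h5 : 5 ≤ p)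
    {s : Multiset (ZMod (6 * p))} (hs : IsHodgeMultiset s) (hcard : Multiset.card s = 4)
    (hind : ∀ a ∈ s, ∀ b ∈ s.erase a, a + b ≠ 0) (h0 : ∀ w ∈ s, (crt h w).2 = 0) :
    ∃ x : ZMod (6 * p), s = {x, x + K6, -(2 * x), K6} := by
  haveI : NeZero p := ⟨hp.ne_zero⟩
  have hp0 := hp.pos
  have hN : 0 < 6 * p := by omega
  -- every member is `k p` with `1 ≤ k ≤ 5`
  have hk : ∀ w ∈ s, ∃ k : ℕ, 1 ≤ k ∧ k ≤ 5 ∧ w.val = k * p ∧ w = (k : ZMod (6 * p)) * (p : ZMod (6 * p)) := by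
    intro w hw
    have hdvd : p ∣ w.val := by
      have := h0 w hw
      rw [crt_snd] at this
      exact (ZMod.natCast_eq_zero_iff _ _).1 this
    obtain ⟨k, hk⟩ := hdvd
    have hlt : w.val < 6 * p := ZMod.val_lt w
    have hne : w.val ≠ 0 := fun e ↦ hs.1.1 w hw ((ZMod.val_eq_zero w).1 e)
    refine ⟨k, ?_, ?_, by rw [hk, mul_comm], ?_⟩
    · rcases Nat.eq_zero_or_pos k with rfl | hk0
      · rw [mul_zero] at hk; exact (hne hk).elim
      · exact hk0
    · by_contra hk5
      have : 6 * p ≤ p * k := Nat.mul_comm p 6 ▸ Nat.mul_le_mul_left p (by omega)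
      omega
    · conv_lhs => rw [← ZMod.natCast_zmod_val w, hk]
      push_cast; ring
  -- the four members
  obtain ⟨w₁, hw₁⟩ := Multiset.card_pos_iff_exists_mem.1 (by rw [hcard]; norm_num)
  obtain ⟨R, hR⟩ := Multiset.exists_cons_of_mem hw₁
  have hRc : Multiset.card R = 3 := by rw [hR, Multiset.card_cons] at hcard; omega
  obtain ⟨w₂, w₃, w₄, rfl⟩ := Multiset.card_eq_three.1 hRc
  have m2 : w₂ ∈ s := by rw [hR]; simp
  have m3 : w₃ ∈ s := by rw [hR]; simp
  have m4 : w₄ ∈ s := by rw [hR]; simp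
  obtain ⟨k₁, h1a, h1b, h1v, h1e⟩ := hk w₁ hw₁
  obtain ⟨k₂, h2a, h2b, h2v, h2e⟩ := hk w₂ m2
  obtain ⟨k₃, h3a, h3b, h3v, h3e⟩ := hk w₃ m3
  obtain ⟨k₄, h4a, h4b, h4v, h4e⟩ := hk w₄ m4
  -- the norm at `t = 1`: `Σ k = 12`
  have hsum : k₁ + k₂ + k₃ + k₄ = 12 := by
    have := hs.2 1
    rw [Units.val_one, Multiset.map_congr rfl (fun a _ ↦ one_mul a), Multiset.map_id', hcard, hR] at this
    simp only [mNormSum, Multiset.map_cons, Multiset.sum_cons, Multiset.insert_eq_cons, Multiset.map_singleton,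
      Multiset.sum_singleton, h1v, h2v, h3v, h4v] at this
    have : (k₁ + k₂ + k₃ + k₄) * p = 12 * p := by linarith
    exact Nat.eq_of_mul_eq_mul_right hp0 this
  -- pair-freeness: `kᵢ + kⱼ ≠ 6`
  have h6P : (6 : ZMod (6 * p)) * (p : ZMod (6 * p)) = 0 := by
    have : (((6 * p : ℕ)) : ZMod (6 * p)) = 0 := ZMod.natCast_self _
    push_cast at this; exact this
  have hpair : ∀ u v : ZMod (6 * p), u ∈ s → v ∈ s.erase u → ∀ a b : ℕ,
      u = (a : ZMod (6 * p)) * (p : ZMod (6 * p)) → v = (b : ZMod (6 * p)) * (p : ZMod (6 * p)) → a + b ≠ 6 := by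
    intro u v hu hv a b ha hb hab
    refine hind u hu v hv ?_
    rw [ha, hb, ← add_mul, ← Nat.cast_add, hab, Nat.cast_ofNat, h6P]
  have e12 : w₂ ∈ s.erase w₁ := by rw [hR, Multiset.erase_cons_head]; simp
  have e13 : w₃ ∈ s.erase w₁ := by rw [hR, Multiset.erase_cons_head]; simp
  have e14 : w₄ ∈ s.erase w₁ := by rw [hR, Multiset.erase_cons_head]; simp
  have hR2 : s = w₂ ::ₘ w₁ ::ₘ w₃ ::ₘ {w₄} := by
    rw [hR, Multiset.insert_eq_cons, Multiset.cons_swap]; try rfl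
  have e23 : w₃ ∈ s.erase w₂ := by rw [hR2, Multiset.erase_cons_head]; simp
  have e24 : w₄ ∈ s.erase w₂ := by rw [hR2, Multiset.erase_cons_head]; simp
  have hR3 : s = w₃ ::ₘ w₁ ::ₘ w₂ ::ₘ {w₄} := by
    rw [hR, Multiset.insert_eq_cons, Multiset.insert_eq_cons, Multiset.cons_swap w₂ w₃, Multiset.cons_swap w₁ w₃]
  have e34 : w₄ ∈ s.erase w₃ := by rw [hR3, Multiset.erase_cons_head]; simp
  have p12 := hpair _ _ hw₁ e12 _ _ h1e h2e
  have p13 := hpair _ _ hw₁ e13 _ _ h1e h3e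
  have p14 := hpair _ _ hw₁ e14 _ _ h1e h4e
  have p23 := hpair _ _ m2 e23 _ _ h2e h3e
  have p24 := hpair _ _ m2 e24 _ _ h2e h4e
  have p34 := hpair _ _ m3 e34 _ _ h3e h4e
  -- the `k`-multiset is `{1, 4, 4, 3}` or `{5, 2, 2, 3}`
  have hK : ({k₁, k₂, k₃, k₄} : Multiset ℕ) = {1, 4, 4, 3} ∨ ({k₁, k₂, k₃, k₄} : Multiset ℕ) = {5, 2, 2, 3} := by
    interval_cases k₁ <;> interval_cases k₂ <;> interval_cases k₃ <;> interval_cases k₄ <;>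
      first | (exfalso; omega) | (left; decide) | (right; decide)
  have hsK : s = (({k₁, k₂, k₃, k₄} : Multiset ℕ)).map (fun k : ℕ ↦ (k : ZMod (6 * p)) * (p : ZMod (6 * p))) := by
    rw [hR, h1e, h2e, h3e, h4e]; simp
  have hK3 : K6 = 3 * (p : ZMod (6 * p)) := by push_cast; ring
  rcases hK with hK | hK <;> rw [hK] at hsK
  · refine ⟨(p : ZMod (6 * p)), ?_⟩
    rw [hsK, hK3]
    simp only [Multiset.insert_eq_cons, Multiset.map_cons, Multiset.map_singleton, Nat.cast_one, one_mul, Nat.cast_ofNat]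
    rw [show (p : ZMod (6 * p)) + 3 * (p : ZMod (6 * p)) = 4 * p by ring,
      show -(2 * (p : ZMod (6 * p))) = 4 * p by linear_combination -h6P]
  · refine ⟨-(p : ZMod (6 * p)), ?_⟩
    rw [hsK, hK3]
    simp only [Multiset.insert_eq_cons, Multiset.map_cons, Multiset.map_singleton, Nat.cast_ofNat]
    rw [show -(p : ZMod (6 * p)) + 3 * (p : ZMod (6 * p)) = 2 * p by ring,
      show -(2 * -(p : ZMod (6 * p))) = 2 * p by ring, show (5 : ZMod (6 * p)) * p = -p by linear_combination h6P]

/-- **Classification of the indecomposable Hodge quadruples of level `6p`, `p ≥ 17` prime (multiset form).** A pair-free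
Hodge `4`-multiset over `ℤ/6p` is `{x, x + 3p, −2x, 3p}`, `{x, x + 3p, 2x + 3p, −4x}` or `{x, x + 2p, x + 4p, −3x}`.
[cite: Shioda1982PicardFermat, §4 Lemma 1 and Prop. 4 (Q′) pp. 728–729] [cite: AokiShioda1983, §2 Theorem (𝔅²ₘ) (ii) a)–c), p. 3] -/
private theorem classify_aux (h : Nat.Coprime 6 p) [NeZero (6 * p)] (hp : p.Prime) (h17 : 17 ≤ p)
    {s : Multiset (ZMod (6 * p))} (hs : IsHodgeMultiset s) (hcard : Multiset.card s = 4)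
    (hind : ∀ a ∈ s, ∀ b ∈ s.erase a, a + b ≠ 0) :
    ∃ x : ZMod (6 * p), s = {x, x + K6, -(2 * x), K6} ∨ s = {x, x + K6, 2 * x + K6, -(4 * x)} ∨
      s = {x, x + D6, x + 2 * D6, -(3 * x)} := by
  have h5 : 5 ≤ p := by omega
  by_cases hex : ∃ w ∈ s, (crt h w).2 ≠ 0
  swap
  · push Not at hex
    obtain ⟨x, hx⟩ := fibre_zero h hp h5 hs hcard hind hex
    exact ⟨x, Or.inl hx⟩
  obtain ⟨w, hw, hw0⟩ := hex
  have hT := good_of_isHodgeMultiset h hp h17 hs hcard hind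
  have hstd := classify_coord hp h17 hT ⟨crt h w, Multiset.mem_map_of_mem _ hw, hw0⟩
  obtain ⟨x', hx'⟩ := hstd
  have hsT : s = (s.map (crt h)).map (crt h).symm := by
    rw [Multiset.map_map]
    have : ((crt h).symm ∘ (crt h) : ZMod (6 * p) → ZMod (6 * p)) = id := funext fun w ↦ (crt h).symm_apply_apply w
    rw [this, Multiset.map_id]
  set x := (crt h).symm x' with hx
  have hK : (crt h).symm ((3 : ZMod 6), (0 : ZMod p)) = K6 := by rw [← crt_K h hp h5, RingEquiv.symm_apply_apply]
  have h2 : (crt h).symm (2, 0) = pt h 2 0 := rfl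
  have h4 : (crt h).symm (4, 0) = pt h 4 0 := rfl
  refine ⟨x, ?_⟩
  rcases hx' with hA | hB | hC
  · left
    rw [hsT, hA, famA]
    simp only [Multiset.insert_eq_cons, Multiset.map_cons, Multiset.map_singleton, _root_.map_add, map_neg,
      _root_.map_mul, map_ofNat, hK, ← hx]
  · right; left
    rw [hsT, hB, famB]
    simp only [Multiset.insert_eq_cons, Multiset.map_cons, Multiset.map_singleton, _root_.map_add, map_neg,
      _root_.map_mul, map_ofNat, hK, ← hx]
  · right; right
    rw [hsT, hC, famC]
    simp only [Multiset.insert_eq_cons, Multiset.map_cons, Multiset.map_singleton, _root_.map_add, map_neg,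
      _root_.map_mul, map_ofNat, h2, h4, ← hx]
    rcases pt_two_four h hp h5 with ⟨e2, e4⟩ | ⟨e2, e4⟩ <;> rw [e2, e4]
    rw [Multiset.cons_swap (x + 2 * D6)]

/-- **Classification of the pair-free Hodge `4`-multisets of level `6p`, `p ≥ 17` prime (multiset form of Shioda's Prop. 4 (Q′) /
Aoki–Shioda's Theorem (𝔅²ₘ) (ii) at `m = 6p`).** Such a multiset is `{x, x + 3p, −2x, 3p}` (type `α`, `m′ = 3p`),
`{x, x + 3p, 2x + 3p, −4x}` (type `β`) or `{x, x + 2p, x + 4p, −3x}` (type `γ`, `m″ = 2p`) for some residue `x`.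
[cite: Shioda1982PicardFermat, §4 Lemma 1 p. 728 and Prop. 4 (Q′) p. 729] [cite: AokiShioda1983, §2 Theorem (𝔅²ₘ) (ii) a)–c), p. 3] -/
theorem classify_hodgeMultiset_sixPrime [NeZero (6 * p)] (hp : p.Prime) (h17 : 17 ≤ p) {s : Multiset (ZMod (6 * p))}
    (hs : IsHodgeMultiset s) (hcard : Multiset.card s = 4) (hind : ∀ a ∈ s, ∀ b ∈ s.erase a, a + b ≠ 0) :
    ∃ x : ZMod (6 * p), s = {x, x + K6, -(2 * x), K6} ∨ s = {x, x + K6, 2 * x + K6, -(4 * x)} ∨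
      s = {x, x + D6, x + 2 * D6, -(3 * x)} :=
  classify_aux (coprime_six hp (by omega)) hp h17 hs hcard hind

end SixPrime


end Literature.AlgebraicGeometry.Shioda1982
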